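import Mathlib
import Literature.Computability.AlgebraicComplexity.DepthThreeChasmAlgebra
import Literature.Computability.AlgebraicComplexity.NewtonPolygonTau
import Summits.ValiantsHypothesis.ValiantsHypothesis.Theses.NewtonUnitEquations
import Summits.ValiantsHypothesis.ValiantsHypothesis.Theorems.NewtonTauWeak.Negative.Zonogon
import Summits.ValiantsHypothesis.ValiantsHypothesis.Theorems.NewtonUnitEquationsNewtonTauWeakStubFischerStep
import Summits.ValiantsHypothesis.ValiantsHypothesis.Theorems.NewtonUnitEquationsNewtonTauWeakStubBinomialStep
import Summits.ValiantsHypothesis.ValiantsHypothesis.Theorems.NewtonUnitEquationsNewtonTauWeakStubCommonStep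
import Summits.ValiantsHypothesis.ValiantsHypothesis.Theorems.NewtonUnitEquationsNewtonTauWeakSeparatedRank
import Summits.ValiantsHypothesis.ValiantsHypothesis.Theorems.NewtonUnitEquationsNewtonTauWeakHexagonClasses
import Summits.ValiantsHypothesis.ValiantsHypothesis.Theorems.NewtonUnitEquationsNewtonTauWeakThreeRaySparsity
import Summits.ValiantsHypothesis.ValiantsHypothesis.Theorems.NewtonUnitEquationsNewtonTauWeakSepDeltaIter
import Summits.ValiantsHypothesis.ValiantsHypothesis.Theorems.NewtonUnitEquationsDissociatedUniformProductChart
import Summits.ValiantsHypothesis.ValiantsHypothesis.Theorems.NewtonUnitEquationsNewtonTauWeakHexagonClassesBinomial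
import Summits.ValiantsHypothesis.ValiantsHypothesis.Theorems.NewtonUnitEquationsNewtonTauWeakHexagonOnePlusSep
import Summits.ValiantsHypothesis.ValiantsHypothesis.Theorems.NewtonUnitEquationsNewtonTauWeakAutomatonGreedy
import Summits.ValiantsHypothesis.ValiantsHypothesis.Theorems.NewtonUnitEquationsNewtonTauWeakAutomatonStep
import Summits.ValiantsHypothesis.ValiantsHypothesis.Theorems.NewtonUnitEquationsNewtonTauWeakAutomatonGenDefs
import Summits.ValiantsHypothesis.ValiantsHypothesis.Theorems.NewtonUnitEquationsDissociatedUniformQuasiPoly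
import Summits.ValiantsHypothesis.ValiantsHypothesis.Theorems.NewtonUnitEquationsNewtonTauWeakLevelBound
import Summits.ValiantsHypothesis.ValiantsHypothesis.Theorems.NewtonUnitEquationsNewtonTauWeakAutomatonGenRecursion
import Summits.ValiantsHypothesis.ValiantsHypothesis.Theorems.NewtonUnitEquationsNewtonTauWeakAutomatonGenSupport
import Summits.ValiantsHypothesis.ValiantsHypothesis.Theorems.NewtonUnitEquationsNewtonTauWeakAutomatonGenAssembly
import Summits.ValiantsHypothesis.ValiantsHypothesis.Theorems.NewtonUnitEquationsNewtonTauWeakLevelsSps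
import Summits.ValiantsHypothesis.ValiantsHypothesis.Theorems.NewtonUnitEquationsNewtonTauWeakDissociatedQuasiShape
import Summits.ValiantsHypothesis.ValiantsHypothesis.Theorems.NewtonUnitEquationsNewtonTauWeakDigitFrame
import Summits.ValiantsHypothesis.ValiantsHypothesis.Theorems.NewtonUnitEquationsNewtonTauWeakAutomatonRadixDefs
import Summits.ValiantsHypothesis.ValiantsHypothesis.Theorems.NewtonUnitEquationsNewtonTauWeakAutomatonRadixCoeff
import Summits.ValiantsHypothesis.ValiantsHypothesis.Theorems.NewtonUnitEquationsNewtonTauWeakAutomatonRadixRecursion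
import Summits.ValiantsHypothesis.ValiantsHypothesis.Theorems.NewtonUnitEquationsNewtonTauWeakAutomatonRadixSupport
import Summits.ValiantsHypothesis.ValiantsHypothesis.Theorems.NewtonUnitEquationsNewtonTauWeakAutomatonBoxGreedy
import Summits.ValiantsHypothesis.ValiantsHypothesis.Theorems.NewtonUnitEquationsNewtonTauWeakAutomatonAnisoStep
import Summits.ValiantsHypothesis.ValiantsHypothesis.Theorems.NewtonUnitEquationsNewtonTauWeakAutomatonRadixAssembly
import Summits.ValiantsHypothesis.ValiantsHypothesis.Theorems.NewtonUnitEquationsNewtonTauWeakRadixFrame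
import Summits.ValiantsHypothesis.ValiantsHypothesis.Theorems.NewtonUnitEquationsNewtonTauWeakSignvecCount
import Summits.ValiantsHypothesis.ValiantsHypothesis.Theorems.NewtonUnitEquationsNewtonTauWeakResidueNormalForm
import Summits.ValiantsHypothesis.ValiantsHypothesis.Theorems.NewtonUnitEquationsNewtonTauWeakResidueDesignHull
import Summits.ValiantsHypothesis.ValiantsHypothesis.Theorems.NewtonUnitEquationsNewtonTauWeakMarkedSwitchNormalForm
import Summits.ValiantsHypothesis.ValiantsHypothesis.Theorems.NewtonUnitEquationsNewtonTauWeakResidueDesignT2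
import Summits.ValiantsHypothesis.ValiantsHypothesis.Theorems.NewtonUnitEquationsNewtonTauWeakMarkedDesignHull
import Summits.ValiantsHypothesis.ValiantsHypothesis.Theorems.NewtonUnitEquationsNewtonTauWeakWeightedNormalForm
import Summits.ValiantsHypothesis.ValiantsHypothesis.Theorems.NewtonUnitEquationsNewtonTauWeakZeroSumFreeCard
import Summits.ValiantsHypothesis.ValiantsHypothesis.Theorems.NewtonUnitEquationsNewtonTauWeakWeightedLevelSetHull
import Summits.ValiantsHypothesis.ValiantsHypothesis.Theorems.NewtonUnitEquationsNewtonTauWeakGradedDesignT2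
import Summits.ValiantsHypothesis.ValiantsHypothesis.Theorems.NewtonUnitEquationsNewtonTauWeakResidueWeightedNormalForm
import Summits.ValiantsHypothesis.ValiantsHypothesis.Theorems.NewtonUnitEquationsNewtonTauWeakResidueWeightedHull
import Summits.ValiantsHypothesis.ValiantsHypothesis.Theorems.NewtonUnitEquationsNewtonTauWeakClassPrefixHull
import Summits.ValiantsHypothesis.ValiantsHypothesis.Theorems.NewtonUnitEquationsNewtonTauWeakLevelSetOfT2
import Summits.ValiantsHypothesis.ValiantsHypothesis.Theorems.NewtonUnitEquationsNewtonTauWeakRefineDissociate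
import Summits.ValiantsHypothesis.ValiantsHypothesis.Theorems.NewtonUnitEquationsNewtonTauWeakWeightedNormalFormPinned
import Summits.ValiantsHypothesis.ValiantsHypothesis.Theorems.NewtonUnitEquationsNewtonTauWeakStubKernelBootstrapOfNF
import Summits.ValiantsHypothesis.ValiantsHypothesis.Theorems.NewtonUnitEquationsNewtonTauWeakSquareToPoly
import Summits.ValiantsHypothesis.ValiantsHypothesis.Theorems.NewtonUnitEquationsNewtonTauWeakCyclicT2Instance
import Summits.ValiantsHypothesis.ValiantsHypothesis.Theorems.NewtonUnitEquationsNewtonTauWeakUnionVertexBound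
import Summits.ValiantsHypothesis.ValiantsHypothesis.Theorems.NewtonUnitEquationsNewtonTauWeakLevelSetSplit
import Summits.ValiantsHypothesis.ValiantsHypothesis.Theorems.NewtonUnitEquationsNewtonTauWeakLevelVertsHalving
import Summits.ValiantsHypothesis.ValiantsHypothesis.Theorems.NewtonUnitEquationsNewtonTauWeakLevelVertsRecursion
import Summits.ValiantsHypothesis.ValiantsHypothesis.Theorems.NewtonUnitEquationsNewtonTauWeakSumsetChartCount
import Summits.ValiantsHypothesis.ValiantsHypothesis.Theorems.NewtonUnitEquationsNewtonTauWeakSignLevelSetOfT2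
import Summits.ValiantsHypothesis.ValiantsHypothesis.Theorems.NewtonUnitEquationsNewtonTauWeakMinkowskiVertexBoundOfChart
import Summits.ValiantsHypothesis.ValiantsHypothesis.Theorems.NewtonUnitEquationsNewtonTauWeakSignLevelSetOfT2All
import Summits.ValiantsHypothesis.ValiantsHypothesis.Theorems.NewtonUnitEquationsNewtonTauWeakOddCoverWeight
import Summits.ValiantsHypothesis.ValiantsHypothesis.Theorems.NewtonUnitEquationsNewtonTauWeakPenalisedFace
import Summits.ValiantsHypothesis.ValiantsHypothesis.Theorems.NewtonUnitEquationsNewtonTauWeakExactCoverShadow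
import Summits.ValiantsHypothesis.ValiantsHypothesis.Theorems.NewtonUnitEquationsNewtonTauWeakThreeCoreExposed
import Summits.ValiantsHypothesis.ValiantsHypothesis.Theorems.NewtonUnitEquationsNewtonTauWeakFourCoreSplitting
import Summits.ValiantsHypothesis.ValiantsHypothesis.Theorems.NewtonUnitEquationsNewtonTauWeakCoreSplitting
import Summits.ValiantsHypothesis.ValiantsHypothesis.Theorems.NewtonUnitEquationsNewtonTauWeakExposedChordUnique
import Summits.ValiantsHypothesis.ValiantsHypothesis.Theorems.NewtonUnitEquationsNewtonTauWeakSingleMovePairBound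
import Summits.ValiantsHypothesis.ValiantsHypothesis.Theorems.NewtonUnitEquationsNewtonTauWeakFourCoreChartRel
import Summits.ValiantsHypothesis.ValiantsHypothesis.Theorems.NewtonUnitEquationsNewtonTauWeakCoreSplittingRel
import Summits.ValiantsHypothesis.ValiantsHypothesis.Theorems.NewtonUnitEquationsNewtonTauWeakTwoCoreChartRel
import Summits.ValiantsHypothesis.ValiantsHypothesis.Theorems.NewtonUnitEquationsNewtonTauWeakCoreRelabel
import Summits.ValiantsHypothesis.ValiantsHypothesis.Theorems.NewtonUnitEquationsNewtonTauWeakCoreLogBound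
import Summits.ValiantsHypothesis.ValiantsHypothesis.Theorems.NewtonUnitEquationsNewtonTauWeakCoreDesignKillSwitch
import Summits.ValiantsHypothesis.ValiantsHypothesis.Theorems.NewtonUnitEquationsNewtonTauWeakTwoCorePerfect
import Summits.ValiantsHypothesis.ValiantsHypothesis.Theorems.NewtonUnitEquationsNewtonTauWeakAxialShadow

/-!
# Skeleton line `binomial-normal-form` for crux `NewtonTauWeak` (stmt-ValiantsHypothesis-5904)

Route `NewtonUnitEquations` (also wanted by `NewtonFrames`), crux r0 `NewtonTauWeak` =
`∃ a b, ∀ k m t (f : Fin k → Fin m → ℂ[X,Y]), (∀ i j, #supp f_ij ≤ t) → vert(Σ_i Π_j f_ij) ≤ 2^{a m}(k t+2)^b`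
(KPTT arXiv:1308.2286, Conj. 1 in the weak form of their Thm 1; `vert` = number of extreme points of the convex
hull of the support in `ℝ²`, the crux's literal subterm, landed as `Theorems.NewtonTauWeak.Negative.vert`).

## The line (crux idea card `Ideas/binomial-normal-form.md`, ideator 1; triage r1: 3 × pass)

LEVER: spend the free factor `2^{O(m)}` of the weak bound on the depth-3-chasm identities that are PROVED in
the tree (`Literature/Computability/AlgebraicComplexity/DepthThreeChasmAlgebra.lean`):

* Fischer (`DepthThreeChasm.fischer_inv`, GKKS TR13-026 Lemma 4.3): `Π_{j<m} f_j = (2^m m!)⁻¹ Σ_{ε∈{±1}^m}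
  (Π_j ε_j)(Σ_j ε_j f_j)^m` — a sum of `k` products of `m` `t`-sparse polynomials is a sum of `k·2^m` `m`-th
  POWERS of `(m t)`-sparse polynomials. Hence the crux is EQUIVALENT (in its weak shape) to its powers form
  (`stub_fischerStep`; the converse `powersBound_of_spsBound` is proved below). This is KPTT Thm 3's device and
  the shared first stub of the sibling cards `euler-wronskian-vdp` / `valued-rolle-wronskian` /
  `border-rank-near-purity` (triage: "file it ONCE") — it is filed here.
* Saxena duality (`DepthThreeChasm.exists_dual_weights`, `duality`, Lemma 4.6) + splitting over `ℂ`
  (`truncExp_eq_aeval`, `aeval_eq_leadingCoeff_mul_prod_roots`, Lemma 4.7), applied to the TERMS `c_v X^v`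
  of a `t`-sparse `g` rather than to variables: `g^m = Σ_{u ≤ m t} β_u Π_{v ∈ supp g} E_m(u c_v X^v)` and
  `E_m(λ X^v) = Π_{σ ≤ m} (1 - (λ/σ_σ) X^v)` (`E_m` = truncated exponential, `E_m(0) = 1`, roots `σ_σ ≠ 0`):
  a sum of `k` `m`-th powers of `t`-sparse polynomials is a sum of `K = k(m t+1)` products of `N = t·m`
  BINOMIALS `1 - ρ X^d` (`stub_binomialStep`).
* What is left is the binomial (`t = 2`) case of KPTT's Conjecture 1 in POLYNOMIAL form
  (`stub_binomialNewtonTau`, the card's `C⁺ = BinomialNewtonTau`): `vert(Σ_{l<K} c_l Π_{j<N}(1 - ρ_{lj}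
  X^{d_{lj}})) ≤ (K N + 2)^b`. Every frame is a cube `{0,1}^N ↦ Σ_{j∈J} d_j`, every coefficient a pure
  exponential `±c Π_{j∈J} ρ_j`, every factor vanishes on a torus coset; the parameter `t` is gone. OPEN and the
  hardest stub: at `K = 2` with common exponents it is the route's provable rung `BinomialPencil`
  (stmt-5908); in general it sits between the crux and the printed conjecture
  (`binomialNewtonTau_of_newtonTauConjecture` below: `KPTT.newtonTauConjecture → BinomialNewtonTau`, proved).

Composition (kernel-checked, no `sorry`): `NewtonTauWeak_of h₃ := ⟨6 b, 2 b, stub_fischerStep (2b) (2b) (stub_binomialStep b h_b)⟩`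
(stubs 1–2 LANDED in wave 1: p85961, p86119; only `stub_binomialNewtonTau` is open).
Constants: `stub_binomialStep` turns exponent `b` into `(a, b) = (2b, 2b)`; `stub_fischerStep` turns `(a, b)`
into `(a + 2b, b)`.

## Disproof used (`Cruxes/NewtonTauWeak/Disproof.lean`, cdisprove gen 1 v2 on the tree; landed part
`Theorems/NewtonTauWeak/Negative/Zonogon.lean`, imported here)

* `newtonTauWeak_false_without_sparsity` (§A) — HONOURED: sparsity is consumed by BOTH reduction stubs
  (`t' = m t` in Fischer, `N = t m`, `K = k(m t+1)` in duality); the open stub has no `t` at all — its role is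
  played by `N`, the number of binomial factors, which the bound `(K N+2)^b` charges polynomially.
* `not_newtonTauBoundNoM` / `two_mul_le_vert_zProd` (§C, landed) — HONOURED and re-checked here:
  `not_binomialBound_one` (proved below) shows the zonogon `Π_{j<m}(1 + X Y^j)` forces the exponent of
  `BinomialNewtonTau` to be `≥ 2`; the stub asks for `∃ b`, and every reduction keeps the `2^{O(m)}` factor
  (`m`-free claims are made for NO class of products).
* `not_newtonTauBoundNoK` / `not_newtonTauBoundNoT` (§B) — consistent: `K` and `N` both enter `(K N+2)^b`.
* §D/N2 (block transfer, kill target T2) and N1 (VP-shadow transfer) are untouched by this line (they concern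
  what the crux implies); N3 (shape of a counterexample: `m → ∞`, `t → ∞`, `k ≫ 1`) translates to: a
  counterexample to `stub_binomialNewtonTau` needs `K, N → ∞` with cancellation across products manufacturing
  all but `2 K N` of the vertices (`vert ≤ Σ_l 2N` without cancellation, Ostrowski + hull of a union).
* No `-- Targets` stub kill in Disproof.lean applies; no landed Negative lemma refutes an instance of a stub
  (`ledger negatives --problem ValiantsHypothesis`: 4 items, none on Newton polygons).
-/

set_option linter.dupNamespace false

noncomputable section

open scoped BigOperators
open MvPolynomial
open Summit.ValiantsHypothesis.ValiantsHypothesis.Theses.NewtonUnitEquations (NewtonTauWeak)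
open Summit.ValiantsHypothesis.ValiantsHypothesis.Theorems.NewtonTauWeak.Negative
  (vert vert_le_card_support v zFactor zProd succ_le_vert_zProd)

namespace Summit.ValiantsHypothesis.ValiantsHypothesis.Cruxes.NewtonTauWeak.BinomialNormalForm

/-! ### The statements of the line (named `Prop`s over existing declarations) -/

/-- The crux's bound with FIXED constants `(a, b)`: `vert(Σ_{i<k} Π_{j<m} f_ij) ≤ 2^{a m}(k t+2)^b` for
`t`-sparse `f_ij`. `NewtonTauWeak` is literally `∃ a b, SpsBound a b` (by `rfl`, see `NewtonTauWeak_of`). -/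
def SpsBound (a b : ℕ) : Prop :=
  ∀ (k m t : ℕ) (f : Fin k → Fin m → MvPolynomial (Fin 2) ℂ),
    (∀ i j, (f i j).support.card ≤ t) → vert (∑ i, ∏ j, f i j) ≤ 2 ^ (a * m) * (k * t + 2) ^ b

/-- POWERS FORM with fixed constants (KPTT Thm 3 shape): `vert(Σ_{i<k} c_i g_i^m) ≤ 2^{a m}(k t+2)^b` for
`t`-sparse `g_i` and scalars `c_i` (the scalars make Fischer's signs and constants free; for `m ≥ 1` they
could be absorbed into `g_i` over `ℂ`). -/
def PowersBound (a b : ℕ) : Prop :=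
  ∀ (k m t : ℕ) (c : Fin k → ℂ) (g : Fin k → MvPolynomial (Fin 2) ℂ),
    (∀ i, (g i).support.card ≤ t) → vert (∑ i, C (c i) * g i ^ m) ≤ 2 ^ (a * m) * (k * t + 2) ^ b

/-- BINOMIAL FORM with a fixed exponent (KPTT Conj. 1 at `t = 2`, polynomial shape): a sum of `K` scalar
multiples of products of `N` binomials `1 - ρ X^d` (`ρ = 0` allowed: padding) has `≤ (K N+2)^b` Newton
vertices. No `m` and no `t`: `N` plays the role of `m·t`. -/
def BinomialBound (b : ℕ) : Prop :=
  ∀ (K N : ℕ) (c : Fin K → ℂ) (ρ : Fin K → Fin N → ℂ) (d : Fin K → Fin N → (Fin 2 →₀ ℕ)),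
    vert (∑ l, C (c l) * ∏ j, (1 - C (ρ l j) * monomial (d l j) 1)) ≤ (K * N + 2) ^ b

/-- `PowersWeak` (card, T1): the powers form of the crux in the weak shape. Equivalent to the crux:
`⟸` is `powersBound_of_spsBound` (proved), `⟹` is `stub_fischerStep`. -/
def PowersWeak : Prop := ∃ a b : ℕ, PowersBound a b

/-- `BinomialNewtonTau` (card, `C⁺`, T2): KPTT's Conjecture 1 restricted to sums of products of binomials
`1 - ρ X^d`, `d ∈ ℕ²`, in polynomial form. Sandwiched: `KPTT.newtonTauConjecture → BinomialNewtonTau`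
(`binomialNewtonTau_of_newtonTauConjecture`, proved) and `BinomialNewtonTau → NewtonTauWeak` (this line). -/
def BinomialNewtonTau : Prop := ∃ b : ℕ, BinomialBound b

/-- COMMON-EXPONENT BINOMIAL FORM (reshape, cycle 1): the same bound for sums of `K` scalar multiples of
products of `N` binomials `1 - ρ_{lj} X^{d_j}` over ONE exponent list `d : Fin N → ℕ²` shared by all products
(`ρ_{lj} = 0` allowed). This is the normal form in which the coefficient of the word `J ⊆ [N]` is the value
`T(J) = Σ_l c_l Π_{j∈J} (-ρ_{lj})` of a RANK-`≤ K` tensor `T ∈ (ℂ²)^{⊗N}` pushed forward along the subset-sum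
map `J ↦ Σ_{j∈J} d_j` — the `t = 2` layer of the route's unit-equation/tensor-rank thesis, directly comparable
with `DissociatedUniform` (stmt-5905: the same with the subset-sum map injective). -/
def BinomialBoundCommon (b : ℕ) : Prop :=
  ∀ (K N : ℕ) (c : Fin K → ℂ) (ρ : Fin K → Fin N → ℂ) (d : Fin N → (Fin 2 →₀ ℕ)),
    vert (∑ l, C (c l) * ∏ j, (1 - C (ρ l j) * monomial (d j) 1)) ≤ (K * N + 2) ^ b

/-- `BinomialNewtonTauCommon`: the common-exponent binomial form with some exponent. EQUIVALENT to
`BinomialNewtonTau`: `⟸` is the specialisation `binomialBoundCommon_of_binomialBound` (proved below), `⟹` is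
`stub_commonStep` (pad every product with `ρ = 0` factors over the concatenated exponent list, `N ↦ K N`). -/
def BinomialNewtonTauCommon : Prop := ∃ b : ℕ, BinomialBoundCommon b

/-- Statement of STUB 1 (Fischer step, with explicit constants). -/
def FischerStep : Prop := ∀ a b : ℕ, PowersBound a b → SpsBound (a + 2 * b) b

/-- Statement of STUB 2 (duality + splitting step, with explicit constants). -/
def BinomialStep : Prop := ∀ b : ℕ, BinomialBound b → PowersBound (2 * b) (2 * b)

/-- Statement of STUB 3a (common-exponent step, with explicit constants). -/
def CommonStep : Prop := ∀ b : ℕ, BinomialBoundCommon b → BinomialBound (2 * b)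

/-! ### The registered stubs (statements inlined; `sorry` lives only here) -/

/-- STUB 1 (M, PROVABLE NOW) — **Fischer step**: a powers bound with constants `(a, b)` gives the crux's
bound with constants `(a + 2b, b)`. Proof to formalise: for each product apply
`DepthThreeChasm.fischer_inv (K := ℂ) (R := MvPolynomial (Fin 2) ℂ) (y := f i)`:
`Π_j f_ij = C((2^m m!)⁻¹) · Σ_{ε : Fin m → Fin 2} (Π_j (-1)^{ε_j}) (Σ_j (-1)^{ε_j} f_ij)^m`
(`Fintype.card (Fin m) = m`; `Π_j (-1 : R)^{ε_j} = C(±1)`); reindex `(i, ε) ∈ Fin k × (Fin m → Fin 2)` by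
`Fin (k * 2^m)` (`finProdFinEquiv`, `finFunctionFinEquiv`, `Equiv.sum_comp`); the signed sums are
`(m t)`-sparse (`support_sum`, `support_smul`/`C_mul'`, `Finset.card_biUnion_le`); apply the hypothesis with
`(k', m, t') = (k 2^m, m, m t)` and finish with `k 2^m m t + 2 ≤ 2^{2m}(k t+2)` (`m ≤ 2^m`), so
`2^{a m}(k 2^m m t+2)^b ≤ 2^{(a+2b) m}(k t+2)^b`. Degenerate `m = 0` (both sides constants, `vert ≤ 1`) is
covered by the same computation. [KPTT arXiv:1308.2286 Thm 3; GKKS TR13-026 Lemma 4.3; Fischer1994] -/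
theorem stub_fischerStep (a b : ℕ)
    (h : ∀ (k m t : ℕ) (c : Fin k → ℂ) (g : Fin k → MvPolynomial (Fin 2) ℂ),
      (∀ i, (g i).support.card ≤ t) → vert (∑ i, C (c i) * g i ^ m) ≤ 2 ^ (a * m) * (k * t + 2) ^ b)
    (k m t : ℕ) (f : Fin k → Fin m → MvPolynomial (Fin 2) ℂ) (hf : ∀ i j, (f i j).support.card ≤ t) :
    vert (∑ i, ∏ j, f i j) ≤ 2 ^ ((a + 2 * b) * m) * (k * t + 2) ^ b :=
  -- LANDED (wave 1, p85961): Theorems/NewtonUnitEquationsNewtonTauWeakStubFischerStep.lean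
  Summit.ValiantsHypothesis.ValiantsHypothesis.Theorems.NewtonUnitEquationsNewtonTauWeak.stub_fischerStep
    a b h k m t f hf

/-- STUB 2 (M/L, PROVABLE NOW) — **duality + splitting step** (the binomial normal form of a power): a
binomial bound with exponent `b` gives the powers bound with constants `(2b, 2b)`. Proof to formalise, for
`Σ_{i<k} c_i g_i^m` with `#supp g_i ≤ t`: write `g_i = Σ_{v ∈ supp g_i} monomial v (coeff v g_i)`
(`MvPolynomial.as_sum`); take `β := exists_dual_weights (N := m t) (W := m)` over `ℂ` and apply
`DepthThreeChasm.duality` with `ι := ↥(g_i).support` (`card ι · m ≤ m t`), `y v := monomial v (coeff v g_i)`: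
`g_i^m = Σ_{u : Fin (m t+1)} C(β_u) Π_{v} E_{m,u}(y_v)`; each factor is `truncExp_eq_aeval` with `e₀ = 1`,
`ℓ = monomial v 1`, `a = coeff v g_i`, `α = u`, i.e. `aeval (monomial v 1) G` for a univariate `G` with
`G(0) = 1` and `natDegree G ≤ m` (`natDegree_truncExp_le`); by `aeval_eq_leadingCoeff_mul_prod_roots`
(`ℂ` algebraically closed) `aeval ℓ G = C(lc G) Π_{σ ∈ roots G}(ℓ - C σ)`, all roots `σ ≠ 0` (as `G(0) = 1`),
and `lc G · Π_σ(-σ) = G(0) = 1`, so `aeval ℓ G = Π_{σ}(1 - C σ⁻¹ · monomial v 1)` — at most `m` binomials with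
the SAME exponent `v`; pad with `ρ = 0` to exactly `m` per `v` and to exactly `t` values of `v`
(`N = t m`, index `Fin t × Fin m ≃ Fin (t m)`), and index the products by `(i, u) ∈ Fin k × Fin (m t+1) ≃
Fin (k (m t+1))` with scalars `c_i β_u`. The hypothesis gives `vert ≤ (k(m t+1)·t m + 2)^b`, and
`k(m t+1) t m + 2 ≤ 4^m (k t+2)^2` (`m t+1 ≤ m(k t+2)` for `k, m ≥ 1`; `m²+1 ≤ 4^m`), so
`vert ≤ 2^{2b m}(k t+2)^{2b}`. Corners `k = 0`, `m = 0`, `t = 0` are covered (constants, `vert ≤ 1`).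
[GKKS TR13-026 Lemmas 4.6–4.7 = tree `duality`, `truncExp_eq_aeval`, `aeval_eq_leadingCoeff_mul_prod_roots`;
Saxena2008; card `binomial-normal-form` N2; triage r1-1/2/3 re-derivations] -/
theorem stub_binomialStep (b : ℕ)
    (h : ∀ (K N : ℕ) (c : Fin K → ℂ) (ρ : Fin K → Fin N → ℂ) (d : Fin K → Fin N → (Fin 2 →₀ ℕ)),
      vert (∑ l, C (c l) * ∏ j, (1 - C (ρ l j) * monomial (d l j) 1)) ≤ (K * N + 2) ^ b)
    (k m t : ℕ) (c : Fin k → ℂ) (g : Fin k → MvPolynomial (Fin 2) ℂ) (hg : ∀ i, (g i).support.card ≤ t) :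
    vert (∑ i, C (c i) * g i ^ m) ≤ 2 ^ (2 * b * m) * (k * t + 2) ^ (2 * b) :=
  -- LANDED (wave 1, p86119): Theorems/NewtonUnitEquationsNewtonTauWeakStubBinomialStep.lean
  Summit.ValiantsHypothesis.ValiantsHypothesis.Theorems.NewtonUnitEquationsNewtonTauWeak.stub_binomialStep
    b h k m t c g hg

/-- STUB 3a (S, LANDED p90067; reshape of cycle 1) — **common-exponent step**: the common-exponent bound with
exponent `b` gives the free-exponent bound with exponent `2b`. Proof to formalise: given `c, ρ, d` with
`d : Fin K → Fin N → ℕ²`, concatenate the exponent lists: `N' := K * N`, `d' (finProdFinEquiv (l', j)) := d l' j`,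
`ρ' l (finProdFinEquiv (l', j)) := if l' = l then ρ l j else 0`; then
`Π_{j'} (1 - C (ρ' l j') * monomial (d' j') 1) = Π_j (1 - C (ρ l j) * monomial (d l j) 1)` (the padded factors
are `1 - 0 = 1`; `Fintype.prod_equiv finProdFinEquiv`, `Fintype.prod_prod_type`, `Finset.prod_eq_single`-type
bookkeeping), so the two sums coincide and the hypothesis gives `vert ≤ (K (K N) + 2)^b ≤ ((K N + 2)^2)^b`. -/
theorem stub_commonStep (b : ℕ)
    (h : ∀ (K N : ℕ) (c : Fin K → ℂ) (ρ : Fin K → Fin N → ℂ) (d : Fin N → (Fin 2 →₀ ℕ)),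
      vert (∑ l, C (c l) * ∏ j, (1 - C (ρ l j) * monomial (d j) 1)) ≤ (K * N + 2) ^ b)
    (K N : ℕ) (c : Fin K → ℂ) (ρ : Fin K → Fin N → ℂ) (d : Fin K → Fin N → (Fin 2 →₀ ℕ)) :
    vert (∑ l, C (c l) * ∏ j, (1 - C (ρ l j) * monomial (d l j) 1)) ≤ (K * N + 2) ^ (2 * b) :=
  -- LANDED (wave 2, p90067): Theorems/NewtonUnitEquationsNewtonTauWeakStubCommonStep.lean
  Summit.ValiantsHypothesis.ValiantsHypothesis.Theorems.NewtonUnitEquationsNewtonTauWeak.stub_commonStep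
    b h K N c ρ d

/-- STUB 3b (XL, OPEN, HARDEST) — **`BinomialNewtonTauCommon`**, the card's `C⁺` in normal form: KPTT's
Conjecture 1 (arXiv:1308.2286 §2) for sums of `K` scalar multiples of products of binomials `1 - ρ_{lj} X^{d_j}`
over a COMMON exponent list `d_1, …, d_N ∈ ℕ²` (`ρ_{lj} ∈ ℂ`, zero allowed), polynomial in `K N`; equivalently
(`stub_commonStep` / `binomialBoundCommon_of_binomialBound`) for free exponents `d_{lj}`. In this form the
coefficient of the word `J ⊆ [N]` is `T(J) = Σ_{l<K} c_l Π_{j∈J}(-ρ_{lj})`, a rank-`≤ K` tensor on the `N`-cube,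
and `supp = {Σ_{j∈J} d_j : Σ_{J' ↦ same point} T(J') ≠ 0}`. STATUS: open; it implies the crux (this line, all
other steps LANDED) and is implied by the printed conjecture (`binomialNewtonTau_of_newtonTauConjecture`).
Known sub-cases (all in the tree): `K = 1` zonogon `≤ 2N` (attained: `not_binomialBound_one`); `K ≤ 2` for
EVERY exponent list (coinciding subset sums, zeros, scalars): `≤ 72(N+2)²` (`stub_binomialNewtonTauCommon_le_two`,
landed p97933 by lead c1, via the PROVED `t = 2` case `twoProducts_sparsity_le_two` of `TwoProducts`); separated
exponents (every `d_j` on an axis) `≤ 4K` for ALL coefficients (`vert_sum_mul_le_of_separated`, landed p89342 —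
so KPTT Example-3 digit frames host no counterexample); dissociated `d` (distinct subset sums) and FIXED `K`:
`≤ (2N+2)^{2K+3}` (instance `t = 2`, `m = N`, `A_j = {0, d_j}` of the PROVED crux `DissociatedFixedK`, stmt-5907);
`K = 2`, dissociated, all `ρ ≠ 0`: `O(N²)` (`BinomialPencil`, stmt-5908, PROVED); ALL `K`, every exponent list, the
LEVEL BOUND `vert ≤ 2(1 + Σ_j |a (d_j)₀ + b (d_j)₁|)` for every nonzero `(a,b) ∈ ℤ²` (`vert_binomialSum_le_levels`, landed
p105881 by lead c2 — so every frame of polynomial lattice width, e.g. the hexagon/block frames `(1,0),(0,1),(1,1)` with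
any multiplicities (`vert ≤ 2(N+1)`), is closed for all `K`, and a counterexample needs subset sums with super-polynomially
many values under EVERY integer functional); and the letter-thickness `< K` of the dissociated engine FAILS with
coincidences (`coincidenceDepth_sum_eq`, p105997: three alive products of `N = 4` binomials summing to ONE monomial at
letter distance `3 = K`). Open layers: FIXED `K ≥ 3` with coincidences on 2-dimensionally rich exponent lists (first open
rung; lead c2's direction-thickness plan LTC and a `K = 3` rigidity theorem under "no short 2-vs-1 direction relations"
in `Cruxes/NewtonTauWeak/Lines/binomial-normal-form-ltc.md`; corner Wronskian (W3) / Δ-Wronskian in `NOTES.md` §4, §7),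
dissociated `d` uniformly in `K` (= `DissociatedUniform`, stmt-5905, at `t = 2`), and coincidences uniformly in `K`
(= this stub). NEW (lead c3, 2026-08-16, global Δ-Wronskian rung, card
`Cruxes/NewtonTauWeak/Lines/binomial-normal-form-delta-global.md`; files `Theorems/…Hexagon*.lean`): every exponent list on
≤ 3 LINES through the origin is closed at every FIXED `K`, degree-free — `hex_vert_sum_three_le` (`K = 3`, `≤ 5000`),
`hex_vert_sum_hexagon_le_allK` (all `K`, `≤ 4 + 4K(K+1)(8 + 8·K!·2^{K·K})`), with the T2 instances
`hex_binomialCommon_three_rays` / `_three_directions` / `_rays_allK` / `_directions_allK` / `hex_fixedK_three_rays`, and two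
lines for ALL `K` (`hex_binomialCommon_two_directions`, `≤ 4K`); so the digit hexagon is closed at fixed `K`, and the
fixed-`K` residual is "≥ 4 directions with in-range 2-vs-1 relations, number of directions → ∞" (card Q1/Q3), plus the
`K`-uniform three-line question (card Q4). WHY IT MIGHT FAIL: `K = poly(N)`
designed products carving a long convex chain out of a mixed digit frame (this would refute KPTT Conj. 1 too;
"believed false": ChatterjeeGajjarTengse2022 Conj. 1.3, HrubesYehudayoff2021). Evidence (lead, cycle 1, exact
probe kit/fibre_probe_results.md): character/fibre designs `K = q ≤ 32`, 13 mixed frames, `N ≤ 28` (MITM) and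
`N ≤ 200` (profile DP): max `V/(K N) = 1.06`, best family `V = 3N - 6` (`K = 3`, frame `(j, j²)`), growth linear
in `N` at every `q`, no growth in `q`: nothing superlinear. [KPTT arXiv:1308.2286 Conj. 1, Thm 6, Prop. 1, §5;
KoiranPortierTavenasThomasse2015; arXiv:1903.11287; HrubesYehudayoff2021; ChatterjeeGajjarTengse2022 Conj. 1.3] -/
theorem stub_binomialNewtonTauCommon :
    ∃ b : ℕ, ∀ (K N : ℕ) (c : Fin K → ℂ) (ρ : Fin K → Fin N → ℂ) (d : Fin N → (Fin 2 →₀ ℕ)),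
      vert (∑ l, C (c l) * ∏ j, (1 - C (ρ l j) * monomial (d j) 1)) ≤ (K * N + 2) ^ b := by
  sorry

/-- Former STUB 3 (`BinomialNewtonTau`, free exponents) — now a CONSEQUENCE of stubs 3a + 3b. -/
theorem stub_binomialNewtonTau :
    ∃ b : ℕ, ∀ (K N : ℕ) (c : Fin K → ℂ) (ρ : Fin K → Fin N → ℂ) (d : Fin K → Fin N → (Fin 2 →₀ ℕ)),
      vert (∑ l, C (c l) * ∏ j, (1 - C (ρ l j) * monomial (d l j) 1)) ≤ (K * N + 2) ^ b := by
  obtain ⟨b, hb⟩ := stub_binomialNewtonTauCommon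
  exact ⟨2 * b, stub_commonStep b hb⟩

/-! ### Consistency: each named statement IS its registered stub (definitionally) -/

theorem fischerStep_holds : FischerStep := stub_fischerStep
theorem binomialStep_holds : BinomialStep := stub_binomialStep
theorem commonStep_holds : CommonStep := stub_commonStep
theorem binomialNewtonTauCommon_holds : BinomialNewtonTauCommon := stub_binomialNewtonTauCommon
theorem binomialNewtonTau_holds : BinomialNewtonTau := stub_binomialNewtonTau

/-- The reshape loses nothing: the free-exponent bound specialises to the common-exponent bound (same `b`). -/
theorem binomialBoundCommon_of_binomialBound {b : ℕ} (h : BinomialBound b) : BinomialBoundCommon b :=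
  fun K N c ρ d => h K N c ρ (fun _ j => d j)

/-- Hence `BinomialNewtonTau ↔ BinomialNewtonTauCommon` (modulo the provable stub 3a for `←`). -/
theorem binomialNewtonTauCommon_of_binomialNewtonTau (h : BinomialNewtonTau) : BinomialNewtonTauCommon := by
  obtain ⟨b, hb⟩ := h
  exact ⟨b, binomialBoundCommon_of_binomialBound hb⟩

/-! ### Rung stubs of lead c4 (K-UNIFORM three-ray regime; registered helper stubs, NOT used by the composition)

These are provable rungs toward `stub_binomialNewtonTauCommon` in the regime "three rays, number of products → ∞"
(card `Cruxes/NewtonTauWeak/PICKED.md`, lead c4).  Each lands as its own `--supports` file under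
`Theorems/NewtonUnitEquationsNewtonTauWeak*.lean`; all LANDED (lead c4, waves 1–2, 2026-08-16): the bodies below are the tree theorems. -/
namespace RungC4

/-- STUB C4-1 (M, LANDED p122610) — **class theorem**: the homogeneous Δ-Wronskian of
`…HexagonAllK` run over the `q` CLASSES of three-ray products sharing a diagonal factor (`D (cls i)`), instead of over
the `k` products: the class sums `M_l = Σ_{cls i = l} X_i·Y_i` are separated of rank `≤ k`, the Wronskian minors are
(diagonal) × (separated of rank `≤ q!·2^{q·q}·k^q`) (generalised `hex_structure_minor`), and the dichotomy/root-count of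
`hex_vert_sum_hexagon_le_allK` goes through verbatim.  POLYNOMIAL in `k` for every fixed `q` (q = 1: linear; `k`
hexagon products with a common diagonal factor, or one hexagon product plus `k - 1` separated products, `D = 1` being
diagonal). [folklore: Wronskian method] -/
theorem stub_hexClasses (k q : ℕ) (cls : Fin k → Fin q)
    (X Y : Fin k → MvPolynomial (Fin 2) ℂ) (D : Fin q → MvPolynomial (Fin 2) ℂ)
    (hX : ∀ i, ∀ e ∈ (X i).support, e 1 = 0) (hY : ∀ i, ∀ e ∈ (Y i).support, e 0 = 0)
    (hD : ∀ l, ∀ e ∈ (D l).support, e 0 = e 1) :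
    vert (∑ i, X i * Y i * D (cls i)) ≤
      4 + 4 * q * (q + 1) * (8 + 8 * (Nat.factorial q * 2 ^ (q * q) * k ^ q)) :=
  -- LANDED p122610 (…Theorems/NewtonUnitEquationsNewtonTauWeakHexagonClasses.lean)
  Summit.ValiantsHypothesis.ValiantsHypothesis.Theorems.NewtonUnitEquationsNewtonTauWeak.stub_hexClasses k q cls X Y D hX hY hD

/-- STUB C4-2 (S, LANDED p122888) — **k-uniform sparsity-rank remark**: expanding each diagonal factor into its
monomials writes `Σ_i X_i·Y_i·D_i` as a sum of `Σ_i #supp D_i` separated products `(x^c X_i)·(y^c Y_i)`, so the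
separated rank bound (`vert_sum_mul_le_of_separated`, p89342) gives `vert ≤ 4·Σ_i #supp D_i` — uniformly in the number
of products and in all degrees (by the symmetry of the three rays the same holds with `X` or `Y` in place of `D`).
[folklore] -/
theorem stub_threeRaySparsity (k : ℕ) (X Y D : Fin k → MvPolynomial (Fin 2) ℂ)
    (hX : ∀ i, ∀ e ∈ (X i).support, e 1 = 0) (hY : ∀ i, ∀ e ∈ (Y i).support, e 0 = 0)
    (hD : ∀ i, ∀ e ∈ (D i).support, e 0 = e 1) :
    vert (∑ i, X i * Y i * D i) ≤ 4 * ∑ i, (D i).support.card :=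
  -- LANDED p122888 (…Theorems/NewtonUnitEquationsNewtonTauWeakThreeRaySparsity.lean)
  Summit.ValiantsHypothesis.ValiantsHypothesis.Theorems.NewtonUnitEquationsNewtonTauWeak.stub_threeRaySparsity k X Y D hX hY hD

/-- STUB C4-3 (S, LANDED p123180) — **Leibniz iterate keeps separated rank linear**: for the direction-killing Euler
derivation `Δ` (coefficient law + Leibniz as hypotheses, as in `…HexagonSeparated`), `Δ^n(Σ_{r<R} P_r Q_r) =
Σ_r Σ_{j≤n} C(n,j) Δ^j P_r · Δ^{n-j} Q_r` is separated of rank `≤ (n+1)·R` (not `2^n·R`): the Wronskian minors of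
`H_K` then have rank `≤ K!·(K+1)!`, i.e. `H_K = K^{O(K)}`. [folklore] -/
theorem stub_sepDeltaIter (Δ : MvPolynomial (Fin 2) ℂ → MvPolynomial (Fin 2) ℂ)
    (hΔ : ∀ p e, coeff e (Δ p) = (((e 0 : ℕ) : ℂ) - ((e 1 : ℕ) : ℂ)) * coeff e p)
    (hL : ∀ p q, Δ (p * q) = Δ p * q + p * Δ q)
    {R : ℕ} {m : MvPolynomial (Fin 2) ℂ} (n : ℕ)
    (hm : ∃ P Q : Fin R → MvPolynomial (Fin 2) ℂ, (∀ r, ∀ e ∈ (P r).support, e 1 = 0) ∧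
      (∀ r, ∀ e ∈ (Q r).support, e 0 = 0) ∧ m = ∑ r, P r * Q r) :
    ∃ P Q : Fin ((n + 1) * R) → MvPolynomial (Fin 2) ℂ, (∀ r, ∀ e ∈ (P r).support, e 1 = 0) ∧
      (∀ r, ∀ e ∈ (Q r).support, e 0 = 0) ∧ (Δ^[n]) m = ∑ r, P r * Q r :=
  -- LANDED p123180 (…Theorems/NewtonUnitEquationsNewtonTauWeakSepDeltaIter.lean)
  Summit.ValiantsHypothesis.ValiantsHypothesis.Theorems.NewtonUnitEquationsNewtonTauWeak.stub_sepDeltaIter Δ hΔ hL n hm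


/-! #### Wave 2 (lead c4): corollaries of the class theorem, and the CARRY-AUTOMATON rung (K-uniform quasi-polynomial
bound on the digit hexagon; card `Cruxes/NewtonTauWeak/Lines/binomial-normal-form-automaton.md`).  The automaton stubs
C4-4/C4-5 are ABSTRACT (any vector configuration on a digit box whose linear image is the coefficient array / which is a
linear image of the Kronecker product of two half-configurations) and reuse Theorem Q's greedy-shadow engine
(`QuasiPoly.cshadow`, `configShadow_prod_le`, crux 5905 files …DissociatedUniformGreedyCharts/ProductChart.lean). -/

/-- STUB C4-8 (S, PROVABLE NOW) — **T2-shaped class corollary**: binomial products over a common exponent list on the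
three model rays whose DIAGONAL coefficient rows take at most `q` values (`ρ l j = ρD (cls l) j` on diagonal `j`) have
`≤ 4 + 4q(q+1)(8 + 8·q!·2^{q·q}·K^q)` Newton vertices — polynomial in `K` for fixed `q` (split each product by ray as in
`hex_binomialCommon_rays_allK`, then `stub_hexClasses`). [folklore] -/
theorem stub_hexClassesBinomial (K N q : ℕ) (cls : Fin K → Fin q) (c : Fin K → ℂ) (ρ : Fin K → Fin N → ℂ)
    (ρD : Fin q → Fin N → ℂ) (d : Fin N → (Fin 2 →₀ ℕ))
    (hd : ∀ j, (d j) 1 = 0 ∨ (d j) 0 = 0 ∨ (d j) 0 = (d j) 1)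
    (hρ : ∀ l j, (d j) 1 ≠ 0 → (d j) 0 ≠ 0 → ρ l j = ρD (cls l) j) :
    vert (∑ l, C (c l) * ∏ j, (1 - C (ρ l j) * monomial (d j) 1)) ≤
      4 + 4 * q * (q + 1) * (8 + 8 * (Nat.factorial q * 2 ^ (q * q) * K ^ q)) :=
  -- LANDED p124505 (…Theorems/NewtonUnitEquationsNewtonTauWeakHexagonClassesBinomial.lean)
  Summit.ValiantsHypothesis.ValiantsHypothesis.Theorems.NewtonUnitEquationsNewtonTauWeak.stub_hexClassesBinomial K N q cls c ρ ρD d hd hρ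

/-- STUB C4-9 (S, PROVABLE NOW) — **one hexagon product plus separated products**: `vert(X·Y·D + Σ_{i<r} A_i B_i) ≤
4 + 24(8 + 8·2·16·(r+1)²)` — LINEAR algebraic dependence on the number `r` of separated summands (class theorem with
`q = 2` classes: `D` and `1`). [folklore] -/
theorem stub_hexOnePlusSep (r : ℕ) (X Y D : MvPolynomial (Fin 2) ℂ) (A B : Fin r → MvPolynomial (Fin 2) ℂ)
    (hX : ∀ e ∈ X.support, e 1 = 0) (hY : ∀ e ∈ Y.support, e 0 = 0) (hD : ∀ e ∈ D.support, e 0 = e 1)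
    (hA : ∀ i, ∀ e ∈ (A i).support, e 1 = 0) (hB : ∀ i, ∀ e ∈ (B i).support, e 0 = 0) :
    vert (X * Y * D + ∑ i, A i * B i) ≤ 4 + 4 * 2 * (2 + 1) * (8 + 8 * (Nat.factorial 2 * 2 ^ (2 * 2) * (r + 1) ^ 2)) :=
  -- LANDED p124655 (…Theorems/NewtonUnitEquationsNewtonTauWeakHexagonOnePlusSep.lean)
  Summit.ValiantsHypothesis.ValiantsHypothesis.Theorems.NewtonUnitEquationsNewtonTauWeak.stub_hexOnePlusSep r X Y D A B hX hY hD hA hB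

/-- STUB C4-4 (M, PROVABLE NOW) — **top survivors are greedy** (automaton rung, abstract form): if the coefficient
array of `f` on `[0, 2^{n+1})²` is a linear image `coeff_{2^n t + P} f = ℓ_t (x P)` of a vector configuration `x` on the
digit box `E = [0,2^n)²`, then every Newton vertex `2^n t + P₀` of `f` has `P₀` lex-greedy for an injective direction
(`ℓ_t` kills the vectors of all heavier `P`), so `vert f ≤ 4·|cshadow E x|` (`stub_exposedGenericDirection` for the
direction). [folklore: Theorem Q, part "top survivor is greedy"] -/
theorem stub_autoGreedy {d : ℕ} (n : ℕ) (E : Finset (ℕ × ℕ))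
    (hE : E = Finset.range (2 ^ n) ×ˢ Finset.range (2 ^ n))
    (f : MvPolynomial (Fin 2) ℂ) (x : ℕ × ℕ → Fin d → ℂ) (ℓ : Fin 2 × Fin 2 → (Fin d → ℂ) →ₗ[ℂ] ℂ)
    (hsupp : ∀ e ∈ f.support, e 0 < 2 ^ (n + 1) ∧ e 1 < 2 ^ (n + 1))
    (hcoeff : ∀ t : Fin 2 × Fin 2, ∀ P ∈ E,
      coeff (Finsupp.single 0 (2 ^ n * (t.1 : ℕ) + P.1) + Finsupp.single 1 (2 ^ n * (t.2 : ℕ) + P.2)) f =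
        ℓ t (x P)) :
    vert f ≤ 4 * (Summit.ValiantsHypothesis.ValiantsHypothesis.Theorems.NewtonUnitEquationsDissociatedUniform.QuasiPoly.cshadow
      E x (fun P => ((P.1 : ℕ) : ℝ)) (fun P => ((P.2 : ℕ) : ℝ))).ncard :=
  -- LANDED p124161 (…Theorems/NewtonUnitEquationsNewtonTauWeakAutomatonGreedy.lean)
  Summit.ValiantsHypothesis.ValiantsHypothesis.Theorems.NewtonTauWeakAutomaton.stub_autoGreedy n E hE f x ℓ hsupp hcoeff

/-- STUB C4-5 (M, PROVABLE NOW) — **bilinear product step** (automaton rung, abstract form): if the configuration `x`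
on the box `[0,2^{h+m})²` is, along the bijection `(H, L) ↦ 2^h H + L`, a linear image `π` of the Kronecker product of a
configuration `x₁` on `[0,2^m)²` (high digits) and `x₂` on `[0,2^h)²` (low digits), then its shadow is bounded by
Theorem Q's product step (`configShadow_prod_le` with `k = d²`: Kronecker = Hadamard after `u ↦ u ⊗ 𝟙`, `v ↦ 𝟙 ⊗ v`;
greedy sets pull back along linear maps of the vectors and are invariant under positive rescaling of positions):
`|cshadow x| ≤ 2 d⁴(d² s₁ + d² s₂ + 1) + 2d² + 1`. [folklore: Theorem Q, product step] -/
theorem stub_autoStep {d : ℕ} (h m : ℕ) (E E₁ E₂ : Finset (ℕ × ℕ))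
    (hE : E = Finset.range (2 ^ (h + m)) ×ˢ Finset.range (2 ^ (h + m)))
    (hE₁ : E₁ = Finset.range (2 ^ m) ×ˢ Finset.range (2 ^ m))
    (hE₂ : E₂ = Finset.range (2 ^ h) ×ˢ Finset.range (2 ^ h))
    (x x₁ x₂ : ℕ × ℕ → Fin d → ℂ) (π : (Fin (d * d) → ℂ) →ₗ[ℂ] (Fin d → ℂ))
    (hx : ∀ H ∈ E₁, ∀ L ∈ E₂, x (2 ^ h * H.1 + L.1, 2 ^ h * H.2 + L.2) =
      π (fun ij => x₁ H (finProdFinEquiv.symm ij).1 * x₂ L (finProdFinEquiv.symm ij).2)) :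
    (Summit.ValiantsHypothesis.ValiantsHypothesis.Theorems.NewtonUnitEquationsDissociatedUniform.QuasiPoly.cshadow
        E x (fun P => ((P.1 : ℕ) : ℝ)) (fun P => ((P.2 : ℕ) : ℝ))).ncard ≤
      2 * (d * d * (d * d) * (d * d *
          (Summit.ValiantsHypothesis.ValiantsHypothesis.Theorems.NewtonUnitEquationsDissociatedUniform.QuasiPoly.cshadow
            E₁ x₁ (fun P => ((P.1 : ℕ) : ℝ)) (fun P => ((P.2 : ℕ) : ℝ))).ncard +
        d * d *
          (Summit.ValiantsHypothesis.ValiantsHypothesis.Theorems.NewtonUnitEquationsDissociatedUniform.QuasiPoly.cshadow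
            E₂ x₂ (fun P => ((P.1 : ℕ) : ℝ)) (fun P => ((P.2 : ℕ) : ℝ))).ncard + 1)) +
        d * d + d * d + 1 :=
  -- LANDED p124383 (…Theorems/NewtonUnitEquationsNewtonTauWeakAutomatonStep.lean)
  Summit.ValiantsHypothesis.ValiantsHypothesis.Theorems.NewtonTauWeakAutomaton.stub_autoStep h m E E₁ E₂ hE hE₁ hE₂ x x₁ x₂ π hx

end RungC4

/-! ### Rung stubs of lead c5 (THEOREM B = general digit frames, K-uniform; crux-language bookkeeping rungs)

Registered helper stubs, NOT used by the composition (card `Cruxes/NewtonTauWeak/PICKED.md`, lead c5).  Each lands as its own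
`--supports` file.  C5-1/C5-2 are lead c4's registered Theorem-B stubs (GenDefs p126524, GreedyGen p126648, GenCoeff p127118
landed); C5-3 is the Theorem-B assembly; C5-4/C5-5 record, in the CRUX language (few factors `m`, sparsity `t` separate — the
shape KPTT's printed Thm 1 accepts, cf. `Cruxes/NewtonTauWeak/AdmissibleRetarget.lean`), the two regimes already closed:
polynomial lattice width (level bound) and dissociated frames (Theorem Q, with NO `2^{am}` factor). -/
namespace RungC5

open Summit.ValiantsHypothesis.ValiantsHypothesis.Theorems.NewtonTauWeakAutomaton
  (genVecFin genContract shiftLev genSum radBox radN radVecFin radProd radSum radExpand)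

/-- STUB C5-1 (M, LANDED p127732; registered by lead c4 as `stub_genRecursion`, target
`Theorems/NewtonUnitEquationsNewtonTauWeakAutomatonGenRecursion.lean`) — **bilinear self-similarity of the general carry
automaton**: reading the levels `[0,h+m)` of `P = 2^h H + L` is reading `[0,h)` of `L`, then `[0,m)` of `H` with the level
polynomials shifted by `h`; `genContract` is blockwise matrix multiplication (verbatim generalisation of `stub_autoRecursion`,
…AutomatonRecursion.lean, from `hexN/hexVecFin/hexContract/shiftPar` to `genN/genVecFin/genContract/shiftLev`). [folklore] -/
theorem stub_genRecursion (k C h m : ℕ) (G : Fin k → ℕ → MvPolynomial (Fin 2) ℂ) (H L : ℕ × ℕ)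
    (hL : L.1 < 2 ^ h ∧ L.2 < 2 ^ h) :
    genVecFin k C G 0 (h + m) (2 ^ h * H.1 + L.1, 2 ^ h * H.2 + L.2) =
      genContract k C (fun ij => genVecFin k C (shiftLev G h) 0 m H (finProdFinEquiv.symm ij).1 *
        genVecFin k C G 0 h L (finProdFinEquiv.symm ij).2) :=
  -- LANDED p127732 (…Theorems/NewtonUnitEquationsNewtonTauWeakAutomatonGenRecursion.lean, lead c5 wave 1)
  Summit.ValiantsHypothesis.ValiantsHypothesis.Theorems.NewtonTauWeakAutomaton.stub_genRecursion k C h m G H L hL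

/-- STUB C5-2 (S/M, LANDED p127873; registered by lead c4 as `stub_genSupport`, target
`Theorems/NewtonUnitEquationsNewtonTauWeakAutomatonGenSupport.lean`) — **support of the general digit-scaled sum**: every
exponent of `genSum k n c G = Σ_l c_l Π_{i<n} G_{l,i}(x^{2^i}, y^{2^i})` with `deg G_{l,i} ≤ C` in each variable lies in
`[0, 2^n (C+1))²` (induction on `n`: `supp (expand (2^i) G) = 2^i · supp G`, `support_mul`, `Σ_{i<n} 2^i C < 2^n (C+1)`;
generalises `stub_autoSupport`). [folklore] -/
theorem stub_genSupport (k C n : ℕ) (c : Fin k → ℂ) (G : Fin k → ℕ → MvPolynomial (Fin 2) ℂ)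
    (hG : ∀ l i, ∀ e ∈ (G l i).support, e 0 ≤ C ∧ e 1 ≤ C) :
    ∀ e ∈ (genSum k n c G).support, e 0 < 2 ^ n * (C + 1) ∧ e 1 < 2 ^ n * (C + 1) :=
  -- LANDED p127873 (…Theorems/NewtonUnitEquationsNewtonTauWeakAutomatonGenSupport.lean, lead c5 wave 1)
  Summit.ValiantsHypothesis.ValiantsHypothesis.Theorems.NewtonTauWeakAutomaton.stub_genSupport k C n c G hG

/-- STUB C5-3 (M, LANDED p128432; target `Theorems/NewtonUnitEquationsNewtonTauWeakAutomatonGenAssembly.lean`) —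
**THEOREM B (K-uniform quasi-polynomial bound on every digit frame with bounded level degree)**: for every number `k` of
products, `vert(genSum k n c G) ≤ (C+1)² · 4 · A^{⌈log₂ n⌉}`, `A = 4D³ + 2D² + 2D + 2`, `D = (k (C+1)⁴)²`.  Proof = the
assembly of Theorem A (…AutomatonAssembly.lean) verbatim with `stub_autoGreedyGen` (p126648), `stub_genCoeff` (p127118),
`stub_genRecursion`, `stub_genSupport` and the abstract product step `stub_autoStep` (p124383) at `d = k (C+1)⁴`.
[folklore: carry automaton + Theorem Q's product step] -/
theorem stub_genAssembly (k C n : ℕ) (c : Fin k → ℂ) (G : Fin k → ℕ → MvPolynomial (Fin 2) ℂ)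
    (hG : ∀ l i, ∀ e ∈ (G l i).support, e 0 ≤ C ∧ e 1 ≤ C) :
    vert (genSum k n c G) ≤ (C + 1) * (C + 1) * (4 *
      (4 * (k * ((C + 1) * (C + 1) * ((C + 1) * (C + 1))) * (k * ((C + 1) * (C + 1) * ((C + 1) * (C + 1))))) ^ 3 +
        2 * (k * ((C + 1) * (C + 1) * ((C + 1) * (C + 1))) * (k * ((C + 1) * (C + 1) * ((C + 1) * (C + 1))))) ^ 2 +
        2 * (k * ((C + 1) * (C + 1) * ((C + 1) * (C + 1))) * (k * ((C + 1) * (C + 1) * ((C + 1) * (C + 1))))) + 2) ^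
      Nat.clog 2 n) :=
  -- LANDED p128432 (…Theorems/NewtonUnitEquationsNewtonTauWeakAutomatonGenAssembly.lean, lead c5 wave 1) = THEOREM B
  Summit.ValiantsHypothesis.ValiantsHypothesis.Theorems.NewtonTauWeakAutomaton.stub_genAssembly k C n c G hG

/-- STUB C5-4 (S/M, LANDED p128041; target `Theorems/NewtonUnitEquationsNewtonTauWeakLevelsSps.lean`) — **the level bound in
the crux's language**: if, for a nonzero integer functional `ℓ = a x₀ + b x₁`, the supports of the factors `f i j` lie in level
windows `[lo j, hi j]` (the same window for all products `i`), then every exponent of `Σ_i Π_j f i j` has level in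
`[Σ lo, Σ hi]`, so (`vert_le_two_mul_card_levels`, p105881) `vert ≤ 2 · ((Σ_j (hi j - lo j)).toNat + 1)`: the crux is a THEOREM,
with `a = 0, b = 1`, on every frame of polynomial lattice width in some direction. [folklore] -/
theorem stub_levelsSps (k m : ℕ) (f : Fin k → Fin m → MvPolynomial (Fin 2) ℂ) (a b : ℤ) (hab : a ≠ 0 ∨ b ≠ 0)
    (lo hi : Fin m → ℤ)
    (hwin : ∀ i j, ∀ e ∈ (f i j).support, lo j ≤ a * (e 0 : ℤ) + b * (e 1 : ℤ) ∧ a * (e 0 : ℤ) + b * (e 1 : ℤ) ≤ hi j) :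
    vert (∑ i, ∏ j, f i j) ≤ 2 * ((∑ j, (hi j - lo j)).toNat + 1) :=
  -- LANDED p128041 (…Theorems/NewtonUnitEquationsNewtonTauWeakLevelsSps.lean, lead c5 wave 1)
  Summit.ValiantsHypothesis.ValiantsHypothesis.Theorems.NewtonUnitEquationsNewtonTauWeak.stub_levelsSps k m f a b hab lo hi hwin

/-- STUB C5-5 (S, LANDED p128052; target `Theorems/NewtonUnitEquationsNewtonTauWeakDissociatedQuasiShape.lean`) — **Theorem Q
in the admissible crux shape, with no `2^{am}` factor**: on a dissociated frame (`≤ t` letters per factor, injective sum map)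
`vert(Σ_{i<k} Π_{j<m} f i j) ≤ (k t + 2)^{7 ⌈log₂ (m+2)⌉}` (from `dissociated_quasiPoly`: `(t+2)(8(k+2)³)^{⌈log₂ m⌉}` with
`t + 2 ≤ kt + 2`, `8(k+2)³ ≤ (kt+2)⁶` for `k, t ≥ 1`; `k = 0` or `t = 0 < m` make the sum vanish, `m = 0` makes it constant).
This is the shape `2^{a m}(kt+2)^{b⌈log₂(m+2)⌉}` of `NewtonTauQuasi` (Cruxes/NewtonTauWeak/AdmissibleRetarget.lean) with
`a = 0`. [folklore] -/
theorem stub_dissociatedQuasiShape (k m t : ℕ) (A : Fin m → Finset (Fin 2 →₀ ℕ))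
    (f : Fin k → Fin m → MvPolynomial (Fin 2) ℂ) (hcard : ∀ j, (A j).card ≤ t)
    (hsupp : ∀ i j, (f i j).support ⊆ A j)
    (hdis : ∀ u v : Fin m → (Fin 2 →₀ ℕ), (∀ j, u j ∈ A j) → (∀ j, v j ∈ A j) → ∑ j, u j = ∑ j, v j → u = v) :
    vert (∑ i, ∏ j, f i j) ≤ (k * t + 2) ^ (7 * Nat.clog 2 (m + 2)) :=
  -- LANDED p128052 (…Theorems/NewtonUnitEquationsNewtonTauWeakDissociatedQuasiShape.lean, lead c5 wave 1)
  Summit.ValiantsHypothesis.ValiantsHypothesis.Theorems.NewtonUnitEquationsNewtonTauWeak.stub_dissociatedQuasiShape k m t A f hcard hsupp hdis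

/-- STUB C5-6 (M, LANDED p128954; target `Theorems/NewtonUnitEquationsNewtonTauWeakDigitFrame.lean`) — **THEOREM B in (near-)crux
language: every DIGIT FRAME**.  `k` products of `m` factors `f_{lj} = g_{lj}(x^{2^{lev j}}, y^{2^{lev j}})` (`MvPolynomial.expand`), at most
`r` factors per level, digit polynomials of degree `≤ c` in each variable: `vert ≤ (rc+1)²·4·A^{⌈log₂ n⌉}`, `A = 4D³+2D²+2D+2`,
`D = (k (rc+1)⁴)²` — uniformly in `k`.  Proof: regroup by level (`Finset.prod_fiberwise`, `map_prod` for the ring hom `expand`):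
`Π_j f_{lj} = genProd (G l) n` with `G l i = Π_{lev j = i} g_{lj}` of degree `≤ r c` per variable (support of a product ⊆ sum of
supports), then `stub_genAssembly` (p128432) with `C = r c` and scalars `1`. [folklore] -/
theorem stub_digitFrameQuasiPoly (k m n r c : ℕ) (lev : Fin m → Fin n)
    (hmult : ∀ i : Fin n, (Finset.univ.filter fun j => lev j = i).card ≤ r)
    (g : Fin k → Fin m → MvPolynomial (Fin 2) ℂ) (hdeg : ∀ l j, ∀ e ∈ (g l j).support, e 0 ≤ c ∧ e 1 ≤ c) :
    vert (∑ l, ∏ j, MvPolynomial.expand (2 ^ (lev j : ℕ)) (g l j)) ≤ (r * c + 1) * (r * c + 1) * (4 *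
      (4 * (k * ((r * c + 1) * (r * c + 1) * ((r * c + 1) * (r * c + 1))) *
            (k * ((r * c + 1) * (r * c + 1) * ((r * c + 1) * (r * c + 1))))) ^ 3 +
        2 * (k * ((r * c + 1) * (r * c + 1) * ((r * c + 1) * (r * c + 1))) *
            (k * ((r * c + 1) * (r * c + 1) * ((r * c + 1) * (r * c + 1))))) ^ 2 +
        2 * (k * ((r * c + 1) * (r * c + 1) * ((r * c + 1) * (r * c + 1))) *
            (k * ((r * c + 1) * (r * c + 1) * ((r * c + 1) * (r * c + 1))))) + 2) ^
      Nat.clog 2 n) :=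
  -- LANDED p128954 (…Theorems/NewtonUnitEquationsNewtonTauWeakDigitFrame.lean, lead c5 wave 2)
  Summit.ValiantsHypothesis.ValiantsHypothesis.Theorems.NewtonTauWeakAutomaton.stub_digitFrameQuasiPoly k m n r c lev hmult g hdeg

/-- STUB C5-7 (S, LANDED p128954, same target file as C5-6) — **the digit-frame bound in the admissible quasi shape**: under the
hypotheses of `stub_digitFrameQuasiPoly`, `vert ≤ (k (rc+1) + 2)^{38 ⌈log₂(n+2)⌉}` — quasi-polynomial with the logarithm on the
number of LEVELS only (KPTT-admissible: exponent `log k · log n`), no `2^{am}` factor.  Arithmetic from C5-6 (`k = 0`: empty sum;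
`k ≥ 1`: `rc+1 ≤ X := k(rc+1)+2`, `D ≤ X^{10}`, `A ≤ 10 D³ ≤ X^{34}`, `(rc+1)²·4 ≤ X⁴`, `⌈log₂ n⌉ ≤ ⌈log₂(n+2)⌉ ≥ 1`). [folklore] -/
theorem stub_digitFrameQuasiShape (k m n r c : ℕ) (lev : Fin m → Fin n)
    (hmult : ∀ i : Fin n, (Finset.univ.filter fun j => lev j = i).card ≤ r)
    (g : Fin k → Fin m → MvPolynomial (Fin 2) ℂ) (hdeg : ∀ l j, ∀ e ∈ (g l j).support, e 0 ≤ c ∧ e 1 ≤ c) :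
    vert (∑ l, ∏ j, MvPolynomial.expand (2 ^ (lev j : ℕ)) (g l j)) ≤ (k * (r * c + 1) + 2) ^ (38 * Nat.clog 2 (n + 2)) :=
  -- LANDED p128954 (…Theorems/NewtonUnitEquationsNewtonTauWeakDigitFrame.lean, lead c5 wave 2)
  Summit.ValiantsHypothesis.ValiantsHypothesis.Theorems.NewtonTauWeakAutomaton.stub_digitFrameQuasiShape k m n r c lev hmult g hdeg

/-- STUB C5-8 (S, anchor of the mixed-radix Defs file `Theorems/NewtonUnitEquationsNewtonTauWeakAutomatonRadixDefs.lean`, lead c5: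
objects `digit/radT/radN/radVec/radVecFin/radExpand/radProd/radSum/radBox` of THEOREM C = Theorem B in an arbitrary radix pair
`(bx, by)`, covering every synchronised-automatic frame, e.g. parabola digits `(2^i,4^i)` with axis digits in radix `(2,4)`) —
the mixed-radix box `[0,bx^n) × [0,by^n)` has `bx^n · by^n` points. [folklore] -/
theorem card_radBox (bx by' n : ℕ) : (radBox bx by' n).card = bx ^ n * by' ^ n :=
  -- LANDED p129103 (…Theorems/NewtonUnitEquationsNewtonTauWeakAutomatonRadixDefs.lean, lead c5: Defs of THEOREM C)
  Summit.ValiantsHypothesis.ValiantsHypothesis.Theorems.NewtonTauWeakAutomaton.card_radBox bx by' n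

/-! #### Wave 3 (lead c5): THEOREM C — the carry automaton in an arbitrary radix pair `(bx, by)` (Defs p129103).  Stubs C5-9 …
C5-14 generalise Theorem B's pieces; C5-12/C5-13 are stated for GENERAL moduli / anisotropic scalings (they are abstract facts
about vector configurations on boxes and serve every radix). -/

/-- STUB C5-9 (M, LANDED p129548; target `Theorems/NewtonUnitEquationsNewtonTauWeakAutomatonRadixCoeff.lean`) — **mixed-radix
automaton correctness**: the coefficient of `radProd bx by G n = Π_{i<n} G_i(x^{bx^i}, y^{by^i})` at `(bx^n t₁ + P₁, by^n t₂ + P₂)`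
(`P` in the radix box) is the `((0,0), t)` entry of `radN bx by C G 0 n P` (verbatim generalisation of `stub_genCoeff`, p127118:
induction on `n` peeling the top level; the carry stays `≤ C` because `bx, by ≥ 2`). [folklore: carry automaton] -/
theorem stub_radCoeff (bx by' C : ℕ) (hbx : 2 ≤ bx) (hby : 2 ≤ by') (G : ℕ → MvPolynomial (Fin 2) ℂ)
    (hG : ∀ i, ∀ e ∈ (G i).support, e 0 ≤ C ∧ e 1 ≤ C) (n : ℕ) (t : Fin (C + 1) × Fin (C + 1)) (P : ℕ × ℕ)
    (hP : P.1 < bx ^ n ∧ P.2 < by' ^ n) :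
    coeff (Finsupp.single 0 (bx ^ n * (t.1 : ℕ) + P.1) + Finsupp.single 1 (by' ^ n * (t.2 : ℕ) + P.2)) (radProd bx by' G n) =
      radN bx by' C G 0 n P ((0 : Fin (C + 1)), (0 : Fin (C + 1))) t :=
  -- LANDED p129548 (…Theorems/NewtonUnitEquationsNewtonTauWeakAutomatonRadixCoeff.lean, lead c5 wave 3)
  Summit.ValiantsHypothesis.ValiantsHypothesis.Theorems.NewtonTauWeakAutomaton.stub_radCoeff bx by' C hbx hby G hG n t P hP

/-- STUB C5-10 (M, LANDED p129492; target `Theorems/NewtonUnitEquationsNewtonTauWeakAutomatonRadixRecursion.lean`) — **mixed-radix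
bilinear self-similarity**: reading the levels `[0,h+m)` of `P = (bx^h H₁ + L₁, by^h H₂ + L₂)` (`L` in the radix box of `h` levels)
is reading `[0,h)` of `L`, then `[0,m)` of `H` with the level polynomials shifted; `genContract` (radix-free) is blockwise matrix
multiplication (verbatim generalisation of `stub_genRecursion`, p127732, with `digit b i` for `testBit`). [folklore] -/
theorem stub_radRecursion (bx by' k C h m : ℕ) (hbx : 2 ≤ bx) (hby : 2 ≤ by') (G : Fin k → ℕ → MvPolynomial (Fin 2) ℂ)
    (H L : ℕ × ℕ) (hL : L.1 < bx ^ h ∧ L.2 < by' ^ h) :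
    radVecFin bx by' k C G 0 (h + m) (bx ^ h * H.1 + L.1, by' ^ h * H.2 + L.2) =
      genContract k C (fun ij => radVecFin bx by' k C (shiftLev G h) 0 m H (finProdFinEquiv.symm ij).1 *
        radVecFin bx by' k C G 0 h L (finProdFinEquiv.symm ij).2) :=
  -- LANDED p129492 (…Theorems/NewtonUnitEquationsNewtonTauWeakAutomatonRadixRecursion.lean, lead c5 wave 3)
  Summit.ValiantsHypothesis.ValiantsHypothesis.Theorems.NewtonTauWeakAutomaton.stub_radRecursion bx by' k C h m hbx hby G H L hL

/-- STUB C5-11 (S/M, LANDED p129737; target `Theorems/NewtonUnitEquationsNewtonTauWeakAutomatonRadixSupport.lean`) — **support of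
the mixed-radix sum**: every exponent of `radSum bx by k n c G` lies in `[0, bx^n (C+1)) × [0, by^n (C+1))` (`Σ_{i<n} bx^i C ≤
C (bx^n − 1) < bx^n (C+1)` for `bx ≥ 2`; generalises `stub_genSupport`, p127873). [folklore] -/
theorem stub_radSupport (bx by' k C n : ℕ) (hbx : 2 ≤ bx) (hby : 2 ≤ by') (c : Fin k → ℂ)
    (G : Fin k → ℕ → MvPolynomial (Fin 2) ℂ) (hG : ∀ l i, ∀ e ∈ (G l i).support, e 0 ≤ C ∧ e 1 ≤ C) :
    ∀ e ∈ (radSum bx by' k n c G).support, e 0 < bx ^ n * (C + 1) ∧ e 1 < by' ^ n * (C + 1) :=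
  -- LANDED p129737 (…Theorems/NewtonUnitEquationsNewtonTauWeakAutomatonRadixSupport.lean, lead c5 wave 3)
  Summit.ValiantsHypothesis.ValiantsHypothesis.Theorems.NewtonTauWeakAutomaton.stub_radSupport bx by' k C n hbx hby c G hG

/-- STUB C5-12 (M, LANDED p129459; target `Theorems/NewtonUnitEquationsNewtonTauWeakAutomatonBoxGreedy.lean`) — **top survivors are
greedy, general moduli**: if the coefficient array of `f` on `[0, Mx (C+1)) × [0, My (C+1))` is a linear image
`coeff_{(Mx t₁ + P₁, My t₂ + P₂)} f = ℓ_t (x P)` of a vector configuration `x` on the box `E = [0,Mx) × [0,My)`, then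
`vert f ≤ (C+1)² · |cshadow E x|` (verbatim generalisation of `stub_autoGreedyGen`, p126648, which is `Mx = My = 2^n`; the digit
decomposition is `e₀ = Mx (e₀ / Mx) + e₀ % Mx`). [folklore: Theorem Q, "top survivor is greedy"] -/
theorem stub_boxGreedy {d : ℕ} (C Mx My : ℕ) (E : Finset (ℕ × ℕ))
    (hE : E = Finset.range Mx ×ˢ Finset.range My)
    (f : MvPolynomial (Fin 2) ℂ) (x : ℕ × ℕ → Fin d → ℂ) (ℓ : Fin (C + 1) × Fin (C + 1) → (Fin d → ℂ) →ₗ[ℂ] ℂ)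
    (hsupp : ∀ e ∈ f.support, e 0 < Mx * (C + 1) ∧ e 1 < My * (C + 1))
    (hcoeff : ∀ t : Fin (C + 1) × Fin (C + 1), ∀ P ∈ E,
      coeff (Finsupp.single 0 (Mx * (t.1 : ℕ) + P.1) + Finsupp.single 1 (My * (t.2 : ℕ) + P.2)) f = ℓ t (x P)) :
    vert f ≤ (C + 1) * (C + 1) *
      (Summit.ValiantsHypothesis.ValiantsHypothesis.Theorems.NewtonUnitEquationsDissociatedUniform.QuasiPoly.cshadow
        E x (fun P => ((P.1 : ℕ) : ℝ)) (fun P => ((P.2 : ℕ) : ℝ))).ncard :=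
  -- LANDED p129459 (…Theorems/NewtonUnitEquationsNewtonTauWeakAutomatonBoxGreedy.lean, lead c5 wave 3)
  Summit.ValiantsHypothesis.ValiantsHypothesis.Theorems.NewtonTauWeakAutomaton.stub_boxGreedy C Mx My E hE f x ℓ hsupp hcoeff

/-- STUB C5-13 (M, LANDED p129505; target `Theorems/NewtonUnitEquationsNewtonTauWeakAutomatonAnisoStep.lean`) — **bilinear product
step with ANISOTROPIC scaling**: if the configuration `x` on the box `[0, sx Hx) × [0, sy Hy)` is, along the bijection
`(H, L) ↦ (sx H₁ + L₁, sy H₂ + L₂)` (`H` in `[0,Hx)×[0,Hy)`, `L` in `[0,sx)×[0,sy)`), a linear image `π` of the Kronecker product of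
a configuration `x₁` at `H` and `x₂` at `L`, then its shadow obeys Theorem Q's product step
`|cshadow x| ≤ 2d⁴(d² s₁ + d² s₂ + 1) + 2d² + 1` (verbatim generalisation of `stub_autoStep`, p124383, which is
`sx = sy = 2^h`, `Hx = Hy = 2^m`; the one new ingredient: `cshadow` is invariant under the anisotropic rescaling
`(X, Y) ↦ (sx X, sy Y)`, `sx, sy > 0`, because `lin (sx X) (sy Y) w = lin X Y (sx w₀, sy w₁)`). [folklore: Theorem Q, product step] -/
theorem stub_anisoStep {d : ℕ} (sx sy Hx Hy : ℕ) (hsx : 1 ≤ sx) (hsy : 1 ≤ sy) (E E₁ E₂ : Finset (ℕ × ℕ))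
    (hE : E = Finset.range (sx * Hx) ×ˢ Finset.range (sy * Hy))
    (hE₁ : E₁ = Finset.range Hx ×ˢ Finset.range Hy)
    (hE₂ : E₂ = Finset.range sx ×ˢ Finset.range sy)
    (x x₁ x₂ : ℕ × ℕ → Fin d → ℂ) (π : (Fin (d * d) → ℂ) →ₗ[ℂ] (Fin d → ℂ))
    (hx : ∀ H ∈ E₁, ∀ L ∈ E₂, x (sx * H.1 + L.1, sy * H.2 + L.2) =
      π (fun ij => x₁ H (finProdFinEquiv.symm ij).1 * x₂ L (finProdFinEquiv.symm ij).2)) :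
    (Summit.ValiantsHypothesis.ValiantsHypothesis.Theorems.NewtonUnitEquationsDissociatedUniform.QuasiPoly.cshadow
        E x (fun P => ((P.1 : ℕ) : ℝ)) (fun P => ((P.2 : ℕ) : ℝ))).ncard ≤
      2 * (d * d * (d * d) * (d * d *
          (Summit.ValiantsHypothesis.ValiantsHypothesis.Theorems.NewtonUnitEquationsDissociatedUniform.QuasiPoly.cshadow
            E₁ x₁ (fun P => ((P.1 : ℕ) : ℝ)) (fun P => ((P.2 : ℕ) : ℝ))).ncard +
        d * d *
          (Summit.ValiantsHypothesis.ValiantsHypothesis.Theorems.NewtonUnitEquationsDissociatedUniform.QuasiPoly.cshadow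
            E₂ x₂ (fun P => ((P.1 : ℕ) : ℝ)) (fun P => ((P.2 : ℕ) : ℝ))).ncard + 1)) +
        d * d + d * d + 1 :=
  -- LANDED p129505 (…Theorems/NewtonUnitEquationsNewtonTauWeakAutomatonAnisoStep.lean, lead c5 wave 3)
  Summit.ValiantsHypothesis.ValiantsHypothesis.Theorems.NewtonTauWeakAutomaton.stub_anisoStep sx sy Hx Hy hsx hsy E E₁ E₂ hE hE₁ hE₂ x x₁ x₂ π hx

/-- STUB C5-14 (M, LANDED p129925; target `Theorems/NewtonUnitEquationsNewtonTauWeakAutomatonRadixAssembly.lean`) —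
**THEOREM C (K-uniform quasi-polynomial bound in every radix pair)**: for `bx, by ≥ 2`, every number `k` of products and level
polynomials of degree `≤ C` per variable, `vert(radSum bx by k n c G) ≤ (C+1)² · (bx·by) · A^{⌈log₂ n⌉}`, `A = 4D³+2D²+2D+2`,
`D = (k (C+1)⁴)²` (assembly of Theorem B verbatim with the radix pieces; the base case `n ≤ 1` is the box itself, `bx·by` points,
which is why `bx·by` replaces Theorem B's `4`). [folklore] -/
theorem stub_radAssembly (bx by' k C n : ℕ) (hbx : 2 ≤ bx) (hby : 2 ≤ by') (c : Fin k → ℂ)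
    (G : Fin k → ℕ → MvPolynomial (Fin 2) ℂ) (hG : ∀ l i, ∀ e ∈ (G l i).support, e 0 ≤ C ∧ e 1 ≤ C) :
    vert (radSum bx by' k n c G) ≤ (C + 1) * (C + 1) * (bx * by' *
      (4 * (k * ((C + 1) * (C + 1) * ((C + 1) * (C + 1))) * (k * ((C + 1) * (C + 1) * ((C + 1) * (C + 1))))) ^ 3 +
        2 * (k * ((C + 1) * (C + 1) * ((C + 1) * (C + 1))) * (k * ((C + 1) * (C + 1) * ((C + 1) * (C + 1))))) ^ 2 +
        2 * (k * ((C + 1) * (C + 1) * ((C + 1) * (C + 1))) * (k * ((C + 1) * (C + 1) * ((C + 1) * (C + 1))))) + 2) ^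
      Nat.clog 2 n) :=
  -- LANDED p129925 (…Theorems/NewtonUnitEquationsNewtonTauWeakAutomatonRadixAssembly.lean, lead c5 wave 3) = THEOREM C
  Summit.ValiantsHypothesis.ValiantsHypothesis.Theorems.NewtonTauWeakAutomaton.stub_radAssembly bx by' k C n hbx hby c G hG

/-- STUB C5-15 (M, LANDED p130242; target `Theorems/NewtonUnitEquationsNewtonTauWeakRadixFrame.lean`) — **THEOREM C in (near-)crux
language: every MIXED-RADIX digit frame**.  `k` products of `m` factors `f_{lj} = g_{lj}(x^{bx^{lev j}}, y^{by^{lev j}})` (`radExpand`),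
at most `r` factors per level, digits of degree `≤ c` per variable, `bx, by ≥ 2`: `vert ≤ (rc+1)²·(bx·by)·A^{⌈log₂ n⌉}`,
`A = 4D³+2D²+2D+2`, `D = (k (rc+1)⁴)²` — uniformly in `k` (regroup by level as in `stub_digitFrameQuasiPoly`, p128954:
`Π_j f_{lj} = radProd bx by (G l) n`, `G l i = Π_{lev j = i} g_{lj}` of degree `≤ rc`; then `stub_radAssembly`, p129925). [folklore] -/
theorem stub_radixFrameQuasiPoly (bx by' k m n r c : ℕ) (hbx : 2 ≤ bx) (hby : 2 ≤ by') (lev : Fin m → Fin n)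
    (hmult : ∀ i : Fin n, (Finset.univ.filter fun j => lev j = i).card ≤ r)
    (g : Fin k → Fin m → MvPolynomial (Fin 2) ℂ) (hdeg : ∀ l j, ∀ e ∈ (g l j).support, e 0 ≤ c ∧ e 1 ≤ c) :
    vert (∑ l, ∏ j, radExpand (bx ^ (lev j : ℕ)) (by' ^ (lev j : ℕ)) (g l j)) ≤ (r * c + 1) * (r * c + 1) * (bx * by' *
      (4 * (k * ((r * c + 1) * (r * c + 1) * ((r * c + 1) * (r * c + 1))) *
            (k * ((r * c + 1) * (r * c + 1) * ((r * c + 1) * (r * c + 1))))) ^ 3 +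
        2 * (k * ((r * c + 1) * (r * c + 1) * ((r * c + 1) * (r * c + 1))) *
            (k * ((r * c + 1) * (r * c + 1) * ((r * c + 1) * (r * c + 1))))) ^ 2 +
        2 * (k * ((r * c + 1) * (r * c + 1) * ((r * c + 1) * (r * c + 1))) *
            (k * ((r * c + 1) * (r * c + 1) * ((r * c + 1) * (r * c + 1))))) + 2) ^
      Nat.clog 2 n) :=
  -- LANDED p130242 (…Theorems/NewtonUnitEquationsNewtonTauWeakRadixFrame.lean, lead c5 wave 3b)
  Summit.ValiantsHypothesis.ValiantsHypothesis.Theorems.NewtonTauWeakAutomaton.stub_radixFrameQuasiPoly bx by' k m n r c hbx hby lev hmult g hdeg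

/-- STUB C5-16 (S, LANDED p130242, same target file as C5-15) — **the mixed-radix digit-frame bound in the admissible quasi shape**:
under the hypotheses of `stub_radixFrameQuasiPoly`, `vert ≤ bx·by·(k(rc+1)+2)^{36⌈log₂(n+2)⌉}` (arithmetic as in
`stub_digitFrameQuasiShape`: `k = 0` empty sum; `k ≥ 1`: `X := k(rc+1)+2`, `(rc+1)² ≤ X²`, `A ≤ X^{34}`). [folklore] -/
theorem stub_radixFrameQuasiShape (bx by' k m n r c : ℕ) (hbx : 2 ≤ bx) (hby : 2 ≤ by') (lev : Fin m → Fin n)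
    (hmult : ∀ i : Fin n, (Finset.univ.filter fun j => lev j = i).card ≤ r)
    (g : Fin k → Fin m → MvPolynomial (Fin 2) ℂ) (hdeg : ∀ l j, ∀ e ∈ (g l j).support, e 0 ≤ c ∧ e 1 ≤ c) :
    vert (∑ l, ∏ j, radExpand (bx ^ (lev j : ℕ)) (by' ^ (lev j : ℕ)) (g l j)) ≤
      bx * by' * (k * (r * c + 1) + 2) ^ (36 * Nat.clog 2 (n + 2)) :=
  -- LANDED p130242 (…Theorems/NewtonUnitEquationsNewtonTauWeakRadixFrame.lean, lead c5 wave 3b)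
  Summit.ValiantsHypothesis.ValiantsHypothesis.Theorems.NewtonTauWeakAutomaton.stub_radixFrameQuasiShape bx by' k m n r c hbx hby lev hmult g hdeg

/-! #### Wave 4 (lead c5): THEOREM G — block-popcount RESIDUE DESIGNS are POLYNOMIAL, uniformly in the number of products.
For an exponent list `d : Fin N → ℕ²`, blocks `B : Fin N → Fin s`, moduli `q` and residues `r`, the point set
`X = {Σ_{j∈J} d_j : |J ∩ B⁻¹ i| ≡ r_i (mod q_i) ∀ i}` has at most `2(2(N²+N)+1)·(Π q_i)²` hull vertices — with NO dissociation
hypothesis.  On a dissociated list `X` is exactly the support of the torsion design `Σ_θ c_θ Π_j (1 − ζ^{θ}_{B j} ρ_j X^{d_j})`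
(`K = Π q_i` products): T2 for this design family with `b = 4`, the first POLYNOMIAL k-uniform cancellation-aware bound of the
record (the judge's "roots-of-unity designs" risk for crux 5905).  Proof: a vertex is the top of `X` in a generic direction `w`;
the optimum is the positive set `J* = {⟨w,d_j⟩ > 0}` corrected, in each block, by removing the `b_i < q_i` CHEAPEST positives and
adding the `a_i < q_i` cheapest negatives (exchange + "q equal residues sum to 0"); so vertices are indexed by (signed order of the
`⟨w,d_j⟩`, `(a_i,b_i)_i`), and signed orders along a chart `w = (±1, t)` are sign vectors of `N + N²` affine functions of `t`. -/

/-- STUB C5-G1 (S/M, LANDED p130022; target `Theorems/NewtonUnitEquationsNewtonTauWeakSignvecCount.lean`) — **sign vectors of affine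
functions along a line**: `M` affine functions `t ↦ α_m + t β_m` realise at most `2M + 1` distinct sign vectors as `t` ranges over
`ℝ` (each non-constant one changes sign once; between consecutive roots the vector is constant). [folklore] -/
theorem stub_signvecCount (M : ℕ) (α β : Fin M → ℝ) :
    {v : Fin M → SignType | ∃ t : ℝ, v = fun m => SignType.sign (α m + t * β m)}.ncard ≤ 2 * M + 1 :=
  -- LANDED p130022 (…Theorems/NewtonUnitEquationsNewtonTauWeakSignvecCount.lean, lead c5 wave 4)
  Summit.ValiantsHypothesis.ValiantsHypothesis.Theorems.NewtonUnitEquationsNewtonTauWeak.stub_signvecCount M α β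

/-- STUB C5-G3 (M, LANDED p130418; target `Theorems/NewtonUnitEquationsNewtonTauWeakResidueNormalForm.lean`) — **exchange normal form
of a residue-constrained maximiser**: with nonzero values `c_j`, blocks `B`, moduli `q_i ≥ 1`, residues `r_i`, every admissible
`J` (block cardinalities `≡ r_i mod q_i`) maximising `Σ_{j∈J} c_j` has the same value as a CANONICAL admissible set: keep the
positives of each block except its `b_i` cheapest (key `(c_j, j)`), add the `a_i` negatives closest to `0`, with `a_i, b_i < q_i`
(`b_i ≥ q_i` omitted positives: add `q_i` of them back — admissible, strictly better; the `b_i` cheapest have the least sum).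
[folklore: exchange argument] -/
theorem stub_residueNormalForm (N s : ℕ) (B : Fin N → Fin s) (q r : Fin s → ℕ) (hq : ∀ i, 1 ≤ q i) (c : Fin N → ℝ)
    (hc : ∀ j, c j ≠ 0) (J : Finset (Fin N))
    (hJ : ∀ i, (J.filter fun j => B j = i).card % q i = r i % q i)
    (hmax : ∀ J' : Finset (Fin N), (∀ i, (J'.filter fun j => B j = i).card % q i = r i % q i) →
      ∑ j ∈ J', c j ≤ ∑ j ∈ J, c j) :
    ∃ a b : Fin s → ℕ, (∀ i, a i < q i ∧ b i < q i) ∧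
      (∀ i, ((Finset.univ.filter fun j : Fin N =>
          (0 < c j ∧ b (B j) ≤ (Finset.univ.filter fun j' : Fin N =>
              B j' = B j ∧ 0 < c j' ∧ (c j' < c j ∨ (c j' = c j ∧ j' < j))).card) ∨
          (c j < 0 ∧ (Finset.univ.filter fun j' : Fin N =>
              B j' = B j ∧ c j' < 0 ∧ (c j < c j' ∨ (c j' = c j ∧ j' < j))).card < a (B j))).filter
            fun j => B j = i).card % q i = r i % q i) ∧
      ∑ j ∈ (Finset.univ.filter fun j : Fin N =>
          (0 < c j ∧ b (B j) ≤ (Finset.univ.filter fun j' : Fin N =>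
              B j' = B j ∧ 0 < c j' ∧ (c j' < c j ∨ (c j' = c j ∧ j' < j))).card) ∨
          (c j < 0 ∧ (Finset.univ.filter fun j' : Fin N =>
              B j' = B j ∧ c j' < 0 ∧ (c j < c j' ∨ (c j' = c j ∧ j' < j))).card < a (B j))), c j =
        ∑ j ∈ J, c j :=
  -- LANDED p130418 (…Theorems/NewtonUnitEquationsNewtonTauWeakResidueNormalForm.lean, lead c5 wave 4)
  Summit.ValiantsHypothesis.ValiantsHypothesis.Theorems.NewtonUnitEquationsNewtonTauWeak.stub_residueNormalForm N s B q r hq c hc J hJ hmax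

/-- STUB C5-G4 (L, LANDED p130877; target `Theorems/NewtonUnitEquationsNewtonTauWeakResidueDesignHull.lean`) — **THEOREM G
(hull vertices of block-residue level sets are polynomial)**: for NONZERO exponents `d_j`,
`#vert conv {Σ_{j∈J} d_j : |J ∩ B⁻¹ i| ≡ r_i (q_i)} ≤ (4(N²+N)+5)(Π q_i)²`.  Proof: each vertex is strictly exposed by a direction
`w` with all `⟨w,d_j⟩` nonzero (`stub_exposedGenericDirection` on `S = X`, `T = {0} ∪ {d_j}`); by G3 the vertex is
`Σ_{j ∈ Jcan(w,a,b)} d_j` with `a_i, b_i < q_i`; `Jcan` depends on `w` only through the sign vector of the `M = N + N²` linear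
functionals `w ↦ ⟨w, d_j⟩`, `w ↦ ⟨w, d_{j'} − d_j⟩`, and sign vectors of `M` linear functionals on `ℝ²` take ≤ `4M + 5` values
(`w₀ > 0` / `w₀ < 0`: rescale to the charts `(±1, t)` and use G1, `2M+1` each; `w₀ = 0`: 3 values); `(Π q_i)²` choices of
`(a,b)`. [folklore] -/
theorem stub_residueDesignHull (N s : ℕ) (B : Fin N → Fin s) (q r : Fin s → ℕ) (hq : ∀ i, 1 ≤ q i)
    (d : Fin N → (Fin 2 →₀ ℕ)) (hd : ∀ j, d j ≠ 0) :
    (Set.extremePoints ℝ (convexHull ℝ ((fun e : Fin 2 →₀ ℕ => fun i : Fin 2 => ((e i : ℕ) : ℝ)) ''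
      (((Finset.univ.filter fun J : Finset (Fin N) =>
          ∀ i, (J.filter fun j => B j = i).card % q i = r i % q i).image
        fun J => ∑ j ∈ J, d j : Finset (Fin 2 →₀ ℕ)) : Set (Fin 2 →₀ ℕ))))).ncard ≤
      (4 * (N * N + N) + 5) * (∏ i, q i) ^ 2 :=
  -- LANDED p130877 (…Theorems/NewtonUnitEquationsNewtonTauWeakResidueDesignHull.lean, lead c5 wave 4) = THEOREM G
  Summit.ValiantsHypothesis.ValiantsHypothesis.Theorems.NewtonUnitEquationsNewtonTauWeak.stub_residueDesignHull N s B q r hq d hd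

/-- STUB C5-G5 (L, LANDED p131173; target `Theorems/NewtonUnitEquationsNewtonTauWeakResidueDesignT2.lean`) — **T2 for torsion
(block-popcount residue) designs, POLYNOMIAL and uniform in the number `K = Π q_i` of products**: on a dissociated exponent list with
nonzero exponents and coefficients, the design `f = Σ_θ c_θ Π_j (1 − ζ_{B j}^{θ_{B j}} ρ_j X^{d_j})`, `c_θ = Π_i ζ_i^{−θ_i r_i}/q_i`
(`ζ_i` a primitive `q_i`-th root of unity), has coefficient `Π_i [ |J ∩ B⁻¹ i| ≡ r_i (q_i) ] · Π_{j∈J}(−ρ_j)` at `Σ_{j∈J} d_j`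
(character orthogonality, `Finset.prod_univ_sum`; dissociation via `stub_coeffFormula`-type expansion), so `supp f` is EXACTLY the
residue level set of THEOREM G and `vert f ≤ (4(N²+N)+5)(Π q_i)²`.  Checked numerically (kit/check_design.py). [folklore] -/
theorem stub_residueDesignT2 (N s : ℕ) (B : Fin N → Fin s) (q r : Fin s → ℕ) (hq : ∀ i, 1 ≤ q i)
    (ζ : Fin s → ℂ) (hζ : ∀ i, IsPrimitiveRoot (ζ i) (q i)) (ρ : Fin N → ℂ) (hρ : ∀ j, ρ j ≠ 0)
    (d : Fin N → (Fin 2 →₀ ℕ)) (hd : ∀ j, d j ≠ 0)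
    (hdis : ∀ J J' : Finset (Fin N), ∑ j ∈ J, d j = ∑ j ∈ J', d j → J = J') :
    vert (∑ θ : ((i : Fin s) → Fin (q i)),
        C (∏ i, ((ζ i)⁻¹) ^ ((θ i : ℕ) * r i) / (q i : ℂ)) *
          ∏ j, (1 - C ((ζ (B j)) ^ ((θ (B j) : ℕ)) * ρ j) * monomial (d j) 1)) ≤
      (4 * (N * N + N) + 5) * (∏ i, q i) ^ 2 :=
  -- LANDED p131173 (…Theorems/NewtonUnitEquationsNewtonTauWeakResidueDesignT2.lean, lead c5 wave 4) = T2 for torsion designs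
  Summit.ValiantsHypothesis.ValiantsHypothesis.Theorems.NewtonUnitEquationsNewtonTauWeak.stub_residueDesignT2 N s B q r hq ζ hζ ρ hρ d hd hdis

/-- STUB C5-G6 (M/L, LANDED p131046; target `Theorems/NewtonUnitEquationsNewtonTauWeakMarkedSwitchNormalForm.lean`) — **THEOREM G′
piece: switch normal form for MARKED LETTERS (t-nomial torsion designs, crux language)**.  Factors `j < m` with letter sets `A_j`,
0/1 marks `μ_j`, injective heights `c` on each `A_j`; an admissible word (`Σ_j μ_j(a_j) ≡ r mod q`) maximising `Σ_j c(a_j)` has the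
value of a word of SPECIAL FORM: every factor takes its top letter except a switched set `S` of factors taking the best letter of
the opposite mark; `S` splits by top-mark into two down-sets for the loss key `(loss_j, j)` of sizes `< q` (exchange: switching is the
only useful deviation; `q` same-type switches undo to 0 mod q; cheapest switches first).  Checked by brute force
(kit/check_exchange_t.py, 0 failures). [folklore: exchange argument] -/
theorem stub_markedSwitchNormalForm (m q r : ℕ) (hq : 1 ≤ q) (A : Fin m → Finset (Fin 2 →₀ ℕ))
    (μ : Fin m → (Fin 2 →₀ ℕ) → ℕ) (hμ : ∀ j a, μ j a ≤ 1) (c : (Fin 2 →₀ ℕ) → ℝ)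
    (hc : ∀ j, Set.InjOn c (A j : Set (Fin 2 →₀ ℕ)))
    (a₀ : Fin m → (Fin 2 →₀ ℕ)) (ha₀ : ∀ j, a₀ j ∈ A j) (hadm : (∑ j, μ j (a₀ j)) % q = r % q)
    (hmax : ∀ a : Fin m → (Fin 2 →₀ ℕ), (∀ j, a j ∈ A j) → (∑ j, μ j (a j)) % q = r % q →
      ∑ j, c (a j) ≤ ∑ j, c (a₀ j)) :
    ∃ (a : Fin m → (Fin 2 →₀ ℕ)) (S : Finset (Fin m)),
      (∀ j, a j ∈ A j) ∧ (∑ j, μ j (a j)) % q = r % q ∧ ∑ j, c (a j) = ∑ j, c (a₀ j) ∧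
      (∀ j, j ∉ S → ∀ x ∈ A j, c x ≤ c (a j)) ∧
      (∀ j ∈ S, (∀ y ∈ A j, μ j y = μ j (a j) → c y ≤ c (a j)) ∧
        ∃ x ∈ A j, μ j x ≠ μ j (a j) ∧ ∀ y ∈ A j, c y ≤ c x) ∧
      (S.filter fun j => μ j (a j) = 0).card < q ∧ (S.filter fun j => μ j (a j) = 1).card < q ∧
      (∀ j ∈ S, ∀ j', j' ∉ S → (∀ y ∈ A j', c y ≤ c (a j')) →
        μ j' (a j') ≠ μ j (a j) →
        ∀ x ∈ A j, (∀ y ∈ A j, c y ≤ c x) →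
        ∀ x' ∈ A j', μ j' x' ≠ μ j' (a j') → (∀ y' ∈ A j', μ j' y' ≠ μ j' (a j') → c y' ≤ c x') →
          (c x - c (a j) < c (a j') - c x' ∨ (c x - c (a j) = c (a j') - c x' ∧ j < j'))) :=
  -- LANDED p131046 (…Theorems/NewtonUnitEquationsNewtonTauWeakMarkedSwitchNormalForm.lean, lead c5 wave 4)
  Summit.ValiantsHypothesis.ValiantsHypothesis.Theorems.NewtonUnitEquationsNewtonTauWeak.stub_markedSwitchNormalForm m q r hq A μ hμ c hc a₀ ha₀ hadm hmax

/-- STUB C5-G7 (L, LANDED p131538; target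
`Theorems/NewtonUnitEquationsNewtonTauWeakMarkedDesignHull.lean`) — **THEOREM G′ (crux language, t-sparse factors): hull vertices of
marked residue level sets of sumsets are polynomial in (m, t, q)**: for letter sets `|A_j| ≤ L`, marks `μ`, modulus `q ≥ 1`,
`#vert conv {Σ_j a_j : a ∈ Π A_j, Σ μ_j(a_j) ≡ r (q)} ≤ (4M+5) q²`, `M = (mL)² + (mL)⁴` (sign vectors of the functionals
`⟨w, x − y⟩`, `⟨w, (x − y) − (x' − y')⟩` over letters determine the special-form word up to the two switch counts `< q`).  On a
dissociated frame this set is the support of the torsion design `Σ_{θ<q} c_θ Π_j (Σ_{a∈A_j} ζ^{θ μ_j(a)} κ_{ja} X^a)` — `k = q`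
products of `t`-sparse factors: KPTT Conj. 1's `poly(kmt)` for this family, uniformly in `k`. [folklore] -/
theorem stub_markedDesignHull (m q r : ℕ) (hq : 1 ≤ q) (A : Fin m → Finset (Fin 2 →₀ ℕ))
    (μ : Fin m → (Fin 2 →₀ ℕ) → ℕ) (hμ : ∀ j a, μ j a ≤ 1) (L : ℕ) (hL : ∀ j, (A j).card ≤ L) :
    (Set.extremePoints ℝ (convexHull ℝ ((fun e : Fin 2 →₀ ℕ => fun i : Fin 2 => ((e i : ℕ) : ℝ)) ''
      (((Fintype.piFinset A).filter (fun a : Fin m → (Fin 2 →₀ ℕ) => (∑ j, μ j (a j)) % q = r % q)).image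
        (fun a => ∑ j, a j) : Set (Fin 2 →₀ ℕ))))).ncard ≤
      (4 * (m * L * (m * L) + m * L * (m * L) * (m * L * (m * L))) + 5) * q ^ 2 :=
  -- LANDED p131538 (…Theorems/NewtonUnitEquationsNewtonTauWeakMarkedDesignHull.lean, lead c5 wave 4) = THEOREM G′
  Summit.ValiantsHypothesis.ValiantsHypothesis.Theorems.NewtonUnitEquationsNewtonTauWeak.stub_markedDesignHull m q r hq A μ hμ L hL


end RungC5

/-! ### Rung stubs of lead c6 (THEOREM W = ℤ-weighted level sets of subset sums; THEOREM G″ = weighted residues at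
fixed modulus; registered helper stubs, NOT used by the composition)

Both stub-ideation cells of this pass (`Cruxes/NewtonTauWeak/STUB-IDEAS-stub_binomialNewtonTauCommon-2.md` PLAN A,
`…-3.md` H1–H5) converge on the same rung: on GRADED designs `ρ_{lj} = u_l^{g_j} ρ_j` (multiplicative rank one,
integer weights `1 ≤ g_j ≤ c`; ANY number of products, any scalars) the support is a union of `≤ cN + 1` weighted
level sets `X_v = {Σ_J d_j : Σ_J g_j = v}`, and `#vert conv X_v` is polynomial in `N`, FPT in `c`, for ARBITRARY
exponent lists — the Lagrangian density prefix plays the role of Theorem G's positive set, a Steinitz zero-sum-free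
bound the role of `a_i, b_i < q_i`.  The residual toward T2 on graded designs is the ONE-CELL question C1 (count
polynomial in `c` too) = the lead's stub.  Each stub lands as its own `--supports` file
`Theorems/NewtonUnitEquationsNewtonTauWeak<Stub>.lean` (namespace `…Theorems.NewtonUnitEquationsNewtonTauWeak`). -/
namespace RungC6

/-- STUB W1 (S, PROVABLE NOW) — **zero-sum-free exchanges are short** (Steinitz / knapsack proximity in
dimension one).  Removed weights `x i`, added weights `y i`, all in `[1, c]`, net gain `r < c`; if no nonempty
sub-family of removals has the same total weight as a sub-family of additions then `p + m ≤ 2c`.  Proof: order the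
`p + m` signed weights greedily (add a `y` while the running sum is `≤ 0`, else subtract an `x`); all `p + m + 1`
partial sums lie in `(-c, c]`, and two equal partial sums give a contiguous block with equal removal/addition
totals (removal part nonempty since `y i ≥ 1`), so they are distinct: `p + m + 1 ≤ 2c`. [folklore] -/
theorem stub_zeroSumFreeCard (p m c r : ℕ) (x : Fin p → ℕ) (y : Fin m → ℕ)
    (hx : ∀ i, 1 ≤ x i ∧ x i ≤ c) (hy : ∀ i, 1 ≤ y i ∧ y i ≤ c)
    (hsum : ∑ i, y i = ∑ i, x i + r) (hr : r < c)
    (hfree : ∀ (S : Finset (Fin p)) (T : Finset (Fin m)), S.Nonempty → ∑ i ∈ S, x i ≠ ∑ i ∈ T, y i) :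
    p + m ≤ 2 * c :=
  -- LANDED (lead c6 wave 1, p132606): Theorems/NewtonUnitEquationsNewtonTauWeakZeroSumFreeCard.lean
  Summit.ValiantsHypothesis.ValiantsHypothesis.Theorems.NewtonUnitEquationsNewtonTauWeak.stub_zeroSumFreeCard
    p m c r x y hx hy hsum hr hfree

/-- STUB W2 (M, PROVABLE NOW) — **weighted exchange normal form** (the ℤ-weighted twin of `stub_residueNormalForm`,
NO genericity).  Items `j : Fin N` with weights `1 ≤ g j ≤ c` and real values `c' j`; DENSITY ORDER "`j'` above
`j`" := `c' j · g j' < c' j' · g j ∨ (c' j' · g j = c' j · g j' ∧ j' < j)` (strict total order), `rk j` = number of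
items above `j`, PREFIX `k` := `{j : rk j < k}`.  CANONICAL SET `canon k α β` := (prefix items `j` with at least
`α (g j)` same-weight prefix items below them — i.e. drop the `α a` lowest of weight class `a`) ∪ (non-prefix items
`j` with fewer than `β (g j)` same-weight non-prefix items above them — i.e. add the `β a` highest).  CLAIM: every
maximiser `J` of `Σ_J c'` over `{J : Σ_J g = v}` has the weight and the value of some `canon k α β` with `k ≤ N`,
`Σ_a (α a + β a) ≤ 2c`, `α, β` vanishing off `[1, c]`.  Proof: take `k` = the largest `k ≤ N` whose prefix `P` has
weight `≤ v` (deficit `r = v − wt P < c`), and among maximisers one, `J₀`, with `|J₀ ∆ P|` least; `R := P ∖ J₀`,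
`A := J₀ ∖ P` satisfy `wt A = wt R + r` and are zero-sum-free (an equal-weight pair `S ⊆ R`, `T ⊆ A` swaps back at
no loss since prefix densities dominate: `c'(S) ≥ ρ_min(P)·wt S ≥ c'(T)`), so `|R| + |A| ≤ 2c` by STUB W1; inside a
weight class values and densities order alike, so replacing `R`, `A` by the lowest / highest items of their
classes keeps the weight and does not lower the value: `α a := |R ∩ class a|`, `β a := |A ∩ class a|`.
(`rk`, `canon` are abstracted into parameters characterised by `hrk`, `hcanon`; instantiate with `_` and `rfl`.)
[folklore: exchange argument; brute-force checked by stub-ideation k3, kit/check_weighted_nf.py] -/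
theorem stub_weightedNormalForm (N c v : ℕ) (g : Fin N → ℕ) (hg : ∀ j, 1 ≤ g j ∧ g j ≤ c)
    (c' : Fin N → ℝ) (J : Finset (Fin N)) (hJ : ∑ j ∈ J, g j = v)
    (hmax : ∀ J' : Finset (Fin N), ∑ j ∈ J', g j = v → ∑ j ∈ J', c' j ≤ ∑ j ∈ J, c' j)
    (rk : Fin N → ℕ)
    (hrk : ∀ j, rk j = (Finset.univ.filter fun j' : Fin N =>
        c' j * (g j' : ℝ) < c' j' * (g j : ℝ) ∨ (c' j' * (g j : ℝ) = c' j * (g j' : ℝ) ∧ j' < j)).card)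
    (canon : ℕ → (ℕ → ℕ) → (ℕ → ℕ) → Finset (Fin N))
    (hcanon : ∀ k α β, canon k α β = Finset.univ.filter fun j : Fin N =>
        (rk j < k ∧ α (g j) ≤ (Finset.univ.filter fun j' : Fin N =>
            rk j' < k ∧ g j' = g j ∧
              (c' j' * (g j : ℝ) < c' j * (g j' : ℝ) ∨ (c' j * (g j' : ℝ) = c' j' * (g j : ℝ) ∧ j < j'))).card) ∨
        (k ≤ rk j ∧ (Finset.univ.filter fun j' : Fin N =>
            k ≤ rk j' ∧ g j' = g j ∧
              (c' j * (g j' : ℝ) < c' j' * (g j : ℝ) ∨ (c' j' * (g j : ℝ) = c' j * (g j' : ℝ) ∧ j' < j))).card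
            < β (g j))) :
    ∃ (k : ℕ) (α β : ℕ → ℕ), k ≤ N ∧ (∑ a ∈ Finset.range (c + 1), (α a + β a) ≤ 2 * c) ∧
      (∀ a, (a = 0 ∨ c < a) → α a = 0 ∧ β a = 0) ∧
      ∑ j ∈ canon k α β, g j = v ∧ ∑ j ∈ canon k α β, c' j = ∑ j ∈ J, c' j :=
  -- LANDED (lead c6 wave 1, p133603): Theorems/NewtonUnitEquationsNewtonTauWeakWeightedNormalForm.lean
  Summit.ValiantsHypothesis.ValiantsHypothesis.Theorems.NewtonUnitEquationsNewtonTauWeak.stub_weightedNormalForm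
    N c v g hg c' J hJ hmax rk hrk canon hcanon

/-- STUB W3 (M, PROVABLE NOW) — **THEOREM W from the normal form**: hull vertices of a ℤ-weighted level set of
subset sums, `X_v = {Σ_{j∈J} d j : Σ_{j∈J} g j = v}`, coincidences allowed, are at most
`(4N² + 5)(N + 1)(2c + 1)^{2c}` GIVEN the normal form of STUB W2 (hypothesis `hNF`, for all value vectors).
Assembly exactly as `stub_residueDesignHull` (Theorems/…ResidueDesignHull.lean): an extreme point is strictly
exposed by a direction `w` (`NewtonUnitEquationsDissociatedUniform.stub_exposedGenericDirection`, `T = ∅`); with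
`c' j = ⟨w, d j⟩` heights of subset sums are `Σ_J c'`, so the point is `Σ_{J₀} d` for a maximiser `J₀`, hence
(strict exposure) `= Σ_{canon c' k α β} d`; `canon c' k α β` depends on `c'` only through the sign vector of the
`N·N` linear functionals `w ↦ ⟨w, g j • d j' − g j' • d j⟩` (pairs via `finProdFinEquiv`), at most `4N² + 5` of them
(`ResidueDesignHullAux.signvec_plane_count`); `k ∈ [0, N]`, and `α, β` restricted to `[1, c]` take values in
`[0, 2c]`: `(2c+1)^c · (2c+1)^c`. [folklore] -/
theorem stub_weightedLevelSetHullOfNF (N c v : ℕ) (g : Fin N → ℕ) (hg : ∀ j, 1 ≤ g j ∧ g j ≤ c)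
    (d : Fin N → (Fin 2 →₀ ℕ))
    (rk : (Fin N → ℝ) → Fin N → ℕ)
    (hrk : ∀ c' j, rk c' j = (Finset.univ.filter fun j' : Fin N =>
        c' j * (g j' : ℝ) < c' j' * (g j : ℝ) ∨ (c' j' * (g j : ℝ) = c' j * (g j' : ℝ) ∧ j' < j)).card)
    (canon : (Fin N → ℝ) → ℕ → (ℕ → ℕ) → (ℕ → ℕ) → Finset (Fin N))
    (hcanon : ∀ c' k α β, canon c' k α β = Finset.univ.filter fun j : Fin N =>
        (rk c' j < k ∧ α (g j) ≤ (Finset.univ.filter fun j' : Fin N =>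
            rk c' j' < k ∧ g j' = g j ∧
              (c' j' * (g j : ℝ) < c' j * (g j' : ℝ) ∨ (c' j * (g j' : ℝ) = c' j' * (g j : ℝ) ∧ j < j'))).card) ∨
        (k ≤ rk c' j ∧ (Finset.univ.filter fun j' : Fin N =>
            k ≤ rk c' j' ∧ g j' = g j ∧
              (c' j * (g j' : ℝ) < c' j' * (g j : ℝ) ∨ (c' j' * (g j : ℝ) = c' j * (g j' : ℝ) ∧ j' < j))).card
            < β (g j)))
    (hNF : ∀ (c' : Fin N → ℝ) (J : Finset (Fin N)), ∑ j ∈ J, g j = v →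
        (∀ J' : Finset (Fin N), ∑ j ∈ J', g j = v → ∑ j ∈ J', c' j ≤ ∑ j ∈ J, c' j) →
        ∃ (k : ℕ) (α β : ℕ → ℕ), k ≤ N ∧ (∑ a ∈ Finset.range (c + 1), (α a + β a) ≤ 2 * c) ∧
          (∀ a, (a = 0 ∨ c < a) → α a = 0 ∧ β a = 0) ∧
          ∑ j ∈ canon c' k α β, g j = v ∧ ∑ j ∈ canon c' k α β, c' j = ∑ j ∈ J, c' j) :
    (Set.extremePoints ℝ (convexHull ℝ ((fun e : Fin 2 →₀ ℕ => fun i : Fin 2 => ((e i : ℕ) : ℝ)) ''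
      (((Finset.univ.filter fun J : Finset (Fin N) => ∑ j ∈ J, g j = v).image
        fun J => ∑ j ∈ J, d j : Finset (Fin 2 →₀ ℕ)) : Set (Fin 2 →₀ ℕ))))).ncard ≤
      (4 * (N * N) + 5) * (N + 1) * (2 * c + 1) ^ (2 * c) :=
  -- LANDED (lead c6 wave 1, p132664): Theorems/NewtonUnitEquationsNewtonTauWeakWeightedLevelSetHull.lean
  Summit.ValiantsHypothesis.ValiantsHypothesis.Theorems.NewtonUnitEquationsNewtonTauWeak.stub_weightedLevelSetHullOfNF
    N c v g hg d rk hrk canon hcanon hNF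

/-- STUB W4 (M, PROVABLE NOW) — **T2 for GRADED designs from a level-set hull bound.**  On a dissociated exponent
list with nonzero `ρ j`, the design `f = Σ_l cf_l Π_j (1 − u_l^{g j} ρ_j X^{d j})` (ANY number `K` of products, any
nodes `u_l`, any scalars) has coefficient `F(Σ_J g) · Π_{j∈J}(−ρ_j)` at `Σ_J d`, `F(s) = Σ_l cf_l u_l^s`
(expand as in `ResidueDesignT2Aux.prod_one_sub_eq_sum` / `coeff_design_subsetSum`), so
`supp f = ⋃_{s ≤ Σ_j g j, F(s) ≠ 0} X_s` with `X_s` the weight-`s` level set; an extreme point of the hull of a finite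
union lies in one of the pieces and is an extreme point of that piece's hull (`extremePoints_convexHull_subset` +
`mem_extremePoints` restricted to a subset), so `vert f ≤ Σ_{s ≤ Σ g} #vert conv X_s ≤ (Σ_j g j + 1) · Bnd`. [folklore] -/
theorem stub_gradedDesignT2OfHull (N K Bnd : ℕ) (g : Fin N → ℕ)
    (u cf : Fin K → ℂ) (ρ : Fin N → ℂ) (hρ : ∀ j, ρ j ≠ 0) (d : Fin N → (Fin 2 →₀ ℕ))
    (hdis : ∀ J J' : Finset (Fin N), ∑ j ∈ J, d j = ∑ j ∈ J', d j → J = J')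
    (hX : ∀ v : ℕ, (Set.extremePoints ℝ (convexHull ℝ
      ((fun e : Fin 2 →₀ ℕ => fun i : Fin 2 => ((e i : ℕ) : ℝ)) ''
        (((Finset.univ.filter fun J : Finset (Fin N) => ∑ j ∈ J, g j = v).image
          fun J => ∑ j ∈ J, d j : Finset (Fin 2 →₀ ℕ)) : Set (Fin 2 →₀ ℕ))))).ncard ≤ Bnd) :
    vert (∑ l, C (cf l) * ∏ j, (1 - C (u l ^ g j * ρ j) * monomial (d j) 1)) ≤ (∑ j, g j + 1) * Bnd :=
  -- LANDED (lead c6 wave 1, p132495): Theorems/NewtonUnitEquationsNewtonTauWeakGradedDesignT2.lean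
  Summit.ValiantsHypothesis.ValiantsHypothesis.Theorems.NewtonUnitEquationsNewtonTauWeak.stub_gradedDesignT2OfHull
    N K Bnd g u cf ρ hρ d hdis hX

/-- STUB R1 (M, PROVABLE NOW) — **Davenport exchange normal form for WEIGHTED residues** (`stub_residueNormalForm`
with ONE cyclic grading by arbitrary weights instead of block popcounts).  Nonzero values `c j`, weights `g j`,
modulus `q ≥ 1`, residue `r`; `J` admissible iff `Σ_J g ≡ r (mod q)`.  Every admissible maximiser of `Σ_J c` has the
value of a canonical admissible set: all positives except, in each residue class `h = g j % q`, its `b h` cheapest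
(key `(c j, j)`), plus the `a h` negatives closest to `0`, with `Σ_h (a h + b h) < q`.  Proof: `P` := positives,
`D := J ∆ P`; if `|D| ≥ q`, some nonempty `E ⊆ D` has signed weight `≡ 0 (mod q)` (prefix sums of any `q` residues
repeat: Davenport constant of `ℤ/q`), and `J ∆ E` is admissible and strictly better (`c ≠ 0`) — so `|D| < q`; inside a
residue class all items shift the residue alike, so lowest-out / highest-in with the same class counts
`a h := |(J ∖ P) ∩ class h|`, `b h := |(P ∖ J) ∩ class h|` is admissible and not worse
(`ResidueNormalFormAux.sum_filter_rank_lt_le`-type down-set sums). (`canon` abstracted as in STUB W2.) [folklore] -/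
theorem stub_residueWeightedNormalForm (N q r : ℕ) (hq : 1 ≤ q) (g : Fin N → ℕ) (c : Fin N → ℝ)
    (hc : ∀ j, c j ≠ 0) (J : Finset (Fin N)) (hJ : (∑ j ∈ J, g j) % q = r % q)
    (hmax : ∀ J' : Finset (Fin N), (∑ j ∈ J', g j) % q = r % q → ∑ j ∈ J', c j ≤ ∑ j ∈ J, c j)
    (canon : (ℕ → ℕ) → (ℕ → ℕ) → Finset (Fin N))
    (hcanon : ∀ a b, canon a b = Finset.univ.filter fun j : Fin N =>
        (0 < c j ∧ b (g j % q) ≤ (Finset.univ.filter fun j' : Fin N =>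
            g j' % q = g j % q ∧ 0 < c j' ∧ (c j' < c j ∨ (c j' = c j ∧ j' < j))).card) ∨
        (c j < 0 ∧ (Finset.univ.filter fun j' : Fin N =>
            g j' % q = g j % q ∧ c j' < 0 ∧ (c j < c j' ∨ (c j' = c j ∧ j' < j))).card < a (g j % q))) :
    ∃ a b : ℕ → ℕ, (∑ h ∈ Finset.range q, (a h + b h) < q) ∧ (∀ h, q ≤ h → a h = 0 ∧ b h = 0) ∧
      (∑ j ∈ canon a b, g j) % q = r % q ∧ ∑ j ∈ canon a b, c j = ∑ j ∈ J, c j :=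
  -- LANDED (lead c6 wave 1, p132656): Theorems/NewtonUnitEquationsNewtonTauWeakResidueWeightedNormalForm.lean
  Summit.ValiantsHypothesis.ValiantsHypothesis.Theorems.NewtonUnitEquationsNewtonTauWeak.stub_residueWeightedNormalForm
    N q r hq g c hc J hJ hmax canon hcanon

/-- STUB R2 (M, PROVABLE NOW) — **THEOREM G″ from the normal form**: for nonzero exponents `d j`, any weights `g j`,
`q ≥ 1`, the hull of `{Σ_J d : Σ_J g ≡ r (mod q)}` has at most `(4(N² + N) + 5) · q^{2q}` extreme points GIVEN the
normal form of STUB R1 (hypothesis `hNF`).  Verbatim the assembly of `stub_residueDesignHull`: strictly exposing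
direction generic for `{0} ∪ {d j}` (so `c j = ⟨w, d j⟩ ≠ 0`), maximiser ⇒ canonical set, canonical set read off
from the sign vector of the `N·N + N` functionals `⟨w, d j' − d j⟩`, `⟨w, d j⟩` (`ResidueDesignHullAux.signvec_plane_count`,
`canonical_eq_of_signs` pattern with blocks `B j := g j % q`), parameters `a, b` restricted to `range q` with values
`< q`: box `q^q · q^q`. [folklore] -/
theorem stub_residueWeightedHullOfNF (N q r : ℕ) (hq : 1 ≤ q) (g : Fin N → ℕ)
    (d : Fin N → (Fin 2 →₀ ℕ)) (hd : ∀ j, d j ≠ 0)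
    (canon : (Fin N → ℝ) → (ℕ → ℕ) → (ℕ → ℕ) → Finset (Fin N))
    (hcanon : ∀ c a b, canon c a b = Finset.univ.filter fun j : Fin N =>
        (0 < c j ∧ b (g j % q) ≤ (Finset.univ.filter fun j' : Fin N =>
            g j' % q = g j % q ∧ 0 < c j' ∧ (c j' < c j ∨ (c j' = c j ∧ j' < j))).card) ∨
        (c j < 0 ∧ (Finset.univ.filter fun j' : Fin N =>
            g j' % q = g j % q ∧ c j' < 0 ∧ (c j < c j' ∨ (c j' = c j ∧ j' < j))).card < a (g j % q)))
    (hNF : ∀ (c : Fin N → ℝ), (∀ j, c j ≠ 0) → ∀ J : Finset (Fin N), (∑ j ∈ J, g j) % q = r % q →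
        (∀ J' : Finset (Fin N), (∑ j ∈ J', g j) % q = r % q → ∑ j ∈ J', c j ≤ ∑ j ∈ J, c j) →
        ∃ a b : ℕ → ℕ, (∑ h ∈ Finset.range q, (a h + b h) < q) ∧ (∀ h, q ≤ h → a h = 0 ∧ b h = 0) ∧
          (∑ j ∈ canon c a b, g j) % q = r % q ∧ ∑ j ∈ canon c a b, c j = ∑ j ∈ J, c j) :
    (Set.extremePoints ℝ (convexHull ℝ ((fun e : Fin 2 →₀ ℕ => fun i : Fin 2 => ((e i : ℕ) : ℝ)) ''
      (((Finset.univ.filter fun J : Finset (Fin N) => (∑ j ∈ J, g j) % q = r % q).image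
        fun J => ∑ j ∈ J, d j : Finset (Fin 2 →₀ ℕ)) : Set (Fin 2 →₀ ℕ))))).ncard ≤
      (4 * (N * N + N) + 5) * q ^ (2 * q) :=
  -- LANDED (lead c6 wave 1, p132557): Theorems/NewtonUnitEquationsNewtonTauWeakResidueWeightedHull.lean
  Summit.ValiantsHypothesis.ValiantsHypothesis.Theorems.NewtonUnitEquationsNewtonTauWeak.stub_residueWeightedHullOfNF
    N q r hq g d hd canon hcanon hNF

/-- STUB S1 (S/M, PROVABLE NOW; wave 2) — **class-prefix hull count, uniform in the weight VALUES.**  If the weights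
`g j` take at most `s` distinct values then `#vert conv{Σ_J d : Σ_J g = v} ≤ (4N² + 5)(N + 1)^s`, whatever the values are
(e.g. grades `{1, c}`: `O(N³)` uniformly in `c`, where THEOREM W pays `(2c+1)^{2c}`).  Proof: a strictly exposed vertex
(`stub_exposedGenericDirection`, `T = ∅`) is `Σ_{J₀} d` for a maximiser `J₀` of the height values `c j = ⟨w, d j⟩`; replacing,
inside each weight class, `J₀ ∩ class` by the TOP `|J₀ ∩ class|` items of the class for the key `(c j, j)` keeps the weight
and does not lower the value (down-set lemma `ResidueNormalFormAux.sum_filter_rank_lt_le` applied to `-c`, or its dual), so by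
strict exposure the vertex is the point of `K(σ, n)` := ⋃_classes top-`n(class)`; `K` depends on `w` only through the sign
vector `σ` of the `N·N` functionals `⟨w, d j' − d j⟩` (`ResidueDesignHullAux.signvec_plane_count`: `≤ 4N² + 5`) and on the
count vector `n : (classes) → [0, N]`, a function on `Finset.univ.image g` with values in `Fin (N+1)`:
`(N+1)^{#classes} ≤ (N+1)^s` of them. [folklore] -/
theorem stub_classPrefixHull (N v s : ℕ) (g : Fin N → ℕ) (hs : (Finset.univ.image g).card ≤ s)
    (d : Fin N → (Fin 2 →₀ ℕ)) :
    (Set.extremePoints ℝ (convexHull ℝ ((fun e : Fin 2 →₀ ℕ => fun i : Fin 2 => ((e i : ℕ) : ℝ)) ''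
      (((Finset.univ.filter fun J : Finset (Fin N) => ∑ j ∈ J, g j = v).image
        fun J => ∑ j ∈ J, d j : Finset (Fin 2 →₀ ℕ)) : Set (Fin 2 →₀ ℕ))))).ncard ≤
      (4 * (N * N) + 5) * (N + 1) ^ s :=
  -- LANDED (lead c6 wave 2, p134514): Theorems/NewtonUnitEquationsNewtonTauWeakClassPrefixHull.lean
  Summit.ValiantsHypothesis.ValiantsHypothesis.Theorems.NewtonUnitEquationsNewtonTauWeak.stub_classPrefixHull
    N v s g hs d

/-- STUB S2 (M, PROVABLE NOW; wave 2) — **the level-set reduction: T2 bounds every weighted level set** (formal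
kill switch for the one-cell dichotomy).  If the stub's inequality holds with exponent `b` (hypothesis `hT2`, the registered
open stub with `b` fixed), then for every weight function `g` and every DISSOCIATED exponent list `d` the level set
`X_v = {Σ_J d : Σ_J g = v}` has `≤ ((Σ_j g j + 1)·N + 2)^b` hull vertices.  Proof: `K := Σ g + 1` distinct nonzero nodes
`u_l := l + 1 ∈ ℂ`; the Vandermonde matrix `(u_l^s)_{l,s<K}` is invertible (`Matrix.det_vandermonde_ne_zero_iff`), so there are
scalars `cf` with `Σ_l cf_l u_l^s = [s = v]` for all `s < K` (`cf := e_v ᵥ* V⁻¹`, `Matrix.vecMul_vecMul`,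
`Matrix.nonsing_inv_mul`); if `v ≥ K` the level set is empty; otherwise the graded design
`f := Σ_l C(cf_l) Π_j (1 − C(u_l^{g j} · 1) X^{d j})` has `coeff_{Σ_J d} f = (Π_{j∈J}(−1))·[Σ_J g = v]`
(`GradedDesignT2Aux.coeff_graded_subsetSum`, landed with W4), hence `supp f = X_v` exactly and `hT2 K N cf ρ d` with
`ρ l j := u_l^{g j}` gives the bound. [folklore; Vandermonde interpolation] -/
theorem stub_levelSetOfT2 (b : ℕ)
    (hT2 : ∀ (K N : ℕ) (c : Fin K → ℂ) (ρ : Fin K → Fin N → ℂ) (d : Fin N → (Fin 2 →₀ ℕ)),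
      vert (∑ l, C (c l) * ∏ j, (1 - C (ρ l j) * monomial (d j) 1)) ≤ (K * N + 2) ^ b)
    (N v : ℕ) (g : Fin N → ℕ) (d : Fin N → (Fin 2 →₀ ℕ))
    (hdis : ∀ J J' : Finset (Fin N), ∑ j ∈ J, d j = ∑ j ∈ J', d j → J = J') :
    (Set.extremePoints ℝ (convexHull ℝ ((fun e : Fin 2 →₀ ℕ => fun i : Fin 2 => ((e i : ℕ) : ℝ)) ''
      (((Finset.univ.filter fun J : Finset (Fin N) => ∑ j ∈ J, g j = v).image
        fun J => ∑ j ∈ J, d j : Finset (Fin 2 →₀ ℕ)) : Set (Fin 2 →₀ ℕ))))).ncard ≤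
      ((∑ j, g j + 1) * N + 2) ^ b :=
  -- LANDED (lead c6 wave 2, p134448): Theorems/NewtonUnitEquationsNewtonTauWeakLevelSetOfT2.lean
  Summit.ValiantsHypothesis.ValiantsHypothesis.Theorems.NewtonUnitEquationsNewtonTauWeak.stub_levelSetOfT2
    b hT2 N v g d hdis


/-- STUB S3 (M, PROVABLE NOW; wave 2) — **dissociation is free for hull counts** (scale refinement).  For any exponent list
`d` (coincidences allowed) there is a DISSOCIATED list `d'` (distinct subset sums) whose weighted level sets have at least as
many hull vertices: `d' j := M • d j + single 0 (2^j)` with `M` larger than `2^{N+1}·‖w_p‖` for strictly exposing directions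
`w_p` of the (finitely many) vertices `p` of `conv X_v(d)` divided by their exposure gaps; subset sums of `d'` are
`M • Σ_J d + single 0 (Σ_{j∈J} 2^j)` (injective in `J`: binary representation), every old vertex `p` becomes a cluster
`{M p + e(J) : Σ_J d = p}` and the face of `conv X_v(d')` in direction `w_p` lies inside that cluster, so distinct old vertices
yield distinct new extreme points.  With STUB S2 this makes `T2 ⇒ #vert conv X_v(d) ≤ ((Σg+1)N+2)^b` for EVERY `d`. [folklore] -/
theorem stub_refineDissociate (N v : ℕ) (g : Fin N → ℕ) (d : Fin N → (Fin 2 →₀ ℕ)) :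
    ∃ d' : Fin N → (Fin 2 →₀ ℕ), (∀ J J' : Finset (Fin N), ∑ j ∈ J, d' j = ∑ j ∈ J', d' j → J = J') ∧
      (Set.extremePoints ℝ (convexHull ℝ ((fun e : Fin 2 →₀ ℕ => fun i : Fin 2 => ((e i : ℕ) : ℝ)) ''
        (((Finset.univ.filter fun J : Finset (Fin N) => ∑ j ∈ J, g j = v).image
          fun J => ∑ j ∈ J, d j : Finset (Fin 2 →₀ ℕ)) : Set (Fin 2 →₀ ℕ))))).ncard ≤
      (Set.extremePoints ℝ (convexHull ℝ ((fun e : Fin 2 →₀ ℕ => fun i : Fin 2 => ((e i : ℕ) : ℝ)) ''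
        (((Finset.univ.filter fun J : Finset (Fin N) => ∑ j ∈ J, g j = v).image
          fun J => ∑ j ∈ J, d' j : Finset (Fin 2 →₀ ℕ)) : Set (Fin 2 →₀ ℕ))))).ncard :=
  -- LANDED (lead c6 wave 2, p134705): Theorems/NewtonUnitEquationsNewtonTauWeakRefineDissociate.lean
  Summit.ValiantsHypothesis.ValiantsHypothesis.Theorems.NewtonUnitEquationsNewtonTauWeak.stub_refineDissociate
    N v g d


/-! #### Wave 3 (stub-critic plan `Cruxes/NewtonTauWeak/STUB-PLAN-stub_binomialNewtonTauCommon.md`, Tier 1): pinned normal form,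
KERNEL BOOTSTRAP `V(N,c) ≤ (4N²+5)·V(4c²,c)` (the grade dependence is decided on `≤ 4c²` items), square-regime arithmetic, and the
cyclic T2-instance. -/

/-- STUB T1 = W2′ (S, PROVABLE NOW; wave 3, stub-critic plan) — **weighted exchange normal form with the prefix PINNED to the
Lagrangian spine** `k₀ := Nat.findGreatest (fun k => Σ_{rk j < k} g j ≤ v) N`.  Same data as `stub_weightedNormalForm` (p133603);
the landed proof (`WeightedNormalFormAux.normalForm_core`, Theorems/…WeightedNormalForm.lean) constructs exactly this `k₀` and then
hides it behind `∃ k ≤ N` — re-export it with `k₀` named (needed by T2: only with a pinned prefix do all canonical corrections of one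
cell live in one fixed kernel). [folklore] -/
theorem stub_weightedNormalFormPinned (N c v : ℕ) (g : Fin N → ℕ) (hg : ∀ j, 1 ≤ g j ∧ g j ≤ c)
    (c' : Fin N → ℝ) (J : Finset (Fin N)) (hJ : ∑ j ∈ J, g j = v)
    (hmax : ∀ J' : Finset (Fin N), ∑ j ∈ J', g j = v → ∑ j ∈ J', c' j ≤ ∑ j ∈ J, c' j)
    (rk : Fin N → ℕ)
    (hrk : ∀ j, rk j = (Finset.univ.filter fun j' : Fin N =>
        c' j * (g j' : ℝ) < c' j' * (g j : ℝ) ∨ (c' j' * (g j : ℝ) = c' j * (g j' : ℝ) ∧ j' < j)).card)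
    (canon : ℕ → (ℕ → ℕ) → (ℕ → ℕ) → Finset (Fin N))
    (hcanon : ∀ k α β, canon k α β = Finset.univ.filter fun j : Fin N =>
        (rk j < k ∧ α (g j) ≤ (Finset.univ.filter fun j' : Fin N =>
            rk j' < k ∧ g j' = g j ∧
              (c' j' * (g j : ℝ) < c' j * (g j' : ℝ) ∨ (c' j * (g j' : ℝ) = c' j' * (g j : ℝ) ∧ j < j'))).card) ∨
        (k ≤ rk j ∧ (Finset.univ.filter fun j' : Fin N =>
            k ≤ rk j' ∧ g j' = g j ∧
              (c' j * (g j' : ℝ) < c' j' * (g j : ℝ) ∨ (c' j' * (g j : ℝ) = c' j * (g j' : ℝ) ∧ j' < j))).card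
            < β (g j))) :
    ∃ (α β : ℕ → ℕ), (∑ a ∈ Finset.range (c + 1), (α a + β a) ≤ 2 * c) ∧
      (∀ a, (a = 0 ∨ c < a) → α a = 0 ∧ β a = 0) ∧
      ∑ j ∈ canon (Nat.findGreatest (fun k => ∑ j ∈ (Finset.univ.filter fun j : Fin N => rk j < k), g j ≤ v) N)
          α β, g j = v ∧
      ∑ j ∈ canon (Nat.findGreatest (fun k => ∑ j ∈ (Finset.univ.filter fun j : Fin N => rk j < k), g j ≤ v) N)
          α β, c' j = ∑ j ∈ J, c' j :=
  -- LANDED (wave 3, p136309 (seat sprove-stub_binomialN: `weightedNormalForm_pinned`, identical signature)): Theorems/NewtonUnitEquationsNewtonTauWeakWeightedNormalFormPinned.lean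
  Summit.ValiantsHypothesis.ValiantsHypothesis.Theorems.NewtonUnitEquationsNewtonTauWeak.weightedNormalForm_pinned
    N c v g hg c' J hJ hmax rk hrk canon hcanon

/-- STUB T2 = S4 (M/L, PROVABLE NOW; wave 3) — **KERNEL BOOTSTRAP from the pinned normal form: `V(N,c) ≤ (4N²+5)·V(4c²,c)`.**
GIVEN the pinned normal form (hypothesis `hNF`, = T1 for every value vector) and a bound `B` for all weighted level sets on `≤ 4c²`
items with weights in `[1,c]` (hypothesis `hB`), every weighted level set on `N` items has `≤ (4N²+5)·B` hull vertices — for ARBITRARY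
exponent lists.  Proof: a vertex `e` is strictly exposed by `w` (`stub_exposedGenericDirection`); heights `c' j = ⟨w, d j⟩`; in the cell
of the sign vector `σ` of the `N·N` density functionals `⟨w, g j • d j' − g j' • d j⟩` the rank `rk c'`, the pinned prefix `P`
(`k₀` is a function of the density order and the data) and the KERNEL `L(σ)` := (per weight class `a ∈ [1,c]`: the `2c` lowest-key items
of `P ∩ class a` and the `2c` highest-key items of `Pᶜ ∩ class a`, all of them if fewer; `|L| ≤ 4c·c`) depend on `σ` only; by `hNF` the
vertex is the point of `canon c' k₀ α β = (P ∖ L) ∪ S` with `S ⊆ L` (`α a, β a ≤ 2c`), and `Σ_S d` is the STRICT maximiser of the height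
over the kernel level set `{Σ_{S'} d : S' ⊆ L, Σ_{S'} g = v − Σ_{P∖L} g}` (a kernel competitor `S'` yields the competitor `(P∖L) ∪ S'` of
weight `v`), hence an extreme point of its hull (`DissociatedFixedK.Negative.mem_extremePoints_convexHull_of_strict_sep`); so
`e = emb(Σ_{P∖L} d) + q` with `q` a kernel extreme point: `#vertices ≤ Σ_σ #ext(kernel(σ)) ≤ (4N²+5)·B` (`signvec_plane_count`;
reindex `L(σ)` by `Fin |L|` via `Finset.orderIsoOfFin` to apply `hB`).  Brute-force checked by the stub-critic
(kit/check_kernel_bootstrap.py: 5724/5724 vertices).  [k2 STUB-IDEAS §A bootstrap lemma; STUB-PLAN S4; folklore] -/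
theorem stub_kernelBootstrapOfNF (N c v B : ℕ) (g : Fin N → ℕ) (hg : ∀ j, 1 ≤ g j ∧ g j ≤ c)
    (d : Fin N → (Fin 2 →₀ ℕ))
    (rk : (Fin N → ℝ) → Fin N → ℕ)
    (hrk : ∀ c' j, rk c' j = (Finset.univ.filter fun j' : Fin N =>
        c' j * (g j' : ℝ) < c' j' * (g j : ℝ) ∨ (c' j' * (g j : ℝ) = c' j * (g j' : ℝ) ∧ j' < j)).card)
    (canon : (Fin N → ℝ) → ℕ → (ℕ → ℕ) → (ℕ → ℕ) → Finset (Fin N))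
    (hcanon : ∀ c' k α β, canon c' k α β = Finset.univ.filter fun j : Fin N =>
        (rk c' j < k ∧ α (g j) ≤ (Finset.univ.filter fun j' : Fin N =>
            rk c' j' < k ∧ g j' = g j ∧
              (c' j' * (g j : ℝ) < c' j * (g j' : ℝ) ∨ (c' j * (g j' : ℝ) = c' j' * (g j : ℝ) ∧ j < j'))).card) ∨
        (k ≤ rk c' j ∧ (Finset.univ.filter fun j' : Fin N =>
            k ≤ rk c' j' ∧ g j' = g j ∧
              (c' j * (g j' : ℝ) < c' j' * (g j : ℝ) ∨ (c' j' * (g j : ℝ) = c' j * (g j' : ℝ) ∧ j' < j))).card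
            < β (g j)))
    (hNF : ∀ (c' : Fin N → ℝ) (J : Finset (Fin N)), ∑ j ∈ J, g j = v →
        (∀ J' : Finset (Fin N), ∑ j ∈ J', g j = v → ∑ j ∈ J', c' j ≤ ∑ j ∈ J, c' j) →
        ∃ (α β : ℕ → ℕ), (∑ a ∈ Finset.range (c + 1), (α a + β a) ≤ 2 * c) ∧
          (∀ a, (a = 0 ∨ c < a) → α a = 0 ∧ β a = 0) ∧
          ∑ j ∈ canon c' (Nat.findGreatest
              (fun k => ∑ j ∈ (Finset.univ.filter fun j : Fin N => rk c' j < k), g j ≤ v) N) α β, g j = v ∧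
          ∑ j ∈ canon c' (Nat.findGreatest
              (fun k => ∑ j ∈ (Finset.univ.filter fun j : Fin N => rk c' j < k), g j ≤ v) N) α β, c' j =
            ∑ j ∈ J, c' j)
    (hB : ∀ (n v' : ℕ) (g' : Fin n → ℕ) (d' : Fin n → (Fin 2 →₀ ℕ)), n ≤ 4 * c * c →
      (∀ j, 1 ≤ g' j ∧ g' j ≤ c) →
      (Set.extremePoints ℝ (convexHull ℝ ((fun e : Fin 2 →₀ ℕ => fun i : Fin 2 => ((e i : ℕ) : ℝ)) ''
        (((Finset.univ.filter fun J : Finset (Fin n) => ∑ j ∈ J, g' j = v').image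
          fun J => ∑ j ∈ J, d' j : Finset (Fin 2 →₀ ℕ)) : Set (Fin 2 →₀ ℕ))))).ncard ≤ B) :
    (Set.extremePoints ℝ (convexHull ℝ ((fun e : Fin 2 →₀ ℕ => fun i : Fin 2 => ((e i : ℕ) : ℝ)) ''
      (((Finset.univ.filter fun J : Finset (Fin N) => ∑ j ∈ J, g j = v).image
        fun J => ∑ j ∈ J, d j : Finset (Fin 2 →₀ ℕ)) : Set (Fin 2 →₀ ℕ))))).ncard ≤ (4 * (N * N) + 5) * B :=
  -- LANDED (wave 3, p136810 (wrapper of seat sprove-stub_binomialN `kernelBootstrapOfNF`)): Theorems/NewtonUnitEquationsNewtonTauWeakStubKernelBootstrapOfNF.lean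
  Summit.ValiantsHypothesis.ValiantsHypothesis.Theorems.NewtonUnitEquationsNewtonTauWeak.stub_kernelBootstrapOfNF
    N c v B g hg d rk hrk canon hcanon hNF hB

/-- STUB T3 = S5 (S, PROVABLE NOW; wave 3) — **polynomiality is decided in the square regime** (arithmetic on top of the kernel
bootstrap, taken as hypothesis `hKB` = T1+T2 composed): if weighted level sets on `N ≤ 4c²` items have `≤ (c+2)^e` hull vertices then all
of them have `≤ (cN+2)^{e+4}` (`(4N²+5)(c+2)^e ≤ (cN+2)^{e+4}` for `N ≥ 1`; `N = 0`: one point). [STUB-PLAN S5] -/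
theorem stub_squareToPoly (e : ℕ)
    (hKB : ∀ (N c v B : ℕ) (g : Fin N → ℕ), (∀ j, 1 ≤ g j ∧ g j ≤ c) → ∀ d : Fin N → (Fin 2 →₀ ℕ),
      (∀ (n v' : ℕ) (g' : Fin n → ℕ) (d' : Fin n → (Fin 2 →₀ ℕ)), n ≤ 4 * c * c →
        (∀ j, 1 ≤ g' j ∧ g' j ≤ c) →
        (Set.extremePoints ℝ (convexHull ℝ ((fun e : Fin 2 →₀ ℕ => fun i : Fin 2 => ((e i : ℕ) : ℝ)) ''
        (((Finset.univ.filter fun J : Finset (Fin n) => ∑ j ∈ J, g' j = v').image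
          fun J => ∑ j ∈ J, d' j : Finset (Fin 2 →₀ ℕ)) : Set (Fin 2 →₀ ℕ))))).ncard ≤ B) →
      (Set.extremePoints ℝ (convexHull ℝ ((fun e : Fin 2 →₀ ℕ => fun i : Fin 2 => ((e i : ℕ) : ℝ)) ''
        (((Finset.univ.filter fun J : Finset (Fin N) => ∑ j ∈ J, g j = v).image
          fun J => ∑ j ∈ J, d j : Finset (Fin 2 →₀ ℕ)) : Set (Fin 2 →₀ ℕ))))).ncard ≤ (4 * (N * N) + 5) * B)
    (hSq : ∀ (N c v : ℕ) (g : Fin N → ℕ), N ≤ 4 * c * c → (∀ j, 1 ≤ g j ∧ g j ≤ c) →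
      ∀ d : Fin N → (Fin 2 →₀ ℕ),
      (Set.extremePoints ℝ (convexHull ℝ ((fun e : Fin 2 →₀ ℕ => fun i : Fin 2 => ((e i : ℕ) : ℝ)) ''
        (((Finset.univ.filter fun J : Finset (Fin N) => ∑ j ∈ J, g j = v).image
          fun J => ∑ j ∈ J, d j : Finset (Fin 2 →₀ ℕ)) : Set (Fin 2 →₀ ℕ))))).ncard ≤ (c + 2) ^ e)
    (N c v : ℕ) (g : Fin N → ℕ) (hg : ∀ j, 1 ≤ g j ∧ g j ≤ c) (d : Fin N → (Fin 2 →₀ ℕ)) :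
    (Set.extremePoints ℝ (convexHull ℝ ((fun e : Fin 2 →₀ ℕ => fun i : Fin 2 => ((e i : ℕ) : ℝ)) ''
        (((Finset.univ.filter fun J : Finset (Fin N) => ∑ j ∈ J, g j = v).image
          fun J => ∑ j ∈ J, d j : Finset (Fin 2 →₀ ℕ)) : Set (Fin 2 →₀ ℕ))))).ncard ≤ (c * N + 2) ^ (e + 4) :=
  -- LANDED (wave 3, p136795): Theorems/NewtonUnitEquationsNewtonTauWeakSquareToPoly.lean
  Summit.ValiantsHypothesis.ValiantsHypothesis.Theorems.NewtonUnitEquationsNewtonTauWeak.stub_squareToPoly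
    e hKB hSq N c v g hg d

/-- STUB T4 = S6 (M, PROVABLE NOW; wave 3) — **cyclic T2-instance (the `%`-weighted twin of `stub_levelSetOfT2`).**  If T2 holds with
exponent `b`, then on a DISSOCIATED exponent list every cyclically weighted level set `{Σ_J d : Σ_J g ≡ r (mod q)}` (`q ≥ 1`) has
`≤ (qN+2)^b` hull vertices: the residue-ISOLATING torsion design `f = Σ_{θ<q} C(ζ^{−θ r}/q) Π_j (1 − C(ζ^{θ g_j}) X^{d_j})` (`ζ` a
primitive `q`-th root of unity, `Complex.isPrimitiveRoot_exp`) has `coeff_{Σ_J d} f = (Π_{j∈J}(−1))·[Σ_J g ≡ r (q)]` by character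
orthogonality (`ResidueDesignT2Aux.charSum_eq`, pattern of `ResidueDesignT2Aux.coeff_design_subsetSum` with `ζ^{θ g_j}` in place of
`ζ_{B j}^{θ_{B j}}`), so `supp f` is exactly the residue level set and `hT2 q N …` applies.  Makes a cyclic counterexample (parametric
cyclic group knapsack with super-polynomially many breakpoints) refute the stub in one step. [STUB-PLAN S6; folklore] -/
theorem stub_cyclicT2Instance (b : ℕ)
    (hT2 : ∀ (K N : ℕ) (c : Fin K → ℂ) (ρ : Fin K → Fin N → ℂ) (d : Fin N → (Fin 2 →₀ ℕ)),
      vert (∑ l, C (c l) * ∏ j, (1 - C (ρ l j) * monomial (d j) 1)) ≤ (K * N + 2) ^ b)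
    (N q r : ℕ) (hq : 1 ≤ q) (g : Fin N → ℕ) (d : Fin N → (Fin 2 →₀ ℕ))
    (hdis : ∀ J J' : Finset (Fin N), ∑ j ∈ J, d j = ∑ j ∈ J', d j → J = J') :
    (Set.extremePoints ℝ (convexHull ℝ ((fun e : Fin 2 →₀ ℕ => fun i : Fin 2 => ((e i : ℕ) : ℝ)) ''
      (((Finset.univ.filter fun J : Finset (Fin N) => (∑ j ∈ J, g j) % q = r % q).image
        fun J => ∑ j ∈ J, d j : Finset (Fin 2 →₀ ℕ)) : Set (Fin 2 →₀ ℕ))))).ncard ≤ (q * N + 2) ^ b :=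
  -- LANDED (wave 3, p136898): Theorems/NewtonUnitEquationsNewtonTauWeakCyclicT2Instance.lean
  Summit.ValiantsHypothesis.ValiantsHypothesis.Theorems.NewtonUnitEquationsNewtonTauWeak.stub_cyclicT2Instance
    b hT2 N q r hq g d hdis


/-! #### Compositions (PROVED modulo the stubs above): THEOREM W, its graded-design T2 instance, THEOREM G″ -/

/-- THEOREM W (from W2 + W3). -/
theorem weightedLevelSetHull (N c v : ℕ) (g : Fin N → ℕ) (hg : ∀ j, 1 ≤ g j ∧ g j ≤ c)
    (d : Fin N → (Fin 2 →₀ ℕ)) :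
    (Set.extremePoints ℝ (convexHull ℝ ((fun e : Fin 2 →₀ ℕ => fun i : Fin 2 => ((e i : ℕ) : ℝ)) ''
      (((Finset.univ.filter fun J : Finset (Fin N) => ∑ j ∈ J, g j = v).image
        fun J => ∑ j ∈ J, d j : Finset (Fin 2 →₀ ℕ)) : Set (Fin 2 →₀ ℕ))))).ncard ≤
      (4 * (N * N) + 5) * (N + 1) * (2 * c + 1) ^ (2 * c) := by
  refine stub_weightedLevelSetHullOfNF N c v g hg d
    (fun c' j => (Finset.univ.filter fun j' : Fin N =>
        c' j * (g j' : ℝ) < c' j' * (g j : ℝ) ∨ (c' j' * (g j : ℝ) = c' j * (g j' : ℝ) ∧ j' < j)).card)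
    (fun _ _ => rfl) _ (fun _ _ _ _ => rfl) ?_
  intro c' J hJ hmax
  exact stub_weightedNormalForm N c v g hg c' J hJ hmax _ (fun _ => rfl) _ (fun _ _ _ => rfl)

/-- THEOREM W read as T2 on GRADED designs (from THEOREM W + W4). -/
theorem gradedDesignT2 (N c K : ℕ) (g : Fin N → ℕ) (hg : ∀ j, 1 ≤ g j ∧ g j ≤ c)
    (u cf : Fin K → ℂ) (ρ : Fin N → ℂ) (hρ : ∀ j, ρ j ≠ 0) (d : Fin N → (Fin 2 →₀ ℕ))
    (hdis : ∀ J J' : Finset (Fin N), ∑ j ∈ J, d j = ∑ j ∈ J', d j → J = J') :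
    vert (∑ l, C (cf l) * ∏ j, (1 - C (u l ^ g j * ρ j) * monomial (d j) 1)) ≤
      (∑ j, g j + 1) * ((4 * (N * N) + 5) * (N + 1) * (2 * c + 1) ^ (2 * c)) :=
  stub_gradedDesignT2OfHull N K _ g u cf ρ hρ d hdis (fun v => weightedLevelSetHull N c v g hg d)

/-- THEOREM G″ (weighted residue designs at fixed modulus; from R1 + R2). -/
theorem residueWeightedHull (N q r : ℕ) (hq : 1 ≤ q) (g : Fin N → ℕ)
    (d : Fin N → (Fin 2 →₀ ℕ)) (hd : ∀ j, d j ≠ 0) :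
    (Set.extremePoints ℝ (convexHull ℝ ((fun e : Fin 2 →₀ ℕ => fun i : Fin 2 => ((e i : ℕ) : ℝ)) ''
      (((Finset.univ.filter fun J : Finset (Fin N) => (∑ j ∈ J, g j) % q = r % q).image
        fun J => ∑ j ∈ J, d j : Finset (Fin 2 →₀ ℕ)) : Set (Fin 2 →₀ ℕ))))).ncard ≤
      (4 * (N * N + N) + 5) * q ^ (2 * q) := by
  refine stub_residueWeightedHullOfNF N q r hq g d hd _ (fun _ _ _ => rfl) ?_
  intro c hc J hJ hmax
  exact stub_residueWeightedNormalForm N q r hq g c hc J hJ hmax _ (fun _ _ => rfl)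

/-- T2 ⇒ polynomial hull counts for ALL weighted level sets (from S2 + S3): the formal kill switch of the one-cell
dichotomy — a super-polynomial family of weighted level sets refutes `stub_binomialNewtonTauCommon`. -/
theorem levelSet_of_T2 (b : ℕ)
    (hT2 : ∀ (K N : ℕ) (c : Fin K → ℂ) (ρ : Fin K → Fin N → ℂ) (d : Fin N → (Fin 2 →₀ ℕ)),
      vert (∑ l, C (c l) * ∏ j, (1 - C (ρ l j) * monomial (d j) 1)) ≤ (K * N + 2) ^ b)
    (N v : ℕ) (g : Fin N → ℕ) (d : Fin N → (Fin 2 →₀ ℕ)) :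
    (Set.extremePoints ℝ (convexHull ℝ ((fun e : Fin 2 →₀ ℕ => fun i : Fin 2 => ((e i : ℕ) : ℝ)) ''
      (((Finset.univ.filter fun J : Finset (Fin N) => ∑ j ∈ J, g j = v).image
        fun J => ∑ j ∈ J, d j : Finset (Fin 2 →₀ ℕ)) : Set (Fin 2 →₀ ℕ))))).ncard ≤
      ((∑ j, g j + 1) * N + 2) ^ b := by
  obtain ⟨d', hdis, hle⟩ := stub_refineDissociate N v g d
  exact hle.trans (stub_levelSetOfT2 b hT2 N v g d' hdis)

/-- KERNEL BOOTSTRAP, unconditional in the normal form (T1 + T2): `V(N,c) ≤ (4N²+5)·V(4c²,c)`. -/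
theorem kernelBootstrap (N c v B : ℕ) (g : Fin N → ℕ) (hg : ∀ j, 1 ≤ g j ∧ g j ≤ c)
    (d : Fin N → (Fin 2 →₀ ℕ))
    (hB : ∀ (n v' : ℕ) (g' : Fin n → ℕ) (d' : Fin n → (Fin 2 →₀ ℕ)), n ≤ 4 * c * c →
      (∀ j, 1 ≤ g' j ∧ g' j ≤ c) →
      (Set.extremePoints ℝ (convexHull ℝ ((fun e : Fin 2 →₀ ℕ => fun i : Fin 2 => ((e i : ℕ) : ℝ)) ''
        (((Finset.univ.filter fun J : Finset (Fin n) => ∑ j ∈ J, g' j = v').image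
          fun J => ∑ j ∈ J, d' j : Finset (Fin 2 →₀ ℕ)) : Set (Fin 2 →₀ ℕ))))).ncard ≤ B) :
    (Set.extremePoints ℝ (convexHull ℝ ((fun e : Fin 2 →₀ ℕ => fun i : Fin 2 => ((e i : ℕ) : ℝ)) ''
      (((Finset.univ.filter fun J : Finset (Fin N) => ∑ j ∈ J, g j = v).image
        fun J => ∑ j ∈ J, d j : Finset (Fin 2 →₀ ℕ)) : Set (Fin 2 →₀ ℕ))))).ncard ≤ (4 * (N * N) + 5) * B := by
  refine stub_kernelBootstrapOfNF N c v B g hg d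
    (fun c' j => (Finset.univ.filter fun j' : Fin N =>
        c' j * (g j' : ℝ) < c' j' * (g j : ℝ) ∨ (c' j' * (g j : ℝ) = c' j * (g j' : ℝ) ∧ j' < j)).card)
    (fun _ _ => rfl) _ (fun _ _ _ _ => rfl) ?_ hB
  intro c' J hJ hmax
  exact stub_weightedNormalFormPinned N c v g hg c' J hJ hmax _ (fun _ => rfl) _ (fun _ _ _ => rfl)

/-- Square regime ⇒ H6 (T1 + T2 + T3): if level sets on `≤ 4c²` items have `≤ (c+2)^e` vertices, all have `≤ (cN+2)^{e+4}`. -/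
theorem weightedLevelSetPoly_of_square (e : ℕ)
    (hSq : ∀ (N c v : ℕ) (g : Fin N → ℕ), N ≤ 4 * c * c → (∀ j, 1 ≤ g j ∧ g j ≤ c) →
      ∀ d : Fin N → (Fin 2 →₀ ℕ),
      (Set.extremePoints ℝ (convexHull ℝ ((fun e : Fin 2 →₀ ℕ => fun i : Fin 2 => ((e i : ℕ) : ℝ)) ''
        (((Finset.univ.filter fun J : Finset (Fin N) => ∑ j ∈ J, g j = v).image
          fun J => ∑ j ∈ J, d j : Finset (Fin 2 →₀ ℕ)) : Set (Fin 2 →₀ ℕ))))).ncard ≤ (c + 2) ^ e)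
    (N c v : ℕ) (g : Fin N → ℕ) (hg : ∀ j, 1 ≤ g j ∧ g j ≤ c) (d : Fin N → (Fin 2 →₀ ℕ)) :
    (Set.extremePoints ℝ (convexHull ℝ ((fun e : Fin 2 →₀ ℕ => fun i : Fin 2 => ((e i : ℕ) : ℝ)) ''
      (((Finset.univ.filter fun J : Finset (Fin N) => ∑ j ∈ J, g j = v).image
        fun J => ∑ j ∈ J, d j : Finset (Fin 2 →₀ ℕ)) : Set (Fin 2 →₀ ℕ))))).ncard ≤ (c * N + 2) ^ (e + 4) :=
  stub_squareToPoly e (fun N c v B g hg d hB => kernelBootstrap N c v B g hg d hB) hSq N c v g hg d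

end RungC6

/-! ### Rung stubs of lead c7 (THEOREM W♯ = quasi-polynomial grade dependence of THEOREM W by GUSFIELD HALVING OVER THE
ITEMS; registered helper stubs, NOT used by the composition)

`X_v(A ⊔ B) = ⋃_{v₁} (X_{v₁}(A) + X_{v−v₁}(B))` (Minkowski sums of the level sets of the two halves), hull vertices of a
finite union are at most the sum over the pieces, hull vertices of a planar Minkowski sum of finite sets are at most
`2·(#vert P + #vert Q)` (chart/sweep: unique maximisers of the heights `t·x + σ·y` move monotonically in `t`), so
`V(n₁+n₂) ≤ Σ_{v₁ ≤ c n₁} 2 (V_A(v₁) + V_B(v − v₁))`, `V(N, c) ≤ (8cN+4)^{⌈log₂ N⌉}` for EVERY exponent list, and with the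
landed kernel bootstrap (RungC6 `kernelBootstrap`) `V(N,c) ≤ (4N²+5)·(32c³+4)^{⌈log₂(4c²)⌉}`: polynomial in `N`,
quasi-polynomial in the grade `c`, uniform in `K` on graded designs.  Abbreviations used in the docstrings only:
`emb e i = (e i : ℝ)`, `LS N g d v = {Σ_{j∈J} d j : J ⊆ Fin N, Σ_{j∈J} g j = v}` (a `Finset (Fin 2 →₀ ℕ)`),
`LV N g d v = #ext conv (emb '' LS N g d v)`, `P ⊕ Q = (P ×ˢ Q).image (·.1 + ·.2)` (Minkowski sum),
`U_σ(S) = {p ∈ S : ∃ t, ∀ q ∈ S, q ≠ p → t·q₀ + σ·q₁ < t·p₀ + σ·p₁}` (points of `S` strictly exposed in the chart `σ`).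
Each stub lands as its own `--supports` file `Theorems/NewtonUnitEquationsNewtonTauWeak<Stub>.lean`
(namespace `…Theorems.NewtonUnitEquationsNewtonTauWeak`). -/
namespace RungC7

/-- STUB Q1a (M/L, PROVABLE NOW) — **chart lemma for Minkowski sums**: for nonempty finite `A, B ⊆ ℕ²` and a chart
`σ : ℝ`, `σ ≠ 0` (reshaped 2026-08-17 after the worker's witness `A = B = {0, single 1 1}` at `σ = 0`: all three sets empty) (heights `h_t(p) = t·p₀ + σ·p₁`), `|U_σ(A ⊕ B)| + 1 ≤ |U_σ(A)| + |U_σ(B)|`.  Proof: (a) if `z ∈ A ⊕ B` is the unique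
`h_t`-maximiser over `A ⊕ B` and `z = a + b` (`a ∈ A`, `b ∈ B`) then `a` is the unique `h_t`-maximiser over `A` and `b` over
`B` (a competitor `a'` gives the competitor `a' + b ≠ z`); hence the decomposition `z = a_z + b_z` is unique and
`a_z ∈ U_σ(A)`, `b_z ∈ U_σ(B)`.  (b) EXCHANGE: if `p ≠ p'` are unique `h_t`-, `h_{t'}`-maximisers over the same set then
`(t − t')(p₀ − p'₀) > 0` (add the two strict inequalities); so `p ↦ p₀` is injective on `U_σ(S)` and orders it like `t`.
(c) Hence for `z, z' ∈ U_σ(A ⊕ B)` with `z₀ < z'₀`: `(a_z)₀ ≤ (a_{z'})₀` and `(b_z)₀ ≤ (b_{z'})₀` — the set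
`Z = {((a_z)₀, (b_z)₀)} ⊆ ℝ × ℝ` is a CHAIN for the product order, and `z ↦ ((a_z)₀,(b_z)₀)` is injective (the sum of the
two coordinates is `z₀`).  (d) A finite nonempty chain `Z` in a product of two linear orders has `|Z| + 1 ≤ |π₁ Z| + |π₂ Z|`
(induction: remove the maximum; it is strictly larger than the maximum of the rest in one coordinate, which is then a
new value); `π₁ Z ⊆ (·)₀ '' U_σ(A)`, `π₂ Z ⊆ (·)₀ '' U_σ(B)`. [folklore: vertices of planar Minkowski sums] -/
theorem stub_sumsetChartCount (σ : ℝ) (hσ : σ ≠ 0) (A B : Finset (Fin 2 →₀ ℕ)) (hA : A.Nonempty) (hB : B.Nonempty) :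
    {p : Fin 2 →₀ ℕ | p ∈ (A ×ˢ B).image (fun pq : (Fin 2 →₀ ℕ) × (Fin 2 →₀ ℕ) => pq.1 + pq.2) ∧
        ∃ t : ℝ, ∀ q ∈ (A ×ˢ B).image (fun pq : (Fin 2 →₀ ℕ) × (Fin 2 →₀ ℕ) => pq.1 + pq.2), q ≠ p →
          t * ((q 0 : ℕ) : ℝ) + σ * ((q 1 : ℕ) : ℝ) < t * ((p 0 : ℕ) : ℝ) + σ * ((p 1 : ℕ) : ℝ)}.ncard + 1 ≤
      {p : Fin 2 →₀ ℕ | p ∈ A ∧ ∃ t : ℝ, ∀ q ∈ A, q ≠ p →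
          t * ((q 0 : ℕ) : ℝ) + σ * ((q 1 : ℕ) : ℝ) < t * ((p 0 : ℕ) : ℝ) + σ * ((p 1 : ℕ) : ℝ)}.ncard +
      {p : Fin 2 →₀ ℕ | p ∈ B ∧ ∃ t : ℝ, ∀ q ∈ B, q ≠ p →
          t * ((q 0 : ℕ) : ℝ) + σ * ((q 1 : ℕ) : ℝ) < t * ((p 0 : ℕ) : ℝ) + σ * ((p 1 : ℕ) : ℝ)}.ncard :=
  -- LANDED (lead c7 wave 1, p139031: Theorems/NewtonUnitEquationsNewtonTauWeakSumsetChartCount.lean)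
  Summit.ValiantsHypothesis.ValiantsHypothesis.Theorems.NewtonUnitEquationsNewtonTauWeak.stub_sumsetChartCount σ hσ A B hA hB

/-- STUB Q1b (M, PROVABLE NOW) — **hull vertices of a planar Minkowski sum**, from the chart lemma (hypothesis `hchart` =
STUB Q1a for every chart): `#ext conv(emb '' (P ⊕ Q)) ≤ 2·(#ext conv(emb '' P) + #ext conv(emb '' Q))`.  Proof: if `P` or `Q`
is empty the sum is empty.  Otherwise every extreme point of `conv(emb '' S)` (`S` finite) is `emb p` for a `p ∈ S` strictly
exposed by a direction `w` with `w 1 ≠ 0` (`NewtonUnitEquationsDissociatedUniform.stub_exposedGenericDirection` with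
`T = {0, single 1 1}`: injectivity on `T` is `w 1 ≠ 0`); dividing by `|w 1|` puts `p` in `U_1(S)` or `U_{-1}(S)`, so
`#ext ≤ |U_1(S)| + |U_{-1}(S)|` (`emb` injective); conversely `U_σ(S) ↪ ext conv(emb '' S)` (strict exposure by the linear
functional `x ↦ t x₀ + σ x₁`: `DissociatedFixedK.Negative.mem_extremePoints_convexHull_of_strict_sep`), so
`|U_σ(P)| ≤ #ext conv(emb '' P)`; combine with `hchart` at `σ = 1, −1`. [folklore] -/
theorem stub_minkowskiVertexBoundOfChart
    (hchart : ∀ (σ : ℝ), σ ≠ 0 → ∀ (A B : Finset (Fin 2 →₀ ℕ)), A.Nonempty → B.Nonempty →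
      {p : Fin 2 →₀ ℕ | p ∈ (A ×ˢ B).image (fun pq : (Fin 2 →₀ ℕ) × (Fin 2 →₀ ℕ) => pq.1 + pq.2) ∧
          ∃ t : ℝ, ∀ q ∈ (A ×ˢ B).image (fun pq : (Fin 2 →₀ ℕ) × (Fin 2 →₀ ℕ) => pq.1 + pq.2), q ≠ p →
            t * ((q 0 : ℕ) : ℝ) + σ * ((q 1 : ℕ) : ℝ) < t * ((p 0 : ℕ) : ℝ) + σ * ((p 1 : ℕ) : ℝ)}.ncard + 1 ≤
        {p : Fin 2 →₀ ℕ | p ∈ A ∧ ∃ t : ℝ, ∀ q ∈ A, q ≠ p →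
            t * ((q 0 : ℕ) : ℝ) + σ * ((q 1 : ℕ) : ℝ) < t * ((p 0 : ℕ) : ℝ) + σ * ((p 1 : ℕ) : ℝ)}.ncard +
        {p : Fin 2 →₀ ℕ | p ∈ B ∧ ∃ t : ℝ, ∀ q ∈ B, q ≠ p →
            t * ((q 0 : ℕ) : ℝ) + σ * ((q 1 : ℕ) : ℝ) < t * ((p 0 : ℕ) : ℝ) + σ * ((p 1 : ℕ) : ℝ)}.ncard)
    (P Q : Finset (Fin 2 →₀ ℕ)) :
    (Set.extremePoints ℝ (convexHull ℝ ((fun e : Fin 2 →₀ ℕ => fun i : Fin 2 => ((e i : ℕ) : ℝ)) ''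
      (((P ×ˢ Q).image (fun pq : (Fin 2 →₀ ℕ) × (Fin 2 →₀ ℕ) => pq.1 + pq.2) : Finset (Fin 2 →₀ ℕ)) :
        Set (Fin 2 →₀ ℕ))))).ncard ≤
      2 * ((Set.extremePoints ℝ (convexHull ℝ ((fun e : Fin 2 →₀ ℕ => fun i : Fin 2 => ((e i : ℕ) : ℝ)) ''
          (P : Set (Fin 2 →₀ ℕ))))).ncard +
        (Set.extremePoints ℝ (convexHull ℝ ((fun e : Fin 2 →₀ ℕ => fun i : Fin 2 => ((e i : ℕ) : ℝ)) ''
          (Q : Set (Fin 2 →₀ ℕ))))).ncard) :=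
  -- LANDED (lead c7 wave 1, p139206: Theorems/NewtonUnitEquationsNewtonTauWeakMinkowskiVertexBoundOfChart.lean)
  Summit.ValiantsHypothesis.ValiantsHypothesis.Theorems.NewtonUnitEquationsNewtonTauWeak.stub_minkowskiVertexBoundOfChart hchart P Q

/-- STUB Q2 (S, PROVABLE NOW) — **hull vertices of a finite union**: an extreme point of `conv(emb '' ⋃_i S i)` lies in some
`emb '' (S i)` (`extremePoints_convexHull_subset`) and is an extreme point of `conv(emb '' (S i))` (extremality is inherited by
convex subsets containing the point: `convexHull_mono`), so the `ncard`s add up (`Set.ncard_biUnion_le`-type count over `s`,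
or induction on `s`).  Pattern: `GradedDesignT2Aux` (Theorems/…GradedDesignT2.lean), the union step of W4. [folklore] -/
theorem stub_unionVertexBound {ι : Type} (s : Finset ι) (S : ι → Finset (Fin 2 →₀ ℕ)) :
    (Set.extremePoints ℝ (convexHull ℝ ((fun e : Fin 2 →₀ ℕ => fun i : Fin 2 => ((e i : ℕ) : ℝ)) ''
      ((s.biUnion S : Finset (Fin 2 →₀ ℕ)) : Set (Fin 2 →₀ ℕ))))).ncard ≤
      ∑ i ∈ s, (Set.extremePoints ℝ (convexHull ℝ ((fun e : Fin 2 →₀ ℕ => fun i : Fin 2 => ((e i : ℕ) : ℝ)) ''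
        (S i : Set (Fin 2 →₀ ℕ))))).ncard :=
  -- LANDED (lead c7 wave 1, p138825: Theorems/NewtonUnitEquationsNewtonTauWeakUnionVertexBound.lean)
  Summit.ValiantsHypothesis.ValiantsHypothesis.Theorems.NewtonUnitEquationsNewtonTauWeak.stub_unionVertexBound s S

/-- STUB Q3 (S/M, PROVABLE NOW) — **level sets split as a union of Minkowski sums**: for items `Fin (n₁ + n₂)` (first block
`Fin.castAdd n₂ : Fin n₁ → Fin (n₁+n₂)`, second block `Fin.natAdd n₁ : Fin n₂ → Fin (n₁+n₂)`),
`LS (n₁+n₂) g d v = ⋃_{v₁ ≤ v} LS n₁ g₁ d₁ v₁ ⊕ LS n₂ g₂ d₂ (v − v₁)` as finsets (`g₁ = g ∘ castAdd`, `g₂ = g ∘ natAdd`, etc.).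
`⊆`: split `J` into its two blocks (`Finset.univ.filter (castAdd · ∈ J)` etc., sums split by `Fin.sum_univ_add`-type /
`Finset.sum_filter` bookkeeping, `v₁ := Σ_{block 1} g ≤ v`); `⊇`: `J := J₁.map castAddEmb ∪ J₂.map natAddEmb` (disjoint
images), weights `v₁ + (v − v₁) = v`. [folklore] -/
theorem stub_levelSetSplit (n₁ n₂ v : ℕ) (g : Fin (n₁ + n₂) → ℕ) (d : Fin (n₁ + n₂) → (Fin 2 →₀ ℕ)) :
    ((Finset.univ.filter fun J : Finset (Fin (n₁ + n₂)) => ∑ j ∈ J, g j = v).image fun J => ∑ j ∈ J, d j) =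
      (Finset.range (v + 1)).biUnion fun v₁ =>
        ((((Finset.univ.filter fun J : Finset (Fin n₁) => ∑ j ∈ J, g (Fin.castAdd n₂ j) = v₁).image
            fun J => ∑ j ∈ J, d (Fin.castAdd n₂ j)) ×ˢ
          ((Finset.univ.filter fun J : Finset (Fin n₂) => ∑ j ∈ J, g (Fin.natAdd n₁ j) = v - v₁).image
            fun J => ∑ j ∈ J, d (Fin.natAdd n₁ j))).image
          fun pq : (Fin 2 →₀ ℕ) × (Fin 2 →₀ ℕ) => pq.1 + pq.2) :=
  -- LANDED (lead c7 wave 1, p138895: Theorems/NewtonUnitEquationsNewtonTauWeakLevelSetSplit.lean)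
  Summit.ValiantsHypothesis.ValiantsHypothesis.Theorems.NewtonUnitEquationsNewtonTauWeak.stub_levelSetSplit n₁ n₂ v g d

/-- STUB Q4 (M, PROVABLE NOW) — **the halving inequality** from Q1b (`hM`), Q2 (`hU`) and Q3 (`hS`) taken as hypotheses:
`LV (n₁+n₂) g d v ≤ Σ_{v₁ ≤ c·n₁} 2·(LV n₁ g₁ d₁ v₁ + LV n₂ g₂ d₂ (v − v₁))` when all weights lie in `[1, c]`.  Proof: rewrite
the level set by `hS`, bound the union by `hU` (index set `range (v+1)`), each Minkowski piece by `hM`; the pieces with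
`v₁ > c·n₁` are EMPTY (a subset of `Fin n₁` weighs `≤ c·n₁`), so contribute `0` (`convexHull_empty`, `extremePoints_empty`,
`Set.ncard_empty`) — bound the remaining ones termwise and enlarge the index set to `range (c·n₁+1)` (`v − v₁` is truncated
subtraction; extra terms are harmless, `Finset.sum_le_sum_of_subset`). [folklore: Gusfield halving] -/
theorem stub_levelVertsHalving (n₁ n₂ c v : ℕ) (g : Fin (n₁ + n₂) → ℕ) (hg : ∀ j, 1 ≤ g j ∧ g j ≤ c)
    (d : Fin (n₁ + n₂) → (Fin 2 →₀ ℕ))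
    (hM : ∀ P Q : Finset (Fin 2 →₀ ℕ),
      (Set.extremePoints ℝ (convexHull ℝ ((fun e : Fin 2 →₀ ℕ => fun i : Fin 2 => ((e i : ℕ) : ℝ)) ''
        (((P ×ˢ Q).image (fun pq : (Fin 2 →₀ ℕ) × (Fin 2 →₀ ℕ) => pq.1 + pq.2) : Finset (Fin 2 →₀ ℕ)) :
          Set (Fin 2 →₀ ℕ))))).ncard ≤
        2 * ((Set.extremePoints ℝ (convexHull ℝ ((fun e : Fin 2 →₀ ℕ => fun i : Fin 2 => ((e i : ℕ) : ℝ)) ''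
            (P : Set (Fin 2 →₀ ℕ))))).ncard +
          (Set.extremePoints ℝ (convexHull ℝ ((fun e : Fin 2 →₀ ℕ => fun i : Fin 2 => ((e i : ℕ) : ℝ)) ''
            (Q : Set (Fin 2 →₀ ℕ))))).ncard))
    (hU : ∀ (s : Finset ℕ) (S : ℕ → Finset (Fin 2 →₀ ℕ)),
      (Set.extremePoints ℝ (convexHull ℝ ((fun e : Fin 2 →₀ ℕ => fun i : Fin 2 => ((e i : ℕ) : ℝ)) ''
        ((s.biUnion S : Finset (Fin 2 →₀ ℕ)) : Set (Fin 2 →₀ ℕ))))).ncard ≤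
        ∑ i ∈ s, (Set.extremePoints ℝ (convexHull ℝ ((fun e : Fin 2 →₀ ℕ => fun i : Fin 2 => ((e i : ℕ) : ℝ)) ''
          (S i : Set (Fin 2 →₀ ℕ))))).ncard)
    (hS : ∀ (n₁ n₂ v : ℕ) (g : Fin (n₁ + n₂) → ℕ) (d : Fin (n₁ + n₂) → (Fin 2 →₀ ℕ)),
      ((Finset.univ.filter fun J : Finset (Fin (n₁ + n₂)) => ∑ j ∈ J, g j = v).image fun J => ∑ j ∈ J, d j) =
        (Finset.range (v + 1)).biUnion fun v₁ =>
          ((((Finset.univ.filter fun J : Finset (Fin n₁) => ∑ j ∈ J, g (Fin.castAdd n₂ j) = v₁).image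
              fun J => ∑ j ∈ J, d (Fin.castAdd n₂ j)) ×ˢ
            ((Finset.univ.filter fun J : Finset (Fin n₂) => ∑ j ∈ J, g (Fin.natAdd n₁ j) = v - v₁).image
              fun J => ∑ j ∈ J, d (Fin.natAdd n₁ j))).image
            fun pq : (Fin 2 →₀ ℕ) × (Fin 2 →₀ ℕ) => pq.1 + pq.2)) :
    (Set.extremePoints ℝ (convexHull ℝ ((fun e : Fin 2 →₀ ℕ => fun i : Fin 2 => ((e i : ℕ) : ℝ)) ''
      (((Finset.univ.filter fun J : Finset (Fin (n₁ + n₂)) => ∑ j ∈ J, g j = v).image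
        fun J => ∑ j ∈ J, d j : Finset (Fin 2 →₀ ℕ)) : Set (Fin 2 →₀ ℕ))))).ncard ≤
      ∑ v₁ ∈ Finset.range (c * n₁ + 1), 2 *
        ((Set.extremePoints ℝ (convexHull ℝ ((fun e : Fin 2 →₀ ℕ => fun i : Fin 2 => ((e i : ℕ) : ℝ)) ''
          (((Finset.univ.filter fun J : Finset (Fin n₁) => ∑ j ∈ J, g (Fin.castAdd n₂ j) = v₁).image
            fun J => ∑ j ∈ J, d (Fin.castAdd n₂ j) : Finset (Fin 2 →₀ ℕ)) : Set (Fin 2 →₀ ℕ))))).ncard +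
        (Set.extremePoints ℝ (convexHull ℝ ((fun e : Fin 2 →₀ ℕ => fun i : Fin 2 => ((e i : ℕ) : ℝ)) ''
          (((Finset.univ.filter fun J : Finset (Fin n₂) => ∑ j ∈ J, g (Fin.natAdd n₁ j) = v - v₁).image
            fun J => ∑ j ∈ J, d (Fin.natAdd n₁ j) : Finset (Fin 2 →₀ ℕ)) : Set (Fin 2 →₀ ℕ))))).ncard) :=
  -- LANDED (lead c7 wave 1, p138903: Theorems/NewtonUnitEquationsNewtonTauWeakLevelVertsHalving.lean)
  Summit.ValiantsHypothesis.ValiantsHypothesis.Theorems.NewtonUnitEquationsNewtonTauWeak.stub_levelVertsHalving n₁ n₂ c v g hg d hM hU hS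

/-- STUB Q5 (M, PROVABLE NOW) — **the halving recursion**: from the halving inequality (hypothesis `hH` = STUB Q4 composed,
for all block sizes) every weighted level set on `N` items with weights in `[1, c]` has `≤ (8cN + 4)^{⌈log₂ N⌉}` hull
vertices (`Nat.clog 2 N`).  Proof: `P k := ∀ N ≤ 2^k, LV ≤ (4c·2^k + 4)^k` by induction on `k`.  Base: `N ≤ 1` — the level
set has at most one point (`N = 0`: only `J = ∅`; `N = 1`: all `J` with the given weight have the same sum since there is at
most one nonempty `J`), so `ncard ≤ 1` (`Set.ncard_le_one`-type / `extremePoints ⊆ emb '' LS`, a subsingleton).  Step: for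
`N ≤ 2^{k+1}` write `N = n₁ + n₂`, `n₁ = N/2 ≤ 2^k`, `n₂ = N − N/2 ≤ 2^k` (`obtain ⟨n₁,n₂,rfl⟩`-style, so that `g : Fin (n₁+n₂) → ℕ`
literally), apply `hH`: `≤ (c n₁ + 1)·2·(B_k + B_k) ≤ (4c·2^k + 4)·B_k ≤ (4c·2^{k+1}+4)^{k+1}` (`Finset.sum_le_card_nsmul`,
`Nat.pow_le_pow_left`).  Finally `k := Nat.clog 2 N`: `N ≤ 2^k` (`Nat.le_pow_clog`) and `2^k ≤ 2N` for `N ≥ 1`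
(`Nat.pow_pred_clog_lt_self`), so `4c·2^k + 4 ≤ 8cN + 4`; `N = 0`: `clog = 0`, one point. [folklore: Gusfield halving] -/
theorem stub_levelVertsRecursion
    (hH : ∀ (n₁ n₂ c v : ℕ) (g : Fin (n₁ + n₂) → ℕ), (∀ j, 1 ≤ g j ∧ g j ≤ c) →
      ∀ d : Fin (n₁ + n₂) → (Fin 2 →₀ ℕ),
      (Set.extremePoints ℝ (convexHull ℝ ((fun e : Fin 2 →₀ ℕ => fun i : Fin 2 => ((e i : ℕ) : ℝ)) ''
        (((Finset.univ.filter fun J : Finset (Fin (n₁ + n₂)) => ∑ j ∈ J, g j = v).image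
          fun J => ∑ j ∈ J, d j : Finset (Fin 2 →₀ ℕ)) : Set (Fin 2 →₀ ℕ))))).ncard ≤
        ∑ v₁ ∈ Finset.range (c * n₁ + 1), 2 *
          ((Set.extremePoints ℝ (convexHull ℝ ((fun e : Fin 2 →₀ ℕ => fun i : Fin 2 => ((e i : ℕ) : ℝ)) ''
            (((Finset.univ.filter fun J : Finset (Fin n₁) => ∑ j ∈ J, g (Fin.castAdd n₂ j) = v₁).image
              fun J => ∑ j ∈ J, d (Fin.castAdd n₂ j) : Finset (Fin 2 →₀ ℕ)) : Set (Fin 2 →₀ ℕ))))).ncard +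
          (Set.extremePoints ℝ (convexHull ℝ ((fun e : Fin 2 →₀ ℕ => fun i : Fin 2 => ((e i : ℕ) : ℝ)) ''
            (((Finset.univ.filter fun J : Finset (Fin n₂) => ∑ j ∈ J, g (Fin.natAdd n₁ j) = v - v₁).image
              fun J => ∑ j ∈ J, d (Fin.natAdd n₁ j) : Finset (Fin 2 →₀ ℕ)) : Set (Fin 2 →₀ ℕ))))).ncard))
    (N c v : ℕ) (g : Fin N → ℕ) (hg : ∀ j, 1 ≤ g j ∧ g j ≤ c) (d : Fin N → (Fin 2 →₀ ℕ)) :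
    (Set.extremePoints ℝ (convexHull ℝ ((fun e : Fin 2 →₀ ℕ => fun i : Fin 2 => ((e i : ℕ) : ℝ)) ''
      (((Finset.univ.filter fun J : Finset (Fin N) => ∑ j ∈ J, g j = v).image
        fun J => ∑ j ∈ J, d j : Finset (Fin 2 →₀ ℕ)) : Set (Fin 2 →₀ ℕ))))).ncard ≤
      (8 * c * N + 4) ^ (Nat.clog 2 N) :=
  -- LANDED (lead c7 wave 1, p138921: Theorems/NewtonUnitEquationsNewtonTauWeakLevelVertsRecursion.lean)
  Summit.ValiantsHypothesis.ValiantsHypothesis.Theorems.NewtonUnitEquationsNewtonTauWeak.stub_levelVertsRecursion hH N c v g hg d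

/-! #### Compositions (PROVED modulo the stubs above): THEOREM W♯ and its graded-design T2 instance -/

/-- The halving inequality, unconditional in the three geometric stubs (Q1a + Q1b + Q2 + Q3 + Q4). -/
theorem levelVertsHalving (n₁ n₂ c v : ℕ) (g : Fin (n₁ + n₂) → ℕ) (hg : ∀ j, 1 ≤ g j ∧ g j ≤ c)
    (d : Fin (n₁ + n₂) → (Fin 2 →₀ ℕ)) :
    (Set.extremePoints ℝ (convexHull ℝ ((fun e : Fin 2 →₀ ℕ => fun i : Fin 2 => ((e i : ℕ) : ℝ)) ''
      (((Finset.univ.filter fun J : Finset (Fin (n₁ + n₂)) => ∑ j ∈ J, g j = v).image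
        fun J => ∑ j ∈ J, d j : Finset (Fin 2 →₀ ℕ)) : Set (Fin 2 →₀ ℕ))))).ncard ≤
      ∑ v₁ ∈ Finset.range (c * n₁ + 1), 2 *
        ((Set.extremePoints ℝ (convexHull ℝ ((fun e : Fin 2 →₀ ℕ => fun i : Fin 2 => ((e i : ℕ) : ℝ)) ''
          (((Finset.univ.filter fun J : Finset (Fin n₁) => ∑ j ∈ J, g (Fin.castAdd n₂ j) = v₁).image
            fun J => ∑ j ∈ J, d (Fin.castAdd n₂ j) : Finset (Fin 2 →₀ ℕ)) : Set (Fin 2 →₀ ℕ))))).ncard +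
        (Set.extremePoints ℝ (convexHull ℝ ((fun e : Fin 2 →₀ ℕ => fun i : Fin 2 => ((e i : ℕ) : ℝ)) ''
          (((Finset.univ.filter fun J : Finset (Fin n₂) => ∑ j ∈ J, g (Fin.natAdd n₁ j) = v - v₁).image
            fun J => ∑ j ∈ J, d (Fin.natAdd n₁ j) : Finset (Fin 2 →₀ ℕ)) : Set (Fin 2 →₀ ℕ))))).ncard) :=
  stub_levelVertsHalving n₁ n₂ c v g hg d
    (fun P Q => stub_minkowskiVertexBoundOfChart (fun σ hσ A B hA hB => stub_sumsetChartCount σ hσ A B hA hB) P Q)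
    (fun s S => stub_unionVertexBound s S) (fun n₁ n₂ v g d => stub_levelSetSplit n₁ n₂ v g d)

/-- THEOREM W♯, item form (Q1–Q5): `V(N, c) ≤ (8cN+4)^{⌈log₂ N⌉}` for every exponent list. -/
theorem levelVertsQuasi (N c v : ℕ) (g : Fin N → ℕ) (hg : ∀ j, 1 ≤ g j ∧ g j ≤ c) (d : Fin N → (Fin 2 →₀ ℕ)) :
    (Set.extremePoints ℝ (convexHull ℝ ((fun e : Fin 2 →₀ ℕ => fun i : Fin 2 => ((e i : ℕ) : ℝ)) ''
      (((Finset.univ.filter fun J : Finset (Fin N) => ∑ j ∈ J, g j = v).image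
        fun J => ∑ j ∈ J, d j : Finset (Fin 2 →₀ ℕ)) : Set (Fin 2 →₀ ℕ))))).ncard ≤
      (8 * c * N + 4) ^ (Nat.clog 2 N) :=
  stub_levelVertsRecursion (fun n₁ n₂ c v g hg d => levelVertsHalving n₁ n₂ c v g hg d) N c v g hg d

/-- Arithmetic for the grade form: on `n ≤ 4c²` items the item-form bound is at most `(32c³+4)^{⌈log₂(4c²)⌉}`. -/
theorem quasi_arith (n c : ℕ) (hn : n ≤ 4 * c * c) :
    (8 * c * n + 4) ^ (Nat.clog 2 n) ≤ (32 * c * c * c + 4) ^ (Nat.clog 2 (4 * c * c)) := by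
  have h1 : 8 * c * n + 4 ≤ 32 * c * c * c + 4 := by nlinarith [Nat.zero_le c]
  calc (8 * c * n + 4) ^ (Nat.clog 2 n) ≤ (32 * c * c * c + 4) ^ (Nat.clog 2 n) :=
        Nat.pow_le_pow_left h1 _
    _ ≤ (32 * c * c * c + 4) ^ (Nat.clog 2 (4 * c * c)) :=
        Nat.pow_le_pow_right (by omega) (Nat.clog_mono_right 2 hn)

/-- THEOREM W♯, grade form (RungC6 `kernelBootstrap` + `levelVertsQuasi`): hull vertices of a ℤ-weighted level set of subset
sums on `N` items with weights in `[1,c]` are at most `(4N²+5)·(32c³+4)^{⌈log₂(4c²)⌉}` — polynomial in `N`, QUASI-polynomial in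
the grade, for every exponent list. -/
theorem weightedLevelSetQuasi (N c v : ℕ) (g : Fin N → ℕ) (hg : ∀ j, 1 ≤ g j ∧ g j ≤ c) (d : Fin N → (Fin 2 →₀ ℕ)) :
    (Set.extremePoints ℝ (convexHull ℝ ((fun e : Fin 2 →₀ ℕ => fun i : Fin 2 => ((e i : ℕ) : ℝ)) ''
      (((Finset.univ.filter fun J : Finset (Fin N) => ∑ j ∈ J, g j = v).image
        fun J => ∑ j ∈ J, d j : Finset (Fin 2 →₀ ℕ)) : Set (Fin 2 →₀ ℕ))))).ncard ≤
      (4 * (N * N) + 5) * (32 * c * c * c + 4) ^ (Nat.clog 2 (4 * c * c)) :=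
  RungC6.kernelBootstrap N c v _ g hg d
    (fun n v' g' d' hn hg' => (levelVertsQuasi n c v' g' hg' d').trans (quasi_arith n c hn))

/-- THEOREM W♯ read as T2 on GRADED designs (RungC6 W4 + `weightedLevelSetQuasi`): on a dissociated exponent list, for ANY
number `K` of products, nodes `u_l` and scalars, `vert(Σ_l cf_l Π_j (1 − u_l^{g_j} ρ_j X^{d_j})) ≤ (Σ_j g_j + 1)·(4N²+5)·
(32c³+4)^{⌈log₂(4c²)⌉}` — uniform in `K`, quasi-polynomial in the grade `c`. -/
theorem gradedDesignT2Quasi (N c K : ℕ) (g : Fin N → ℕ) (hg : ∀ j, 1 ≤ g j ∧ g j ≤ c)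
    (u cf : Fin K → ℂ) (ρ : Fin N → ℂ) (hρ : ∀ j, ρ j ≠ 0) (d : Fin N → (Fin 2 →₀ ℕ))
    (hdis : ∀ J J' : Finset (Fin N), ∑ j ∈ J, d j = ∑ j ∈ J', d j → J = J') :
    vert (∑ l, C (cf l) * ∏ j, (1 - C (u l ^ g j * ρ j) * monomial (d j) 1)) ≤
      (∑ j, g j + 1) * ((4 * (N * N) + 5) * (32 * c * c * c + 4) ^ (Nat.clog 2 (4 * c * c))) :=
  RungC6.stub_gradedDesignT2OfHull N K _ g u cf ρ hρ d hdis (fun v => weightedLevelSetQuasi N c v g hg d)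

end RungC7

/-! ### Rung stubs of lead c7, wave B (the SIGN-DESIGN KILL SWITCH over `𝔽₂^r`; registered helper stubs, NOT used by the
composition)

`K = 2^r` products with `±1` twists — the characters `l ↦ (−1)^{⟨l,x⟩}` of `𝔽₂^r` — isolate the level set
`{J : Σ_{j∈J} g_j = v}` of ARBITRARY labels `g_j ∈ 𝔽₂^r` (here `Fin r → ZMod 2`), exactly as the `Σ g + 1` Vandermonde nodes of
RungC6 `stub_levelSetOfT2` isolate a `ℤ`-weighted level and the `q` roots of unity of `stub_cyclicT2Instance` a residue class.
So `T2(b)` bounds the hull vertices of `X_v = {Σ_J d_j : Σ_J g_j = v}` by `(2^r·N + 2)^b` for every `r, N, g, v, d`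
(`stub_signLevelSetOfT2`, dissociated; `stub_signLevelSetOfT2All`, coincidences allowed, by RungC6's free dissociation).  The
faces of these clouds cut out by a POSITIVE size functional are T2 instances with the same bound (`stub_penalisedFace`: add
`C·size·(1,1)` to every item; strict minimisers of the minimum-size face for directions in the open positive quadrant stay strict
minimisers of the whole penalised cloud), and for labels of Hamming weight `wt j` and target `v = 1` the minimum-size members
(`Σ_J wt = r`) are exactly the EXACT COVERS (`stub_oddCoverWeight`: an odd cover meets every coordinate an odd number `≥ 1` of
times).  Composition `exactCoverShadow_of_T2` (PROVED modulo P1–P4): `T2(b) ⇒` for every labelled family the exact covers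
`{J : every coordinate covered exactly once}` have at most `(2^r N + 2)^b` strictly positively exposed points `Σ_J ε_j` — items
= all nonempty subsets of `[r]`: SET PARTITIONS (parametric set partitioning / soft-decision decoding of the Hamming coset);
items = pairs: PERFECT MATCHINGS (biobjective matching; `σ(DS_n) ≤ 2^{O(n)}` is HY21 Prop. 23, consistent); items = transversal
triples of `[n] × 3`: AXIAL 3-ASSIGNMENTS.  A family of exact-cover clouds with `2^{ω(r)}·N^{ω(1)}` exposed points is a formal
`¬ stub_binomialNewtonTauCommon` (and refutes KPTT Conj. 1 in print at `t = 2`; not the weak crux).  Each stub lands as its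
own `--supports` file `Theorems/NewtonUnitEquationsNewtonTauWeak<Stub>.lean` (namespace `…Theorems.NewtonUnitEquationsNewtonTauWeak`). -/
namespace RungC7b

/-- STUB P1 (M, PROVABLE NOW) — **sign-design kill switch on a dissociated frame.**  If T2 holds with exponent `b` (`hT2`),
then for labels `g : Fin N → (Fin r → ZMod 2)`, target `v` and a DISSOCIATED exponent list `d`, the sign level set
`X_v = {Σ_J d_j : Σ_{j∈J} g_j = v}` has `≤ (2^r·N + 2)^b` hull vertices.  Proof: index the `K = 2^r` products by
`l : Fin r → ZMod 2` through `e : Fin (2^r) ≃ (Fin r → ZMod 2)` (`Fintype.equivFinOfCardEq`, `Fintype.card_fun`, `ZMod.card`);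
bi-character `χ l x := (-1 : ℂ) ^ (∑ i, l i * x i).val`, multiplicative in `x` (`(a+b).val ≡ a.val + b.val (mod 2)`,
`ZMod.val_add`, `(-1)^n` depends on `n % 2`) with orthogonality `Σ_l χ l x = if x = 0 then 2^r else 0`
(`Finset.prod_univ_sum` turns `Σ_l Π_i (−1)^{(l i * x i).val}` into `Π_i Σ_{a : ZMod 2} (−1)^{(a * x i).val} = Π_i (1 + (−1)^{(x i).val})`;
a coordinate with `x i = 1` kills the product; `Fin.sum_univ_two`/`ZMod` case split).  Design `c l := χ l v / 2^r`,
`ρ l j := χ l (g j)`; expanding (`ResidueDesignT2Aux.prod_one_sub_eq_sum`, pattern `GradedDesignT2Aux.coeff_graded` /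
`coeff_graded_subsetSum` with dissociation) gives `coeff_{Σ_J d} f = (−1)^{|J|} · 2^{−r} Σ_l χ l (v + Σ_J g) = (−1)^{|J|}·[Σ_J g = v]`
(`v + Σ_J g = 0 ↔ Σ_J g = v` in characteristic 2: `ZMod.neg_eq_self_mod_two` / `CharTwo`), so `supp f = X_v` exactly
(pattern `CyclicT2InstanceAux.support_cyclic_design`) and `vert f = #ext conv(emb '' X_v) ≤ (2^r N + 2)^b`. [folklore] -/
theorem stub_signLevelSetOfT2 (b : ℕ)
    (hT2 : ∀ (K N : ℕ) (c : Fin K → ℂ) (ρ : Fin K → Fin N → ℂ) (d : Fin N → (Fin 2 →₀ ℕ)),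
      vert (∑ l, C (c l) * ∏ j, (1 - C (ρ l j) * monomial (d j) 1)) ≤ (K * N + 2) ^ b)
    (N r : ℕ) (g : Fin N → Fin r → ZMod 2) (v : Fin r → ZMod 2) (d : Fin N → (Fin 2 →₀ ℕ))
    (hdis : ∀ J J' : Finset (Fin N), ∑ j ∈ J, d j = ∑ j ∈ J', d j → J = J') :
    (Set.extremePoints ℝ (convexHull ℝ ((fun e : Fin 2 →₀ ℕ => fun i : Fin 2 => ((e i : ℕ) : ℝ)) ''
      (((Finset.univ.filter fun J : Finset (Fin N) => ∑ j ∈ J, g j = v).image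
        fun J => ∑ j ∈ J, d j : Finset (Fin 2 →₀ ℕ)) : Set (Fin 2 →₀ ℕ))))).ncard ≤
      (2 ^ r * N + 2) ^ b :=
  -- LANDED (lead c7 wave 1, p139188: Theorems/NewtonUnitEquationsNewtonTauWeakSignLevelSetOfT2.lean)
  Summit.ValiantsHypothesis.ValiantsHypothesis.Theorems.NewtonUnitEquationsNewtonTauWeak.stub_signLevelSetOfT2  b hT2 N r g v d hdis

/-- STUB P2 (S, PROVABLE NOW) — **sign-design kill switch, coincidences allowed** (from P1 = `hP1`): dissociation is free —
`RefineDissociateAux.exists_scale_ncard_le` (Theorems/…RefineDissociate.lean, generic in the index family) applied to the family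
`F = {J : Σ_J g = v}` with the binary tags `t J = Σ_{j∈J} 2^j < 2^N` (`sum_two_pow_lt`, `sum_two_pow_injective`) gives `M₁` with
`#ext(d) ≤ #ext(J ↦ M • Σ_J d + single 0 (t J))`, `M = M₁ + 2^N`; the refined list `d' j := M • d j + single 0 (2^j)` has these subset
sums (`Finset.sum_add_distrib`, `Finset.smul_sum`, `Finsupp.single_finsetSum`) and is dissociated (`smul_add_single_injOn`); finish
with `hP1 … d'`.  Verbatim the proof of RungC6 `stub_refineDissociate` with the filter predicate `Σ_J g j = v` over `𝔽₂^r`. [folklore] -/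
theorem stub_signLevelSetOfT2All (b : ℕ)
    (hP1 : ∀ (N r : ℕ) (g : Fin N → Fin r → ZMod 2) (v : Fin r → ZMod 2) (d : Fin N → (Fin 2 →₀ ℕ)),
      (∀ J J' : Finset (Fin N), ∑ j ∈ J, d j = ∑ j ∈ J', d j → J = J') →
      (Set.extremePoints ℝ (convexHull ℝ ((fun e : Fin 2 →₀ ℕ => fun i : Fin 2 => ((e i : ℕ) : ℝ)) ''
        (((Finset.univ.filter fun J : Finset (Fin N) => ∑ j ∈ J, g j = v).image
          fun J => ∑ j ∈ J, d j : Finset (Fin 2 →₀ ℕ)) : Set (Fin 2 →₀ ℕ))))).ncard ≤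
        (2 ^ r * N + 2) ^ b)
    (N r : ℕ) (g : Fin N → Fin r → ZMod 2) (v : Fin r → ZMod 2) (d : Fin N → (Fin 2 →₀ ℕ)) :
    (Set.extremePoints ℝ (convexHull ℝ ((fun e : Fin 2 →₀ ℕ => fun i : Fin 2 => ((e i : ℕ) : ℝ)) ''
      (((Finset.univ.filter fun J : Finset (Fin N) => ∑ j ∈ J, g j = v).image
        fun J => ∑ j ∈ J, d j : Finset (Fin 2 →₀ ℕ)) : Set (Fin 2 →₀ ℕ))))).ncard ≤
      (2 ^ r * N + 2) ^ b :=
  -- LANDED (lead c7 wave 2, p139339: Theorems/NewtonUnitEquationsNewtonTauWeakSignLevelSetOfT2All.lean)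
  Summit.ValiantsHypothesis.ValiantsHypothesis.Theorems.NewtonUnitEquationsNewtonTauWeak.stub_signLevelSetOfT2All b hP1 N r g v d

/-- STUB P3 (S/M, PROVABLE NOW) — **strict positive minimisers of the minimum-size face survive a dominant size penalty.**
Finite family `F`, points `p T ∈ ℕ²`, sizes `s T ≥ s₀` on `F`, and `Cst > p T 0 + p T 1` on `F`.  Every point `q = p T`
(`T ∈ F`, `s T = s₀`) that is the STRICT minimiser of `w₀ x₀ + w₁ x₁` over the points of the size-`s₀` members, for some `w` with
`w₀, w₁ > 0`, yields the extreme point `q + (Cst s₀)•(1,1)` of the hull of the penalised cloud `{p T + (Cst·s T)•(1,1) : T ∈ F}`: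
for size-`s₀` competitors the penalty is common; for `s T' ≥ s₀ + 1` one has `w·(p T' + Cst s T' (1,1)) ≥ Cst (s₀+1)(w₀+w₁) >
w·q + Cst s₀ (w₀+w₁)` because `w·q ≤ (w₀+w₁)·max(q₀,q₁) < (w₀+w₁) Cst`.  A strict minimiser of a linear functional over a finite
set is an extreme point of the hull of its `emb`-image (`RefineDissociateAux.emb_mem_extremePoints_of_strict`, or
`DissociatedFixedK.Negative.mem_extremePoints_convexHull_of_strict_sep`), and `q ↦ q + (Cst s₀)•(1,1)` is injective, so
`Set.ncard_le_ncard_of_injOn` concludes (the target set is finite: extreme points lie in the finite image). [folklore] -/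
theorem stub_penalisedFace {ι : Type} (F : Finset ι) (p : ι → Fin 2 →₀ ℕ) (s : ι → ℕ) (s₀ Cst : ℕ)
    (hs : ∀ T ∈ F, s₀ ≤ s T) (hC : ∀ T ∈ F, p T 0 + p T 1 < Cst) :
    {q : Fin 2 →₀ ℕ | ∃ T ∈ F, s T = s₀ ∧ p T = q ∧ ∃ w : Fin 2 → ℝ, 0 < w 0 ∧ 0 < w 1 ∧
        ∀ T' ∈ F, s T' = s₀ → p T' ≠ q →
          w 0 * ((q 0 : ℕ) : ℝ) + w 1 * ((q 1 : ℕ) : ℝ) <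
            w 0 * ((p T' 0 : ℕ) : ℝ) + w 1 * ((p T' 1 : ℕ) : ℝ)}.ncard ≤
      (Set.extremePoints ℝ (convexHull ℝ ((fun e : Fin 2 →₀ ℕ => fun i : Fin 2 => ((e i : ℕ) : ℝ)) ''
        ((F.image fun T => p T + (Cst * s T) • (Finsupp.single 0 1 + Finsupp.single 1 1) :
          Finset (Fin 2 →₀ ℕ)) : Set (Fin 2 →₀ ℕ))))).ncard :=
  -- LANDED (lead c7 wave 2, p139459: Theorems/NewtonUnitEquationsNewtonTauWeakPenalisedFace.lean)
  Summit.ValiantsHypothesis.ValiantsHypothesis.Theorems.NewtonUnitEquationsNewtonTauWeak.stub_penalisedFace F p s s₀ Cst hs hC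

/-- STUB P4 (S, PROVABLE NOW) — **odd covers weigh at least `r`; equality exactly for exact covers.**  Labels
`g j ∈ (Fin r → ZMod 2)` with supports `{i : g j i = 1}`; for `J` with `Σ_{j∈J} g j = 1` (all-ones) every coordinate `i` has
`n_i := #{j ∈ J : g j i = 1}` ODD (`Σ_{j∈J} g j i = (n_i : ZMod 2)` since `g j i ∈ {0,1}` — `Fin.sum_univ`/`Finset.sum_boole`
after `ZMod 2` case split `g j i = 0 ∨ g j i = 1` — and `(n : ZMod 2) = 1 ↔ n % 2 = 1`, `ZMod.natCast_eq_one_iff_odd`-type), hence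
`n_i ≥ 1`; double counting `Σ_{j∈J} #{i : g j i = 1} = Σ_i n_i` (`Finset.sum_comm` on the indicator / `Finset.card_eq_sum_ones`)
gives `≥ r`, and `= r` iff all `n_i = 1`; conversely all `n_i = 1` gives both the all-ones sum and the weight `r`. [folklore] -/
theorem stub_oddCoverWeight (N r : ℕ) (g : Fin N → Fin r → ZMod 2) (J : Finset (Fin N)) :
    ((∑ j ∈ J, g j = fun _ => 1) →
        r ≤ ∑ j ∈ J, (Finset.univ.filter fun i : Fin r => g j i = 1).card) ∧
      (((∑ j ∈ J, g j = fun _ => 1) ∧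
          ∑ j ∈ J, (Finset.univ.filter fun i : Fin r => g j i = 1).card = r) ↔
        ∀ i : Fin r, (J.filter fun j => g j i = 1).card = 1) :=
  -- LANDED (lead c7 wave 2, p139377: Theorems/NewtonUnitEquationsNewtonTauWeakOddCoverWeight.lean)
  Summit.ValiantsHypothesis.ValiantsHypothesis.Theorems.NewtonUnitEquationsNewtonTauWeak.stub_oddCoverWeight N r g J

/-- STUB P5 (LANDED p147988; lead c7 wave 3) — **the three-core exact-cover family has `3^x` strictly positively exposed points**
(EXACT PARABOLA LEMMA, card Lines/binomial-normal-form-c7.md §3b).  Items `Fin (3·2^x) ≃ Fin 3 × Finset (Fin x)`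
(`Fintype.equivFinOfCardEq`; `Fintype.card (Finset (Fin x)) = 2^x`); cores = `Fin.natAdd x i` (`i : Fin 3`), attached = `Fin.castAdd 3 u`
(`u : Fin x`); label `g (i,S) k = 1 ↔ k = natAdd x i ∨ ∃ u ∈ S, k = castAdd 3 u` (indicator of `{κ_i} ∪ S`).  With `B S = Σ_{u∈S} 3^u`,
`M = Σ_{u<x} 3^u`: `ε (0,S) = (0, 2(B S)²)`, `ε (1,S) = (B S, 4M² − (B S)²)`, `ε (2,S) = (2 B S, 2(B S − M)² + 8M²)` (all in `ℕ`; `B S ≤ M`).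
(i) exact covers `J` (every coordinate of `Fin (x+3)` hit exactly once) are exactly `J_f = {(i, f⁻¹ i) : i < 3}` for `f : Fin x → Fin 3`
(one item per core since item `(i,S)` covers core `i`; the `S`-parts partition the attached coordinates); (ii) `Σ_{J_f} ε = (X_f, (2M − X_f)² + 12M²)`
with `X_f = B(f⁻¹1) + 2B(f⁻¹2) = Σ_u f(u)·3^u ∈ [0, 2M]` (ring identity using `B(f⁻¹0)+B(f⁻¹1)+B(f⁻¹2) = M`); (iii) `f ↦ X_f` is injective
(base-3 digits; peel the top digit, `Σ_{u<x} d_u 3^u < 3^x` for `d_u ≤ 2`); (iv) each `q_f` is the STRICT minimiser of `w₀ x₀ + w₁ x₁` with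
`w = (4(2M − X_f) + 1, 2)` over all exact-cover points: `2(X'−X_f)² + (X'−X_f) > 0` for integers `X' ≠ X_f`; (v) so the set contains the
`3^x` distinct points `q_f` (`Finset.card_image_of_injective`, `Set.ncard_le_ncard` into the finite target).  Composition
`threeCore_vs_T2` (card): `T2(b) ⇒ 3^x ≤ (2^{x+3}·3·2^x + 2)^b` — the transfer (★) is tight up to base `3` versus `4^b`. [folklore] -/
theorem stub_threeCoreExposed (x : ℕ) :
    ∃ (g : Fin (3 * 2 ^ x) → Fin (x + 3) → ZMod 2) (ε : Fin (3 * 2 ^ x) → (Fin 2 →₀ ℕ)),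
      3 ^ x ≤ {q : Fin 2 →₀ ℕ | ∃ J : Finset (Fin (3 * 2 ^ x)),
        (∀ i : Fin (x + 3), (J.filter fun j => g j i = 1).card = 1) ∧
        ∑ j ∈ J, ε j = q ∧ ∃ w : Fin 2 → ℝ, 0 < w 0 ∧ 0 < w 1 ∧
        ∀ J' : Finset (Fin (3 * 2 ^ x)), (∀ i : Fin (x + 3), (J'.filter fun j => g j i = 1).card = 1) →
          ∑ j ∈ J', ε j ≠ q →
          w 0 * ((q 0 : ℕ) : ℝ) + w 1 * ((q 1 : ℕ) : ℝ) <
            w 0 * (((∑ j ∈ J', ε j) 0 : ℕ) : ℝ) + w 1 * (((∑ j ∈ J', ε j) 1 : ℕ) : ℝ)}.ncard :=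
  -- LANDED (p147988): Theorems/NewtonUnitEquationsNewtonTauWeakThreeCoreExposed.lean
  Summit.ValiantsHypothesis.ValiantsHypothesis.Theorems.NewtonUnitEquationsNewtonTauWeak.stub_threeCoreExposed x

/-! #### Composition (PROVED modulo P1–P4): exact-cover shadows are T2 instances -/

/-- **T2 ⇒ exact-cover shadow bound.**  If the open stub holds with exponent `b`, then for every labelled family
`g : Fin N → (Fin r → ZMod 2)` and every `ε : Fin N → ℕ²`, the points `Σ_{j∈J} ε_j` of the EXACT COVERS `J` (every coordinate
`i < r` covered by exactly one `j ∈ J`) that are strict minimisers of some `w₀ x₀ + w₁ x₁` with `w₀, w₁ > 0` number at most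
`(2^r·N + 2)^b`.  Instances: set partitions of `[r]` (items = nonempty subsets), perfect matchings (items = pairs), axial
3-assignments (items = transversal triples). -/
theorem exactCoverShadow_of_T2 (b : ℕ)
    (hT2 : ∀ (K N : ℕ) (c : Fin K → ℂ) (ρ : Fin K → Fin N → ℂ) (d : Fin N → (Fin 2 →₀ ℕ)),
      vert (∑ l, C (c l) * ∏ j, (1 - C (ρ l j) * monomial (d j) 1)) ≤ (K * N + 2) ^ b)
    (N r : ℕ) (g : Fin N → Fin r → ZMod 2) (ε : Fin N → (Fin 2 →₀ ℕ)) :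
    {q : Fin 2 →₀ ℕ | ∃ J : Finset (Fin N), (∀ i : Fin r, (J.filter fun j => g j i = 1).card = 1) ∧
        ∑ j ∈ J, ε j = q ∧ ∃ w : Fin 2 → ℝ, 0 < w 0 ∧ 0 < w 1 ∧
        ∀ J' : Finset (Fin N), (∀ i : Fin r, (J'.filter fun j => g j i = 1).card = 1) → ∑ j ∈ J', ε j ≠ q →
          w 0 * ((q 0 : ℕ) : ℝ) + w 1 * ((q 1 : ℕ) : ℝ) <
            w 0 * (((∑ j ∈ J', ε j) 0 : ℕ) : ℝ) + w 1 * (((∑ j ∈ J', ε j) 1 : ℕ) : ℝ)}.ncard ≤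
      (2 ^ r * N + 2) ^ b :=
  -- LANDED (p139696): Theorems/NewtonUnitEquationsNewtonTauWeakExactCoverShadow.lean
  Summit.ValiantsHypothesis.ValiantsHypothesis.Theorems.NewtonUnitEquationsNewtonTauWeak.exactCoverShadow_of_T2
    b hT2 N r g ε

/-- **Calibration of the transfer (PROVED; P5):** `T2(b)` forces `3^x ≤ (2^{x+3}·(3·2^x) + 2)^b` — the three-core family realises base `3`
per attached element inside an allowance of base `4^b`. -/
theorem threeCore_vs_T2 (b : ℕ)
    (hT2 : ∀ (K N : ℕ) (c : Fin K → ℂ) (ρ : Fin K → Fin N → ℂ) (d : Fin N → (Fin 2 →₀ ℕ)),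
      vert (∑ l, C (c l) * ∏ j, (1 - C (ρ l j) * monomial (d j) 1)) ≤ (K * N + 2) ^ b) (x : ℕ) :
    3 ^ x ≤ (2 ^ (x + 3) * (3 * 2 ^ x) + 2) ^ b := by
  obtain ⟨g, ε, h⟩ := stub_threeCoreExposed x
  exact h.trans (exactCoverShadow_of_T2 b hT2 (3 * 2 ^ x) (x + 3) g ε)

/-! #### Stub P6 (lead c7, session 3) — the MINKOWSKI SPLITTING THEOREM at `c = 4`: four cores give base `3`, not `4`

For the `c`-core family write the configuration `f : Fin x → Fin c` (attached element `u` joins the block of core `f u`) and the block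
costs as a DESIGN `h : Fin c → Finset (Fin x) → ℕ²`; the cloud is `{Σ_d h d (f⁻¹ d)}` and `A(c,x)` its maximal number of strictly
positively exposed points.  Splitting the cores into groups `{0,1} ⊔ {2,3}` and conditioning on `W = f⁻¹{2,3}`, the configurations with a
given `W` form the PRODUCT of the `{0,1}`-configurations on `Wᶜ` and the `{2,3}`-configurations on `W`, and their points the Minkowski sum
`A_W ⊕ B_W` (`|A_W| = 2^{x-|W|}`, `|B_W| = 2^{|W|}`).  A strictly positively exposed point of the whole cloud is exposed in its own slice, and a
planar sumset has at most `|U(A)| + |U(B)| − 1 ≤ |A| + |B| − 1` chart points (RungC7 Q1a `stub_sumsetChartCount` at `σ = −1`), so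
`A(4,x) ≤ Σ_W (2^{x−|W|} + 2^{|W|} − 1) = 2·3^x − 2^x` — against `3^x ≤ A(3,x) ≤ A(4,x)` (P5): the per-element base of the four-core family is
EXACTLY `3`.  In general `A(a+b,x) ≤ Σ_j C(x,j)(A(a,x−j) + A(b,j) − 1)`, whence `f(c) := lim A(c,x)^{1/x} ≤ 1 + ⌈log₂ c⌉` and, for fixed `x`,
`A(c,x) = O_x(c·log^{x−1} c)` (card Lines/binomial-normal-form-c7.md §9). -/

/-- STUB P6 (LANDED p146092; lead c7 session 3) — **four-core splitting bound** `A(4,x) + 2^x ≤ 2·3^x` in design language.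
Proof: for `f` let `W f := univ.filter (2 ≤ f ·)`; for `W : Finset (Fin x)` put
`A_W := Wᶜ.powerset.image (fun S => h 0 (Wᶜ \ S) + h 1 S)`, `B_W := W.powerset.image (fun S => h 2 (W \ S) + h 3 S)` and
`AB_W := (A_W ×ˢ B_W).image (·.1 + ·.2)`.  (i) `Σ_d h d (f⁻¹ d) ∈ AB_{W f}` and conversely every `a + b ∈ AB_W` is the point of the glued
configuration `u ↦ if u ∈ W then (if u ∈ S' then 3 else 2) else (if u ∈ S then 1 else 0)` (compute the four fibres); (ii) hence a point `q`
exposed by `w` (`0 < w 0, 0 < w 1`) in the whole cloud lies in the chart set `U(AB_{W f}) = {p ∈ AB | ∃ t, ∀ q ∈ AB, q ≠ p → t q₀ − q₁ < t p₀ − p₁}`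
with `t := −w 0 / w 1` (multiply by `−w 1 < 0`); (iii) `ncard ≤ Σ_W ncard U(AB_W)` (`Set.ncard` union bound over `univ.powerset`, each chart set
finite inside `AB_W`); (iv) `ncard U(AB_W) + 1 ≤ ncard U(A_W) + ncard U(B_W) ≤ |A_W| + |B_W| ≤ 2^{x−|W|} + 2^{|W|}`
(`RungC7.stub_sumsetChartCount (−1) (by norm_num) A_W B_W` — both nonempty via `S = ∅`; `Set.ncard_le_ncard` into `↑A_W`,
`Finset.card_image_le`, `Finset.card_powerset`, `Finset.card_compl`); (v) sum: `Σ_{W ⊆ univ} 2^{|W|} = 3^x = Σ_W 2^{x−|W|}`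
(`Fintype.sum_pow_mul_eq_add_pow` / `Finset.sum_pow_mul_eq_add_pow` with `(2,1)` and `(1,2)`), `Σ_W 1 = 2^x` (`Finset.card_powerset`). [folklore] -/
theorem stub_fourCoreSplitting (x : ℕ) (h : Fin 4 → Finset (Fin x) → (Fin 2 →₀ ℕ)) :
    {q : Fin 2 →₀ ℕ | ∃ f : Fin x → Fin 4, ∑ d, h d (Finset.univ.filter fun u => f u = d) = q ∧
        ∃ w : Fin 2 → ℝ, 0 < w 0 ∧ 0 < w 1 ∧ ∀ f' : Fin x → Fin 4,
          ∑ d, h d (Finset.univ.filter fun u => f' u = d) ≠ q →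
          w 0 * ((q 0 : ℕ) : ℝ) + w 1 * ((q 1 : ℕ) : ℝ) <
            w 0 * (((∑ d, h d (Finset.univ.filter fun u => f' u = d)) 0 : ℕ) : ℝ) +
              w 1 * (((∑ d, h d (Finset.univ.filter fun u => f' u = d)) 1 : ℕ) : ℝ)}.ncard + 2 ^ x ≤
      2 * 3 ^ x :=
  -- LANDED (p146092): Theorems/NewtonUnitEquationsNewtonTauWeakFourCoreSplitting.lean
  Summit.ValiantsHypothesis.ValiantsHypothesis.Theorems.NewtonUnitEquationsNewtonTauWeak.stub_fourCoreSplitting x h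

/-- **Four cores give base three (PROVED; P6).**  The strictly positively exposed points of any four-core design number at most
`2·3^x` (P6 without the `2^x` correction); with P5 (`3^x` exposed points for three cores, a sub-design of four cores with the fourth
core's nonempty blocks priced out) the per-element base of the four-core family is exactly `3`. -/
theorem fourCoreExposed_le (x : ℕ) (h : Fin 4 → Finset (Fin x) → (Fin 2 →₀ ℕ)) :
    {q : Fin 2 →₀ ℕ | ∃ f : Fin x → Fin 4, ∑ d, h d (Finset.univ.filter fun u => f u = d) = q ∧
        ∃ w : Fin 2 → ℝ, 0 < w 0 ∧ 0 < w 1 ∧ ∀ f' : Fin x → Fin 4,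
          ∑ d, h d (Finset.univ.filter fun u => f' u = d) ≠ q →
          w 0 * ((q 0 : ℕ) : ℝ) + w 1 * ((q 1 : ℕ) : ℝ) <
            w 0 * (((∑ d, h d (Finset.univ.filter fun u => f' u = d)) 0 : ℕ) : ℝ) +
              w 1 * (((∑ d, h d (Finset.univ.filter fun u => f' u = d)) 1 : ℕ) : ℝ)}.ncard ≤ 2 * 3 ^ x :=
  le_trans (Nat.le_add_right _ _) (stub_fourCoreSplitting x h)

/-! #### Stubs P7–P8 (lead c7, session 3, wave 2) — the general splitting inequality and chord uniqueness

P7 is the Minkowski splitting theorem for an arbitrary split `c = a + b` of the cores, in the chart language of RungC7 Q1a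
(`σ = −1`, all real `t`: the LOWER-HULL vertices `U(S)` of a finite `S ⊆ ℕ²`, a superset of the strictly positively exposed points):
`|U(cloud)| + 2^x ≤ Σ_W (|U(A_W)| + |U(B_W)|)` where `A_W`, `B_W` are the clouds of the two sub-designs restricted to `Wᶜ`, `W`
(configurations read through total functions `φ : Fin x → Fin a`, fibres intersected with `Wᶜ`).  Iterated, it is the kernel form of
`f(c) ≤ 1 + ⌈log₂ c⌉` (card §9.1).  P8 is the rigidity fact behind (R1)/(C) of card §9.3: among strictly positively exposed points of one
planar set a nonzero difference vector occurs at most once (secant slopes through an exposed point increase strictly), whence the single-move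
datum bound `#{(f,u,d′) : f, f^{u→d′} both exposed} ≤ x·c²·3^x` (composition to follow). -/

/-- STUB P7 (LANDED p150266; lead c7 session 3) — **general core splitting** in chart language.  For `1 ≤ a`, `1 ≤ b` and a design
`h` on `a + b` cores: with `P f := Σ_d h d (f⁻¹ d)`, `PA W φ := Σ_{d<a} h (castAdd b d) (Wᶜ ∩ φ⁻¹ d)`, `PB W ψ := Σ_{d<b} h (natAdd a d) (W ∩ ψ⁻¹ d)`
and `U(S) := {p ∈ S | ∃ t, ∀ q ∈ S, q ≠ p → t q₀ − q₁ < t p₀ − p₁}`:  `|U(im P)| + 2^x ≤ Σ_W (|U(im PA W)| + |U(im PB W)|)`.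
Proof (pattern of P6 `stub_fourCoreSplitting`, whose Aux lemmas generalise verbatim): (i) for `f` put `W f := univ.filter (a ≤ (f ·).val)`;
`P f = PA (W f) φ_f + PB (W f) ψ_f` with `φ_f u := ⟨f u, _⟩` where `f u < a` (else anything), `ψ_f u := ⟨f u − a, _⟩` (use `Fin.addCases` on `f u`;
`Finset.sum_univ_add`/`Fin.sum_univ_add` splits `Σ_{d : Fin (a+b)}` into the `castAdd` and `natAdd` parts, and the fibres of `f` over `castAdd b d`
equal `(W f)ᶜ ∩ φ_f⁻¹ d`); (ii) gluing: for `φ, ψ` the configuration `g u := if u ∈ W then natAdd a (ψ u) else castAdd b (φ u)` has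
`P g = PA W φ + PB W ψ`, so `im(PA W) ⊕ im(PB W) ⊆ im P` pointwise and `P f ∈ im(PA (W f)) ⊕ im(PB (W f))`; (iii) a chart point `p = P f` of `im P`
(strict maximiser of `t x₀ − x₁` over `im P`) is a chart point of the sumset `im(PA (W f)) ⊕ im(PB (W f))` for the same `t` (the sumset is a
subset of `im P` containing `p`); (iv) `ncard ≤ Σ_W ncard(U(sumset W))` (finite union bound over `W : Finset (Fin x)`), and per `W`
`ncard U(sumset) + 1 ≤ ncard U(im PA W) + ncard U(im PB W)` is `RungC7.stub_sumsetChartCount (−1) (by norm_num)` (both images nonempty: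
`1 ≤ a`, `1 ≤ b` give constant functions); (v) `Σ_W 1 = 2^x`. [folklore] -/
theorem stub_coreSplitting (a b x : ℕ) (ha : 1 ≤ a) (hb : 1 ≤ b) (h : Fin (a + b) → Finset (Fin x) → (Fin 2 →₀ ℕ)) :
    {p : Fin 2 →₀ ℕ | p ∈ (Finset.univ.image fun f : Fin x → Fin (a + b) =>
          ∑ d, h d (Finset.univ.filter fun u => f u = d)) ∧
        ∃ t : ℝ, ∀ q ∈ (Finset.univ.image fun f : Fin x → Fin (a + b) =>
          ∑ d, h d (Finset.univ.filter fun u => f u = d)), q ≠ p →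
          t * ((q 0 : ℕ) : ℝ) + (-1) * ((q 1 : ℕ) : ℝ) < t * ((p 0 : ℕ) : ℝ) + (-1) * ((p 1 : ℕ) : ℝ)}.ncard + 2 ^ x ≤
      ∑ W : Finset (Fin x),
        ({p : Fin 2 →₀ ℕ | p ∈ (Finset.univ.image fun φ : Fin x → Fin a =>
              ∑ d, h (Fin.castAdd b d) (Wᶜ ∩ Finset.univ.filter fun u => φ u = d)) ∧
            ∃ t : ℝ, ∀ q ∈ (Finset.univ.image fun φ : Fin x → Fin a =>
              ∑ d, h (Fin.castAdd b d) (Wᶜ ∩ Finset.univ.filter fun u => φ u = d)), q ≠ p →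
              t * ((q 0 : ℕ) : ℝ) + (-1) * ((q 1 : ℕ) : ℝ) < t * ((p 0 : ℕ) : ℝ) + (-1) * ((p 1 : ℕ) : ℝ)}.ncard +
         {p : Fin 2 →₀ ℕ | p ∈ (Finset.univ.image fun ψ : Fin x → Fin b =>
              ∑ d, h (Fin.natAdd a d) (W ∩ Finset.univ.filter fun u => ψ u = d)) ∧
            ∃ t : ℝ, ∀ q ∈ (Finset.univ.image fun ψ : Fin x → Fin b =>
              ∑ d, h (Fin.natAdd a d) (W ∩ Finset.univ.filter fun u => ψ u = d)), q ≠ p →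
              t * ((q 0 : ℕ) : ℝ) + (-1) * ((q 1 : ℕ) : ℝ) < t * ((p 0 : ℕ) : ℝ) + (-1) * ((p 1 : ℕ) : ℝ)}.ncard) :=
  -- LANDED (p150266): Theorems/NewtonUnitEquationsNewtonTauWeakCoreSplitting.lean
  Summit.ValiantsHypothesis.ValiantsHypothesis.Theorems.NewtonUnitEquationsNewtonTauWeak.stub_coreSplitting a b x ha hb h

/-- STUB P8 (LANDED p149658; lead c7 session 3) — **chord uniqueness for strictly positively exposed points.**  If `p, p', q, q'` are
points of a planar set `S ⊆ ℕ²`, each a STRICT minimiser over `S` of some functional `w₀ x₀ + w₁ x₁` with `w₀, w₁ > 0`, and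
`p − p' = q − q' ≠ 0`, then `p = q`.  Proof: (1) exposed points have pairwise distinct first coordinates, and for an exposed `m` and
points `l, r ∈ S` with `l₀ < m₀ < r₀` the secant slopes satisfy `slope(l,m) < −w₀/w₁ < slope(m,r)` (from `w·m < w·l`, `w·m < w·r`);
(2) w.l.o.g. (symmetries `(p,p',q,q') ↦ (p',p,q',q)` and `↦ (q,q',p,p')`) `p₀ > p'₀` and `p'₀ < q'₀`; then either `p'₀ < p₀ ≤ q'₀ < q₀`
(chain `slope(p',p) < slope(p,q') < slope(q',q)`, or `slope(p',p) < slope(p,q) = slope(q',q)` when `p = q'`) or `p'₀ < q'₀ < p₀ < q₀`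
(`slope(p',p)` is a proper convex combination of `slope(p',q') < slope(q',p)`, and `slope(q',q)` of `slope(q',p) < slope(p,q)`, so
`slope(p',p) < slope(q',p) < slope(q',q)`); in all cases `slope(p',p) ≠ slope(q',q)`, contradicting `p − p' = q − q'`.  Work with
cross-multiplied integer/real inequalities rather than slopes. [folklore] -/
theorem stub_exposedChordUnique (S : Set (Fin 2 →₀ ℕ)) (p p' q q' : Fin 2 →₀ ℕ)
    (hp : p ∈ S) (hp' : p' ∈ S) (hq : q ∈ S) (hq' : q' ∈ S)
    (hexp : ∀ m : Fin 2 →₀ ℕ, (m = p ∨ m = p' ∨ m = q ∨ m = q') →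
      ∃ w : Fin 2 → ℝ, 0 < w 0 ∧ 0 < w 1 ∧ ∀ r ∈ S, r ≠ m →
        w 0 * ((m 0 : ℕ) : ℝ) + w 1 * ((m 1 : ℕ) : ℝ) < w 0 * ((r 0 : ℕ) : ℝ) + w 1 * ((r 1 : ℕ) : ℝ))
    (hne : p ≠ p')
    (h0 : ((p 0 : ℕ) : ℤ) - ((p' 0 : ℕ) : ℤ) = ((q 0 : ℕ) : ℤ) - ((q' 0 : ℕ) : ℤ))
    (h1 : ((p 1 : ℕ) : ℤ) - ((p' 1 : ℕ) : ℤ) = ((q 1 : ℕ) : ℤ) - ((q' 1 : ℕ) : ℤ)) :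
    p = q :=
  -- LANDED (p149658): Theorems/NewtonUnitEquationsNewtonTauWeakExposedChordUnique.lean
  Summit.ValiantsHypothesis.ValiantsHypothesis.Theorems.NewtonUnitEquationsNewtonTauWeak.stub_exposedChordUnique
    S p p' q q' hp hp' hq hq' hexp hne h0 h1

/-! #### Stubs P9–P10 (lead c7, session 3, wave 3) — the single-move datum bound and the relative four-core chart bound

P9 is the rigorous core of the hierarchical cap (card §9.3): pairs of strictly positively exposed points of a `c`-core cloud that
differ by moving ONE attached element number at most `x·c²·3^x` (datum `(u, d, d′, trace of the other elements in {S_d, S_{d′}, elsewhere})`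
↦ difference vector ↦ by P8 at most one pair).  P10 is P6 in chart language and relative to a sub-universe `V` (configurations read through
`V ∩ fibre`), the shape in which P7's right-hand side presents the sub-designs; with P7 at `4 + 4` it gives `eightCoreChart_le`:
eight cores have base `≤ 4` (`N₈ + 2^x + 2·3^x ≤ 4·4^x`), the `k = 3` case of `f(2^k) ≤ k + 1`. -/

/-- STUB P9 (LANDED p151681; lead c7 session 3) — **single-move datum bound.**  For a `c`-core design, the ordered pairs `(p, p')` of
DISTINCT strictly positively exposed points such that `p = P f` and `p' = P (update f u d')` for some configuration `f`, element `u` and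
core `d'` number at most `x·c²·3^x`.  Proof: such a pair has `d' ≠ f u`; its difference `p' − p` (in `ℤ²`) equals
`[h d' (T₂ ∪ {u}) − h d' T₂] − [h d (T₁ ∪ {u}) − h d T₁]` with `d = f u`, `T₁ = f⁻¹ d ∖ {u}`, `T₂ = f⁻¹ d'` — a function of the DATUM
`(u, d, d', τ)` where `τ : Fin x → Fin 3` records `T₁`, `T₂`, rest (value at `u` fixed to `0`); by P8 `stub_exposedChordUnique` (all four points
exposed, `p ≠ p'`) two pairs with the same datum coincide, so the pair set injects into `Fin x × Fin c × Fin c × (Fin x → Fin 3)`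
(`Set.ncard_le_ncard_of_injOn` / `Finite.card_le_of_injective`; the pair set is finite inside `E × E`, `E ⊆ im P`). [folklore] -/
theorem stub_singleMovePairBound (c x : ℕ) (h : Fin c → Finset (Fin x) → (Fin 2 →₀ ℕ)) :
    {pq : (Fin 2 →₀ ℕ) × (Fin 2 →₀ ℕ) |
        (∃ f : Fin x → Fin c, ∑ d, h d (Finset.univ.filter fun u => f u = d) = pq.1 ∧
          ∃ w : Fin 2 → ℝ, 0 < w 0 ∧ 0 < w 1 ∧ ∀ f' : Fin x → Fin c,
            ∑ d, h d (Finset.univ.filter fun u => f' u = d) ≠ pq.1 →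
            w 0 * ((pq.1 0 : ℕ) : ℝ) + w 1 * ((pq.1 1 : ℕ) : ℝ) <
              w 0 * (((∑ d, h d (Finset.univ.filter fun u => f' u = d)) 0 : ℕ) : ℝ) +
                w 1 * (((∑ d, h d (Finset.univ.filter fun u => f' u = d)) 1 : ℕ) : ℝ)) ∧
        (∃ f : Fin x → Fin c, ∑ d, h d (Finset.univ.filter fun u => f u = d) = pq.2 ∧
          ∃ w : Fin 2 → ℝ, 0 < w 0 ∧ 0 < w 1 ∧ ∀ f' : Fin x → Fin c,
            ∑ d, h d (Finset.univ.filter fun u => f' u = d) ≠ pq.2 →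
            w 0 * ((pq.2 0 : ℕ) : ℝ) + w 1 * ((pq.2 1 : ℕ) : ℝ) <
              w 0 * (((∑ d, h d (Finset.univ.filter fun u => f' u = d)) 0 : ℕ) : ℝ) +
                w 1 * (((∑ d, h d (Finset.univ.filter fun u => f' u = d)) 1 : ℕ) : ℝ)) ∧
        pq.1 ≠ pq.2 ∧
        ∃ (f : Fin x → Fin c) (u : Fin x) (d' : Fin c),
          ∑ d, h d (Finset.univ.filter fun v => f v = d) = pq.1 ∧
          ∑ d, h d (Finset.univ.filter fun v => Function.update f u d' v = d) = pq.2}.ncard ≤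
      x * (c * c) * 3 ^ x :=
  -- LANDED (p151681): Theorems/NewtonUnitEquationsNewtonTauWeakSingleMovePairBound.lean
  Summit.ValiantsHypothesis.ValiantsHypothesis.Theorems.NewtonUnitEquationsNewtonTauWeak.stub_singleMovePairBound c x h

/-- STUB P10 (LANDED p151432; lead c7 session 3) — **relative four-core bound in chart language.**  For `V ⊆ Fin x` and a four-core
design read through `V` (`P_V f := Σ_d h d (V ∩ f⁻¹ d)`), the lower-hull vertices (`σ = −1` chart points, any real `t`) of `im P_V` number at most
`2·3^{|V|} − 2^{|V|}`.  Proof = P6 `stub_fourCoreSplitting` with `W` ranging over `V.powerset`, `A_W := (V \ W).powerset.image (fun S => h 0 ((V \ W) \ S) + h 1 S)`,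
`B_W := W.powerset.image (fun S => h 2 (W \ S) + h 3 S)`, slice of `f` = `V ∩ univ.filter (2 ≤ f ·)`, gluing `g u := if u ∈ W then (if u ∈ S' then 3 else 2) else
(if u ∈ S then 1 else 0)` (its `V`-relative fibres are `(V \ W) \ S, S, W \ S', S'` for `S ⊆ V \ W`, `S' ⊆ W`), chart points now directly in the `t`-language
(no positivity conversion needed), `RungC7.stub_sumsetChartCount (−1)`, and `Σ_{W ⊆ V} (2^{|V|−|W|} + 2^{|W|}) = 2·3^{|V|}` (`Finset.sum_pow_mul_eq_add_pow 2 1 V`,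
`… 1 2 V`). [folklore] -/
theorem stub_fourCoreChartRel (x : ℕ) (V : Finset (Fin x)) (h : Fin 4 → Finset (Fin x) → (Fin 2 →₀ ℕ)) :
    {p : Fin 2 →₀ ℕ | p ∈ (Finset.univ.image fun f : Fin x → Fin 4 =>
          ∑ d, h d (V ∩ Finset.univ.filter fun u => f u = d)) ∧
        ∃ t : ℝ, ∀ q ∈ (Finset.univ.image fun f : Fin x → Fin 4 =>
          ∑ d, h d (V ∩ Finset.univ.filter fun u => f u = d)), q ≠ p →
          t * ((q 0 : ℕ) : ℝ) + (-1) * ((q 1 : ℕ) : ℝ) < t * ((p 0 : ℕ) : ℝ) + (-1) * ((p 1 : ℕ) : ℝ)}.ncard +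
        2 ^ V.card ≤ 2 * 3 ^ V.card :=
  -- LANDED (p151432): Theorems/NewtonUnitEquationsNewtonTauWeakFourCoreChartRel.lean
  Summit.ValiantsHypothesis.ValiantsHypothesis.Theorems.NewtonUnitEquationsNewtonTauWeak.stub_fourCoreChartRel x V h

/-- Arithmetic of the `4 + 4` composition: pointwise slice bounds sum to `Σ_W (A W + B W) + 2·3^x ≤ 4·4^x`. -/
theorem sum_slice_bound (x : ℕ) (A B : Finset (Fin x) → ℕ)
    (hA : ∀ W, A W + 2 ^ (x - W.card) ≤ 2 * 3 ^ (x - W.card))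
    (hB : ∀ W, B W + 2 ^ W.card ≤ 2 * 3 ^ W.card) :
    ∑ W : Finset (Fin x), (A W + B W) + 2 * 3 ^ x ≤ 4 * 4 ^ x := by
  have e1 : ∑ W : Finset (Fin x), (2 : ℕ) ^ (x - W.card) = 3 ^ x := by
    simpa [add_comm] using Fin.sum_pow_mul_eq_add_pow (1 : ℕ) 2 (n := x)
  have e2 : ∑ W : Finset (Fin x), (2 : ℕ) ^ W.card = 3 ^ x := by
    simpa using Fin.sum_pow_mul_eq_add_pow (2 : ℕ) 1 (n := x)
  have e3 : ∑ W : Finset (Fin x), (3 : ℕ) ^ (x - W.card) = 4 ^ x := by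
    simpa [add_comm] using Fin.sum_pow_mul_eq_add_pow (1 : ℕ) 3 (n := x)
  have e4 : ∑ W : Finset (Fin x), (3 : ℕ) ^ W.card = 4 ^ x := by
    simpa using Fin.sum_pow_mul_eq_add_pow (3 : ℕ) 1 (n := x)
  have key : ∀ W ∈ (Finset.univ : Finset (Finset (Fin x))),
      (A W + B W) + ((2 : ℕ) ^ (x - W.card) + 2 ^ W.card) ≤ 2 * 3 ^ (x - W.card) + 2 * 3 ^ W.card := by
    intro W _
    have h₁ := hA W
    have h₂ := hB W
    omega
  have hs := Finset.sum_le_sum key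
  have er : ∑ W : Finset (Fin x), (2 * (3 : ℕ) ^ (x - W.card) + 2 * 3 ^ W.card) = 2 * 4 ^ x + 2 * 4 ^ x := by
    rw [Finset.sum_add_distrib, ← Finset.mul_sum, ← Finset.mul_sum, e3, e4]
  have ec : ∑ W : Finset (Fin x), ((2 : ℕ) ^ (x - W.card) + 2 ^ W.card) = 3 ^ x + 3 ^ x := by
    rw [Finset.sum_add_distrib, e1, e2]
  rw [Finset.sum_add_distrib, ec, er] at hs
  omega

/-- **Eight cores have base at most four (PROVED; P7 + P10).**  For a design on `4 + 4` cores the lower-hull vertices of the cloud satisfy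
`N₈ + 2^x + 2·3^x ≤ 4·4^x`: P7 `stub_coreSplitting` at `a = b = 4`, then P10 on both sub-designs of every slice, then `sum_slice_bound`.
This is `f(8) ≤ 4`, the `k = 3` instance of `f(2^k) ≤ k + 1` (card §9.1). -/
theorem eightCoreChart_le (x : ℕ) (h : Fin (4 + 4) → Finset (Fin x) → (Fin 2 →₀ ℕ)) :
    {p : Fin 2 →₀ ℕ | p ∈ (Finset.univ.image fun f : Fin x → Fin (4 + 4) =>
          ∑ d, h d (Finset.univ.filter fun u => f u = d)) ∧
        ∃ t : ℝ, ∀ q ∈ (Finset.univ.image fun f : Fin x → Fin (4 + 4) =>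
          ∑ d, h d (Finset.univ.filter fun u => f u = d)), q ≠ p →
          t * ((q 0 : ℕ) : ℝ) + (-1) * ((q 1 : ℕ) : ℝ) < t * ((p 0 : ℕ) : ℝ) + (-1) * ((p 1 : ℕ) : ℝ)}.ncard +
        2 ^ x + 2 * 3 ^ x ≤ 4 * 4 ^ x := by
  classical
  have h7 := stub_coreSplitting 4 4 x (by norm_num) (by norm_num) h
  have hA : ∀ W : Finset (Fin x),
      {p : Fin 2 →₀ ℕ | p ∈ (Finset.univ.image fun φ : Fin x → Fin 4 =>
          ∑ d, h (Fin.castAdd 4 d) (Wᶜ ∩ Finset.univ.filter fun u => φ u = d)) ∧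
        ∃ t : ℝ, ∀ q ∈ (Finset.univ.image fun φ : Fin x → Fin 4 =>
          ∑ d, h (Fin.castAdd 4 d) (Wᶜ ∩ Finset.univ.filter fun u => φ u = d)), q ≠ p →
          t * ((q 0 : ℕ) : ℝ) + (-1) * ((q 1 : ℕ) : ℝ) < t * ((p 0 : ℕ) : ℝ) + (-1) * ((p 1 : ℕ) : ℝ)}.ncard +
        2 ^ (x - W.card) ≤ 2 * 3 ^ (x - W.card) := by
    intro W
    simpa only [Finset.card_compl, Fintype.card_fin] using
      (stub_fourCoreChartRel x Wᶜ (fun d => h (Fin.castAdd 4 d)))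
  have hB : ∀ W : Finset (Fin x),
      {p : Fin 2 →₀ ℕ | p ∈ (Finset.univ.image fun ψ : Fin x → Fin 4 =>
          ∑ d, h (Fin.natAdd 4 d) (W ∩ Finset.univ.filter fun u => ψ u = d)) ∧
        ∃ t : ℝ, ∀ q ∈ (Finset.univ.image fun ψ : Fin x → Fin 4 =>
          ∑ d, h (Fin.natAdd 4 d) (W ∩ Finset.univ.filter fun u => ψ u = d)), q ≠ p →
          t * ((q 0 : ℕ) : ℝ) + (-1) * ((q 1 : ℕ) : ℝ) < t * ((p 0 : ℕ) : ℝ) + (-1) * ((p 1 : ℕ) : ℝ)}.ncard +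
        2 ^ W.card ≤ 2 * 3 ^ W.card := fun W =>
    stub_fourCoreChartRel x W (fun d => h (Fin.natAdd 4 d))
  have hs := sum_slice_bound x _ _ hA hB
  exact le_trans (Nat.add_le_add_right h7 _) hs

/-! #### Stubs P11–P13 (lead c7, session 3, wave 4) — relative splitting, two-core base, core relabelling; then the log bound

With P11 (P7 read through a sub-universe `V`, slices `W ⊆ V`), P12 (a two-core design read through `V` has at most `2^{|V|}` lower-hull vertices)
and P13 (the cloud is invariant under relabelling the cores along an equivalence) the splitting recursion closes by induction on `k`:
`coreChart_logBound : N(2^k cores, rel V) ≤ 2^{k−1}·(k+1)^{|V|}` — the kernel form of `f(c) ≤ 1 + ⌈log₂ c⌉` (card §9.1(b)). -/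

/-- STUB P11 (LANDED p153208; lead c7 session 3) — **relative core splitting** (P7 `stub_coreSplitting` read through `V`): for `1 ≤ a`, `1 ≤ b`,
`V ⊆ Fin x` and a design on `a + b` cores, with all clouds read through `V ∩ fibre` and slices `W ∈ V.powerset` (A-part through `(V \ W) ∩ fibre`,
B-part through `W ∩ fibre`):  `|U(im P_V)| + 2^{|V|} ≤ Σ_{W ⊆ V} (|U(im PA_{V∖W})| + |U(im PB_W)|)`.  Proof: P7's proof verbatim with `W f := V ∩ univ.filter (a ≤ f ·)`,
gluing `g u := if u ∈ W then natAdd a (ψ u) else castAdd b (φ u)` whose `V`-relative fibres are `(V \ W) ∩ φ⁻¹ d` and `W ∩ ψ⁻¹ d` (for `W ⊆ V`), chart transfer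
with the same `t`, `RungC7.stub_sumsetChartCount (−1)`, union bound over `V.powerset`, `Σ_{W ⊆ V} 1 = 2^{|V|}` (`Finset.card_powerset`).  The `CoreSplittingAux`
helpers of P7 (`filter_glue_*`, `sum_glue`, `exists_glue`, `core_bound`) are the model; P10 `stub_fourCoreChartRel` is the `a = b = 2` instance. [folklore] -/
theorem stub_coreSplittingRel (a b x : ℕ) (ha : 1 ≤ a) (hb : 1 ≤ b) (V : Finset (Fin x))
    (h : Fin (a + b) → Finset (Fin x) → (Fin 2 →₀ ℕ)) :
    {p : Fin 2 →₀ ℕ | p ∈ (Finset.univ.image fun f : Fin x → Fin (a + b) =>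
          ∑ d, h d (V ∩ Finset.univ.filter fun u => f u = d)) ∧
        ∃ t : ℝ, ∀ q ∈ (Finset.univ.image fun f : Fin x → Fin (a + b) =>
          ∑ d, h d (V ∩ Finset.univ.filter fun u => f u = d)), q ≠ p →
          t * ((q 0 : ℕ) : ℝ) + (-1) * ((q 1 : ℕ) : ℝ) < t * ((p 0 : ℕ) : ℝ) + (-1) * ((p 1 : ℕ) : ℝ)}.ncard + 2 ^ V.card ≤
      ∑ W ∈ V.powerset,
        ({p : Fin 2 →₀ ℕ | p ∈ (Finset.univ.image fun φ : Fin x → Fin a =>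
          ∑ d, h (Fin.castAdd b d) ((V \ W) ∩ Finset.univ.filter fun u => φ u = d)) ∧
            ∃ t : ℝ, ∀ q ∈ (Finset.univ.image fun φ : Fin x → Fin a =>
          ∑ d, h (Fin.castAdd b d) ((V \ W) ∩ Finset.univ.filter fun u => φ u = d)), q ≠ p →
              t * ((q 0 : ℕ) : ℝ) + (-1) * ((q 1 : ℕ) : ℝ) < t * ((p 0 : ℕ) : ℝ) + (-1) * ((p 1 : ℕ) : ℝ)}.ncard +
         {p : Fin 2 →₀ ℕ | p ∈ (Finset.univ.image fun ψ : Fin x → Fin b =>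
          ∑ d, h (Fin.natAdd a d) (W ∩ Finset.univ.filter fun u => ψ u = d)) ∧
            ∃ t : ℝ, ∀ q ∈ (Finset.univ.image fun ψ : Fin x → Fin b =>
          ∑ d, h (Fin.natAdd a d) (W ∩ Finset.univ.filter fun u => ψ u = d)), q ≠ p →
              t * ((q 0 : ℕ) : ℝ) + (-1) * ((q 1 : ℕ) : ℝ) < t * ((p 0 : ℕ) : ℝ) + (-1) * ((p 1 : ℕ) : ℝ)}.ncard) :=
  -- LANDED (p153208): Theorems/NewtonUnitEquationsNewtonTauWeakCoreSplittingRel.lean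
  Summit.ValiantsHypothesis.ValiantsHypothesis.Theorems.NewtonUnitEquationsNewtonTauWeak.stub_coreSplittingRel a b x ha hb V h

/-- STUB P12 (LANDED p153267; lead c7 session 3) — **two cores, base two**: a two-core design read through `V` has at most `2^{|V|}` lower-hull
vertices — indeed at most `2^{|V|}` POINTS: the image of `f ↦ h 0 (V ∩ f⁻¹0) + h 1 (V ∩ f⁻¹1)` is the image of `S ↦ h 0 (V \ S) + h 1 S` over `S ∈ V.powerset`
(`S := V ∩ f⁻¹ 1`; `Fin.sum_univ_two`), so `ncard ≤ card image ≤ card powerset = 2^{|V|}` (`Set.ncard_le_ncard` into the coerced finset, `Set.ncard_coe_Finset`,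
`Finset.card_image_le`, `Finset.card_powerset`). [folklore] -/
theorem stub_twoCoreChartRel (x : ℕ) (V : Finset (Fin x)) (h : Fin 2 → Finset (Fin x) → (Fin 2 →₀ ℕ)) :
    {p : Fin 2 →₀ ℕ | p ∈ (Finset.univ.image fun f : Fin x → Fin 2 =>
          ∑ d, h d (V ∩ Finset.univ.filter fun u => f u = d)) ∧
        ∃ t : ℝ, ∀ q ∈ (Finset.univ.image fun f : Fin x → Fin 2 =>
          ∑ d, h d (V ∩ Finset.univ.filter fun u => f u = d)), q ≠ p →
          t * ((q 0 : ℕ) : ℝ) + (-1) * ((q 1 : ℕ) : ℝ) < t * ((p 0 : ℕ) : ℝ) + (-1) * ((p 1 : ℕ) : ℝ)}.ncard ≤ 2 ^ V.card :=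
  -- LANDED (p153267): Theorems/NewtonUnitEquationsNewtonTauWeakTwoCoreChartRel.lean
  Summit.ValiantsHypothesis.ValiantsHypothesis.Theorems.NewtonUnitEquationsNewtonTauWeak.stub_twoCoreChartRel x V h

/-- STUB P13 (LANDED p153088; lead c7 session 3) — **core relabelling invariance**: relabelling the cores of a design along an equivalence
`e : Fin c' ≃ Fin c` does not change the cloud read through `V`: the image of `f ↦ Σ_{d : Fin c'} h (e d) (V ∩ f⁻¹ d)` over `f : Fin x → Fin c'` equals the
image of `f ↦ Σ_{d : Fin c} h d (V ∩ f⁻¹ d)` over `f : Fin x → Fin c` (`⊆`: for `f` take `e ∘ f` and reindex the sum with `Fintype.sum_equiv e` /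
`Equiv.sum_comp`, fibres `(e ∘ f)⁻¹ (e d) = f⁻¹ d` by `e.injective`; `⊇`: take `e.symm ∘ f`). [folklore] -/
theorem stub_coreRelabel (c c' x : ℕ) (e : Fin c' ≃ Fin c) (V : Finset (Fin x)) (h : Fin c → Finset (Fin x) → (Fin 2 →₀ ℕ)) :
    (Finset.univ.image fun f : Fin x → Fin c' =>
          ∑ d, h (e d) (V ∩ Finset.univ.filter fun u => f u = d)) =
      (Finset.univ.image fun f : Fin x → Fin c =>
          ∑ d, h d (V ∩ Finset.univ.filter fun u => f u = d)) :=
  -- LANDED (p153088): Theorems/NewtonUnitEquationsNewtonTauWeakCoreRelabel.lean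
  Summit.ValiantsHypothesis.ValiantsHypothesis.Theorems.NewtonUnitEquationsNewtonTauWeak.stub_coreRelabel c c' x e V h

/-- **The logarithmic base bound (PROVED; P11 + P12 + P13 by induction on `k`, LANDED p153582 as
`Theorems/NewtonUnitEquationsNewtonTauWeakCoreLogBound.lean`).**  For `1 ≤ k`, a design on `2^k` cores read through any `V` has at most
`2^{k−1}·(k+1)^{|V|}` lower-hull vertices: `f(2^k) ≤ k + 1`, i.e. `f(c) ≤ 1 + ⌈log₂ c⌉` — the `c`-core sign-design kill family can only
beat `T2(b)`'s allowance `4^b` with `c ≥ 2^{4^b}` cores (card §9.1(b)). -/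
theorem coreChart_logBound (x k : ℕ) (hk : 1 ≤ k) (V : Finset (Fin x))
    (h : Fin (2 ^ k) → Finset (Fin x) → (Fin 2 →₀ ℕ)) :
    {p : Fin 2 →₀ ℕ | p ∈ (Finset.univ.image fun f : Fin x → Fin (2 ^ k) =>
          ∑ d, h d (V ∩ Finset.univ.filter fun u => f u = d)) ∧
        ∃ t : ℝ, ∀ q ∈ (Finset.univ.image fun f : Fin x → Fin (2 ^ k) =>
          ∑ d, h d (V ∩ Finset.univ.filter fun u => f u = d)), q ≠ p →
          t * ((q 0 : ℕ) : ℝ) + (-1) * ((q 1 : ℕ) : ℝ) < t * ((p 0 : ℕ) : ℝ) + (-1) * ((p 1 : ℕ) : ℝ)}.ncard ≤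
      2 ^ (k - 1) * (k + 1) ^ V.card :=
  Summit.ValiantsHypothesis.ValiantsHypothesis.Theorems.NewtonUnitEquationsNewtonTauWeak.coreChart_logBound x k hk V h

/-! #### Stubs P14–P15 (lead c7, session 3, wave 5) — the kill switch in design language; two cores are hereditarily perfect

P14 transports `exactCoverShadow_of_T2` to the design language used by P6–P13: the `c`-core design cloud `{Σ_d h d (f⁻¹ d)}` IS the
exact-cover cloud of the block family `{κ_d} ∪ S` (items `Fin c × Finset (Fin x)`, coordinates `Fin (x + c)`), so `T2(b)` bounds its strictly
positively exposed points by `(2^{x+c}·(c·2^x) + 2)^b` — for every `c` at once (P5/`threeCore_vs_T2` is the case `c = 3` with a specific design).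
With `coreChart_logBound` this closes the formal circle of card §2/§9: refuting T2 through this family needs a design with more than
`(2^{x+c} c 2^x + 2)^b` exposed points, while every design has at most `2^{k−1}(k+1)^x` (`c = 2^k`).  P15 records that the `k = 1` level is
hereditarily tight: the two-core design `h 1 S = (B S, (B S)²)`, `h 0 = 0` has ALL `2^{|V|}` configurations as lower-hull vertices through every `V`
("robust capacity 2", card §9.7). -/

/-- STUB P14 (LANDED p155012; lead c7 session 3) — **the sign-design kill switch in design language.**  If the open stub holds with exponent
`b`, then for EVERY `c`, `x` and every `c`-core design `h`, the strictly positively exposed points of `{Σ_d h d (f⁻¹ d) : f : Fin x → Fin c}` number at most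
`(2^{x+c}·(c·2^x) + 2)^b`.  Proof: index items by `e : Fin (c * 2^x) ≃ Fin c × Finset (Fin x)` (`Fintype.equivFinOfCardEq`), coordinates `Fin (x + c)` with
attached `u ↦ Fin.castAdd c u` and cores `d ↦ Fin.natAdd x d`, labels `g j k = 1 ↔ k = natAdd x (e j).1 ∨ ∃ u ∈ (e j).2, k = castAdd c u` (else `0`), costs
`ε j := h (e j).1 (e j).2`; exact covers are exactly `J_f := univ.image (fun d => e.symm (d, f⁻¹ d))` (one item per core; the attached parts partition `univ`
— generalise `ThreeCoreExposedAux.cover_triple_iff` / `eq_triple_of_cover` from `Fin 3` to `Fin c`), and `Σ_{j ∈ J_f} ε j = Σ_d h d (f⁻¹ d)`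
(`Finset.sum_image` with `e.symm` injective); hence the exposed set of the statement EQUALS the exposed exact-cover set of
`exactCoverShadow_of_T2 b hT2 (c * 2^x) (x + c) g ε` (same points, and strictness quantifies over the same point set), whose `ncard` is bounded there. [folklore] -/
theorem stub_coreDesignKillSwitch (b : ℕ)
    (hT2 : ∀ (K N : ℕ) (c : Fin K → ℂ) (ρ : Fin K → Fin N → ℂ) (d : Fin N → (Fin 2 →₀ ℕ)),
      vert (∑ l, C (c l) * ∏ j, (1 - C (ρ l j) * monomial (d j) 1)) ≤ (K * N + 2) ^ b)
    (c x : ℕ) (h : Fin c → Finset (Fin x) → (Fin 2 →₀ ℕ)) :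
    {q : Fin 2 →₀ ℕ | (∃ f : Fin x → Fin c, ∑ d, h d (Finset.univ.filter fun u => f u = d) = q ∧
          ∃ w : Fin 2 → ℝ, 0 < w 0 ∧ 0 < w 1 ∧ ∀ f' : Fin x → Fin c,
            ∑ d, h d (Finset.univ.filter fun u => f' u = d) ≠ q →
            w 0 * ((q 0 : ℕ) : ℝ) + w 1 * ((q 1 : ℕ) : ℝ) <
              w 0 * (((∑ d, h d (Finset.univ.filter fun u => f' u = d)) 0 : ℕ) : ℝ) +
                w 1 * (((∑ d, h d (Finset.univ.filter fun u => f' u = d)) 1 : ℕ) : ℝ))}.ncard ≤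
      (2 ^ (x + c) * (c * 2 ^ x) + 2) ^ b :=
  -- LANDED (p155012): Theorems/NewtonUnitEquationsNewtonTauWeakCoreDesignKillSwitch.lean
  Summit.ValiantsHypothesis.ValiantsHypothesis.Theorems.NewtonUnitEquationsNewtonTauWeak.stub_coreDesignKillSwitch b hT2 c x h

/-- STUB P15 (LANDED p155135; lead c7 session 3) — **two cores are hereditarily perfect.**  There is a two-core design all of whose restrictions
are full lower hulls: with `B S := Σ_{u ∈ S} 3^u` (any weights with distinct subset sums do), `h 1 S := (B S, (B S)^2)` (as `Finsupp.single 0 (B S) +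
Finsupp.single 1 ((B S)^2)`) and `h 0 S := 0`, every configuration point `(B S, (B S)²)`, `S = V ∩ f⁻¹ 1`, is the STRICT maximiser over the `V`-relative
cloud of `t x₀ − x₁` for `t := 2 B S` (`2 B B' − B'^2 < B^2 ⟺ 0 < (B − B')^2`, and `B` is injective on `V.powerset`: base-3 digits,
cf. `ThreeCoreExposedAux.digitSum_injective`), so the chart set has `ncard ≥ 2^{|V|}` (inject `V.powerset` by `S ↦ (B S, (B S)^2)`,
`Set.ncard_le_ncard` / `Finset.card_le_card_of_injOn`).  Hence P12 and the `k = 1` case of `coreChart_logBound` are tight through every `V`. [folklore] -/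
theorem stub_twoCorePerfect (x : ℕ) :
    ∃ h : Fin 2 → Finset (Fin x) → (Fin 2 →₀ ℕ), ∀ V : Finset (Fin x),
      2 ^ V.card ≤
        {p : Fin 2 →₀ ℕ | p ∈ (Finset.univ.image fun f : Fin x → Fin 2 =>
              ∑ d, h d (V ∩ Finset.univ.filter fun u => f u = d)) ∧
            ∃ t : ℝ, ∀ q ∈ (Finset.univ.image fun f : Fin x → Fin 2 =>
              ∑ d, h d (V ∩ Finset.univ.filter fun u => f u = d)), q ≠ p →
              t * ((q 0 : ℕ) : ℝ) + (-1) * ((q 1 : ℕ) : ℝ) < t * ((p 0 : ℕ) : ℝ) + (-1) * ((p 1 : ℕ) : ℝ)}.ncard :=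
  -- LANDED (p155135): Theorems/NewtonUnitEquationsNewtonTauWeakTwoCorePerfect.lean
  Summit.ValiantsHypothesis.ValiantsHypothesis.Theorems.NewtonUnitEquationsNewtonTauWeak.stub_twoCorePerfect x

/-- **THE KILL CRITERION OF THE SIGN-DESIGN FAMILY, FORMALLY (PROVED from P14).**  If for every exponent `b` some `c`-core design has MORE than
`(2^{x+c}·(c·2^x) + 2)^b` strictly positively exposed configuration points, then the open stub `BinomialNewtonTauCommon` (= T2) is FALSE.
By `coreChart_logBound` such designs need `c ≥ 2^{4^b}` cores (and by the three-bin-law conjecture they do not exist at all). -/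
theorem not_binomialNewtonTauCommon_of_designs
    (hbig : ∀ b : ℕ, ∃ (c x : ℕ) (h : Fin c → Finset (Fin x) → (Fin 2 →₀ ℕ)),
      (2 ^ (x + c) * (c * 2 ^ x) + 2) ^ b <
        {q : Fin 2 →₀ ℕ | (∃ f : Fin x → Fin c, ∑ d, h d (Finset.univ.filter fun u => f u = d) = q ∧
          ∃ w : Fin 2 → ℝ, 0 < w 0 ∧ 0 < w 1 ∧ ∀ f' : Fin x → Fin c,
            ∑ d, h d (Finset.univ.filter fun u => f' u = d) ≠ q →
            w 0 * ((q 0 : ℕ) : ℝ) + w 1 * ((q 1 : ℕ) : ℝ) <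
              w 0 * (((∑ d, h d (Finset.univ.filter fun u => f' u = d)) 0 : ℕ) : ℝ) +
                w 1 * (((∑ d, h d (Finset.univ.filter fun u => f' u = d)) 1 : ℕ) : ℝ))}.ncard) :
    ¬ BinomialNewtonTauCommon := by
  rintro ⟨b, hb⟩
  obtain ⟨c, x, h, hlt⟩ := hbig b
  exact absurd (stub_coreDesignKillSwitch b hb c x h) (not_le.mpr hlt)

/-! #### Stub P16 (lead c7, session 3, wave 6) — axial 3-assignments halve (card §1, §9.9)

The bounded-block theorem of card §9.9 fences every exact-cover family of bounded block size; its 3-partite sub-type `(1,1,1)` is the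
AXIAL 3-ASSIGNMENT family (points `R ⊔ P ⊔ C`, blocks = transversal triples), whose halving is literally Hrubeš–Yehudayoff's proof of
`σ(DS_n) ≤ 2^{O(n)}` (tree: `Literature/Computability/AlgebraicComplexity/BirkhoffShadowProofs.lean`, pencil/`UM` framework) run with
PAIRS of bijections: condition on the row-set AND the pillar-set used by the first half of the columns (`4^m` data), Minkowski-add the two
sub-assignments.  P16 records it in the pencil counting form of that file. -/

/-- STUB P16 (LANDED p156469; lead c7 session 3) — **axial 3-assignment shadows are `2^{O(m)}`** (pencil counting form).  For finite types
`R, P, C` with `#C = m`, weights `w : R → P → C → ℝ²` and any pencil `c + t•d` of additive functionals, the sums `Σ_x w (e₁ x) (e₂ x) x` over pairs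
of bijections `(e₁, e₂) : (C ≃ R) × (C ≃ P)` have at most `2^{6m}` uniquely supported points.  Proof = `HrubesYehudayoff2021Prop23.ncard_um_permSums_le`
with pairs: (i) if `#R ≠ #C` or `#P ≠ #C` the range is empty; (ii) `m ≤ 1`: at most one point... (a singleton range when `m = 0`; for `m = 1` the range
has `≤ #R·#P = 1` point); (iii) split `C₁ ⊆ C` with `#C₁ = ⌊m/2⌋`; the range equals `⋃_{(S,T) : Finset R × Finset P} (range over
({x // x ∈ C₁} ≃ {r // r ∈ S}) × ({x // x ∈ C₁} ≃ {p // p ∈ T}) + range over the complements)` (pattern `permSums_eq_iUnion`, gluing pairs of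
bijections with `Equiv.sumCongr`/`subtypeEquiv` exactly as there, twice); (iv) `ncard_um_iUnion_le` + `ncard_um_add_le` give
`f(m) ≤ 4^{max(#R,#P,…)}·…` — precisely `UM ≤ 2^{#R} · 2^{#P} · (B₁ + B₂)` with `#R = #P = m` in the nonempty case; (v) induction on `m`
(strong): `2^{2m}·(2^{6⌊m/2⌋} + 2^{6⌈m/2⌉}) ≤ 2^{6m}` for `m ≥ 2`. [folklore] -/
theorem stub_axialShadow (m : ℕ) :
    ∀ (R P C : Type) [Fintype R] [Fintype P] [Fintype C] [DecidableEq R] [DecidableEq P] [DecidableEq C],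
      Fintype.card C = m → ∀ (c d : (Fin 2 → ℝ) →+ ℝ) (w : R → P → C → (Fin 2 → ℝ)),
        {p : Fin 2 → ℝ | p ∈ Set.range (fun e : (C ≃ R) × (C ≃ P) => ∑ x, w (e.1 x) (e.2 x) x) ∧
          ∃ t : ℝ, ∀ q ∈ Set.range (fun e : (C ≃ R) × (C ≃ P) => ∑ x, w (e.1 x) (e.2 x) x), q ≠ p →
            c q + t * d q < c p + t * d p}.ncard ≤ 2 ^ (6 * m) :=
  -- LANDED (p156469): Theorems/NewtonUnitEquationsNewtonTauWeakAxialShadow.lean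
  Summit.ValiantsHypothesis.ValiantsHypothesis.Theorems.NewtonUnitEquationsNewtonTauWeak.stub_axialShadow m

end RungC7b

/-! ### Name-keyed alias of the remaining open statement (the hypothesis of the composition; the skeleton audit
admits a hypothesis only if its head constant is a registered obligation or is named like a declared stub) -/
namespace Registered

/-- Alias of `BinomialNewtonTauCommon` keyed by the registered stub name. -/
abbrev stub_binomialNewtonTauCommon : Prop := BinomialNewtonTauCommon

end Registered

/-! ### Composition (PROVED): the open stub gives the crux BY NAME (stubs 1–2 are theorems now) -/

/-- **The line closes the crux modulo `stub_binomialNewtonTauCommon`.** From `BinomialNewtonTauCommon` with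
exponent `b`, STUB 3a gives `BinomialBound (2b)`, STUB 2 (landed, p86119) the powers bound with constants
`(4b, 4b)`, STUB 1 (landed, p85961) the crux's bound with constants `(12b, 4b)`; `NewtonTauWeak` is
`∃ a b, SpsBound a b` definitionally (`vert` is the crux's literal subterm). -/
theorem NewtonTauWeak_of (h₃ : Registered.stub_binomialNewtonTauCommon) : NewtonTauWeak := by
  obtain ⟨b, hb⟩ := h₃
  exact ⟨2 * (2 * b) + 2 * (2 * (2 * b)), 2 * (2 * b),
    stub_fischerStep (2 * (2 * b)) (2 * (2 * b)) (stub_binomialStep (2 * b) (stub_commonStep b hb))⟩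

/-- The composition instantiated with the registered stub (so the audit sees the crux closed BY NAME from
`stub_*` only; this theorem becomes the crux proof when the last `sorry` is discharged). -/
theorem NewtonTauWeak_of_stubs : NewtonTauWeak :=
  NewtonTauWeak_of stub_binomialNewtonTauCommon

/-- Equivalently: the crux follows from `BinomialNewtonTau` (KPTT Conj. 1 at `t = 2`, polynomial form) — an
UNCONDITIONAL implication now that both reductions are theorems of the tree. -/
theorem newtonTauWeak_of_binomialNewtonTau (h : BinomialNewtonTau) : NewtonTauWeak :=
  NewtonTauWeak_of (binomialNewtonTauCommon_of_binomialNewtonTau h)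

/-! ### Calibration (PROVED): where the stubs sit -/

/-- A constant has at most one Newton vertex. -/
theorem vert_C_le_one (a : ℂ) : vert (C a : MvPolynomial (Fin 2) ℂ) ≤ 1 := by
  refine (vert_le_card_support _).trans ?_
  rw [C_apply]
  exact (Finset.card_le_card support_monomial_subset).trans (by simp)

/-- **T1 is an equivalence (easy direction): the crux's bound implies the powers bound with the SAME
constants** — a power `c·g^m` is the product `(c g)·g⋯g` of `m` `t`-sparse factors. Hence `stub_fischerStep`'s
hypothesis `PowersWeak` is not stronger than the crux (no costume): `PowersWeak ↔ NewtonTauWeak`. -/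
theorem powersBound_of_spsBound {a b : ℕ} (h : SpsBound a b) : PowersBound a b := by
  intro k m t c g hg
  cases m with
  | zero =>
    have h1 : vert (∑ i, C (c i) * g i ^ 0) ≤ 1 := by
      have : (∑ i, C (c i) * g i ^ 0) = C (∑ i, c i) := by rw [map_sum]; simp
      rw [this]
      exact vert_C_le_one _
    calc vert (∑ i, C (c i) * g i ^ 0) ≤ 1 := h1
      _ ≤ 2 ^ (a * 0) * (k * t + 2) ^ b := by
          rw [Nat.mul_zero, pow_zero, one_mul]
          exact Nat.one_le_pow _ _ (by omega)
  | succ n =>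
    -- present `c_i g_i^{n+1}` as the product of the `n+1` factors `(c_i g_i), g_i, …, g_i`
    let f : Fin k → Fin (n + 1) → MvPolynomial (Fin 2) ℂ := fun i => Fin.cons (C (c i) * g i) fun _ => g i
    have hf : ∀ i j, (f i j).support.card ≤ t := by
      intro i j
      refine Fin.cases ?_ (fun j => ?_) j
      · simp only [f, Fin.cons_zero]
        rw [C_mul']
        exact (Finset.card_le_card (support_smul)).trans (hg i)
      · simp only [f, Fin.cons_succ]
        exact hg i
    have hprod : ∀ i, (∏ j, f i j) = C (c i) * g i ^ (n + 1) := by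
      intro i
      rw [Fin.prod_univ_succ]
      simp only [f, Fin.cons_zero, Fin.cons_succ, Finset.prod_const, Finset.card_univ, Fintype.card_fin]
      ring
    have := h k (n + 1) t f hf
    simpa only [hprod] using this

/-- The powers form in the weak shape follows from the crux (with the same constants). -/
theorem powersWeak_of_newtonTauWeak (h : NewtonTauWeak) : PowersWeak := by
  obtain ⟨a, b, h⟩ := h
  exact ⟨a, b, powersBound_of_spsBound h⟩

/-- **Upper calibration: the printed conjecture implies `C⁺`.** KPTT's Conjecture 1 as catalogued
(`Literature.….KPTT.newtonTauConjecture`: `vert ≤ (k m t+2)^C`) gives `BinomialNewtonTau` with exponent `3C`: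
a scalar times a product of `N` binomials is a product of `N+1` factors of sparsity `≤ 2`, and
`2K(N+1)+2 ≤ (K N+2)^3` for `N ≥ 1` (`N = 0`: constants). So STUB 3 is no stronger than Conjecture 1. -/
theorem binomialNewtonTau_of_newtonTauConjecture
    (h : Literature.Computability.AlgebraicComplexity.KPTT.newtonTauConjecture) : BinomialNewtonTau := by
  obtain ⟨C₀, hC⟩ := h
  refine ⟨3 * C₀, fun K N c ρ d => ?_⟩
  cases N with
  | zero =>
    have h1 : vert (∑ l, C (c l) * ∏ j : Fin 0, (1 - C (ρ l j) * monomial (d l j) 1)) ≤ 1 := by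
      have : (∑ l, C (c l) * ∏ j : Fin 0, (1 - C (ρ l j) * monomial (d l j) 1)) = C (∑ l, c l) := by
        rw [map_sum]; simp
      rw [this]
      exact vert_C_le_one _
    calc vert (∑ l, C (c l) * ∏ j : Fin 0, (1 - C (ρ l j) * monomial (d l j) 1)) ≤ 1 := h1
      _ ≤ (K * 0 + 2) ^ (3 * C₀) := Nat.one_le_pow _ _ (by omega)
  | succ n =>
    -- the `K` products of `n+2` factors: the scalar `C (c l)` first, then the `n+1` binomials
    let F : Fin K → Fin (n + 2) → MvPolynomial (Fin 2) ℂ := fun l =>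
      Fin.cons (C (c l)) fun j => 1 - C (ρ l j) * monomial (d l j) 1
    have hF : ∀ l j, (F l j).support.card ≤ 2 := by
      intro l j
      refine Fin.cases ?_ (fun j => ?_) j
      · simp only [F, Fin.cons_zero]
        rw [C_apply]
        exact (Finset.card_le_card support_monomial_subset).trans (by simp)
      · simp only [F, Fin.cons_succ]
        calc (1 - C (ρ l j) * monomial (d l j) (1 : ℂ)).support.card
            ≤ ((1 : MvPolynomial (Fin 2) ℂ).support ∪ (C (ρ l j) * monomial (d l j) (1 : ℂ)).support).card :=
              Finset.card_le_card (support_sub ..)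
          _ ≤ (1 : MvPolynomial (Fin 2) ℂ).support.card + (C (ρ l j) * monomial (d l j) (1 : ℂ)).support.card :=
              Finset.card_union_le _ _
          _ ≤ 1 + 1 := by
              gcongr
              · rw [support_one]; simp
              · rw [C_mul_monomial]
                exact (Finset.card_le_card support_monomial_subset).trans (by simp)
    have hprod : ∀ l, (∏ j, F l j) = C (c l) * ∏ j : Fin (n + 1), (1 - C (ρ l j) * monomial (d l j) 1) := by
      intro l
      rw [Fin.prod_univ_succ]
      simp only [F, Fin.cons_zero, Fin.cons_succ]
    have hle := hC K (n + 2) 2 F hF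
    change vert (∑ l, ∏ j, F l j) ≤ (K * (n + 2) * 2 + 2) ^ C₀ at hle
    simp only [hprod] at hle
    refine hle.trans ?_
    -- arithmetic: `(2K(n+2)+2)^C₀ ≤ ((K(n+1)+2)^3)^C₀`
    rw [pow_mul]
    apply Nat.pow_le_pow_left
    obtain ⟨P, hP⟩ : ∃ P, P = K * n := ⟨_, rfl⟩
    have e1 : K * (n + 2) * 2 + 2 = 2 * P + 4 * K + 2 := by rw [hP]; ring
    have e2 : K * (n + 1) + 2 = P + K + 2 := by rw [hP]; ring
    rw [e1, e2]
    have h2 : 2 ≤ P + K + 2 := by omega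
    calc 2 * P + 4 * K + 2 ≤ (P + K + 2) * 2 * 2 := by omega
      _ ≤ (P + K + 2) * (P + K + 2) * (P + K + 2) := by gcongr
      _ = (P + K + 2) ^ 3 := by ring

/-- **Lower calibration against the landed Negative lemma** (`two_mul_le_vert_zProd`, the witness of
`not_newtonTauBoundNoM`): the exponent in `BinomialNewtonTau` cannot be `1`. The zonogon
`Π_{j<3}(1 + X Y^j)` is the instance `K = 1`, `N = 3`, `c = 1`, `ρ = -1`, `d_j = (1, j)` of `BinomialBound`,
and it has `≥ 2·3 = 6 > 1·3 + 2` vertices. (For `b ≥ 2` the zonogon is consistent: `2N ≤ (N+2)^2`.) -/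
theorem not_binomialBound_one : ¬ BinomialBound 1 := by
  intro h
  have hle := h 1 3 (fun _ => 1) (fun _ _ => -1) (fun _ j => v (j : ℕ))
  have hsum : (∑ _l : Fin 1, C (1 : ℂ) * ∏ j : Fin 3, (1 - C (-1 : ℂ) * monomial (v (j : ℕ)) (1 : ℂ))) =
      zProd 3 := by
    rw [Fin.sum_univ_one, C_1, one_mul]
    have : ∀ j : Fin 3, (1 - C (-1 : ℂ) * monomial (v (j : ℕ)) (1 : ℂ) : MvPolynomial (Fin 2) ℂ) =
        zFactor (j : ℕ) := by
      intro j
      simp only [zFactor, map_neg, C_1, neg_mul, one_mul, sub_neg_eq_add]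
    simp_rw [this]
    exact Fin.prod_univ_eq_prod_range zFactor 3
  rw [hsum] at hle
  have hlow := Summit.ValiantsHypothesis.ValiantsHypothesis.Theorems.NewtonTauWeak.Negative.two_mul_le_vert_zProd 3
  norm_num at hle
  omega

end Summit.ValiantsHypothesis.ValiantsHypothesis.Cruxes.NewtonTauWeak.BinomialNormalForm

end
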